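import Literature.NumberTheory.LFunctions.DirichletLOneHalfLogBoundOdd
import Mathlib.NumberTheory.Harmonic.GammaDeriv
import Mathlib.MeasureTheory.Integral.Gamma
import Mathlib.Analysis.SpecialFunctions.Gaussian.GaussianIntegral
import Mathlib.Analysis.SpecialFunctions.Pow.Asymptotics
import HarnessLib

/-!
# Odd primitive Dirichlet characters: `|L(1, χ)| ≤ ½ (log q + κ₁)` with Louboutin's PRINTED constant `κ₁ = 2 + γ − log π`, and `|L(1, χ)| ≤ (1 − β) log² q/8` with the PRINTED `log² q` (both proved)

Topic `Literature/NumberTheory/LFunctions`, namespace `Literature.NumberTheory.LFunctions.Louboutin2001`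
(fourth file of the story `DirichletLOneHalfLogBoundEven` → `DirichletLOneRealZeroBoundEvenQuadratic` →
`DirichletLOneHalfLogBoundOdd`). Everything here is PROVED from Mathlib and the tree; no named facts. Typed by
the literature-typing seat `littype-FP2-1` (cell `parity-realchar`, D-0088 (4) row (7), conditionals column /
instrument provenance): the sibling file `DirichletLOneHalfLogBoundOdd` reaches Louboutin's Lemma 6
(`(q/π)|L(1, χ)| ≤ I₁(q)`, kernel `div_pi_mul_norm_LFunction_one_le_oddMajorant`) but evaluates `I₁(q)` only with
the elementary constant `2.6` («the printed `κ₁ = 1.4325…` is NOT reached», its item 3); this file evaluates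
`I₁(q)` with the printed constant, by an elementary route with two EXACT inputs from Mathlib
(`Γ′(1) = −γ`: `Real.hasDerivAt_Gamma_one`; `∫₀^∞ e^{−u²} du = √π/2`: `integral_gaussian_Ioi`).

## Source, as printed (read first-hand: text PDF `paper:doi-10-4064-aa121-3-1`, pp. 200–206)

S. Louboutin, *Lower bounds for relative class numbers of imaginary abelian number fields and CM-fields*,
Acta Arith. 121 (2006) 199–220 [Louboutin2006RelativeClassNumbers].
* **(1)** p. 200: «`κ₀ := 2 + γ − log(4π) = 0.046191…`, `κ₁ := 2 + γ − log π = 1.432485…`.»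
  **Theorem 1** (p. 200): «Let `χ` be a primitive Dirichlet character modulo `f > 1`. (i) We have
  **(2)** `|L(1, χ)| ≤ ½ (log f + κ_χ)` where `κ_χ := κ₀` if `χ` is even, `κ₁` if `χ` is odd.»
* **Lemma 6** (pp. 203–204): «If `χ` is odd, then `(f/π)|L(1, χ)| = |Λ(1, χ)| ≤ I₁(f)`» — the tree's
  `div_pi_mul_norm_LFunction_one_le_oddMajorant` with `I₁(q) = oddMajorant q = ∫₁^∞ T₁(t/q)(1 + t^{−1/2}) dt`,
  `T₁(u) = Σ_{n≥1} n e^{−πn²u}` (Lemma 4 p. 202 / (11) p. 203).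
* **Lemma 9 (15)** (p. 206): «`I₁(f) = (f/2π)(log f + κ₁) − ½√f + ¼ + θ√(2ζ(3)/(π⁵f)) K₁ ≤ (f/2π)(log f + κ₁)` for
  `f ≥ 3`» (contour shift of (7) to `Re s = −1/2`; `K₁` a numerical integral of Lemma 8).
* **Theorem 1 (ii) (3)** (p. 200): «if `χ` is quadratic, `½ ≤ β < 1` and `L(β, χ) = 0`, then
  `L(1, χ) ≤ (1 − β) log² f/8`»; **Lemma 9 (17)** (p. 206): «`Ĩ₁(f) = (f/4π)((log f − κ₁′)² + κ₁″) + ¼√f(log f + κ₁′)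
  + ¼ + θK̃₁/√(π⁵f) ≤ (f/4π) log² f` (`f ≥ 3`)», where `Ĩ₁(f) = ∫₁^∞ T₁(t/f)(log t)(1 − t^{−1/2}) dt` is the tree's
  `logMajorantOdd` (the sibling file proves only `Ĩ₁(q) ≤ (q/4π)(log q + ½)²`, its item 6).

## What is proved, and how (the elementary substitute for the contour shift)

Write `a = π/q`, `h = √a`. Integrating the theta series termwise (`oddMajorant_eq_tsum`):
`I₁(q) = (q/π) S₁ + (2/h) Σ_{n≥1} G(nh)`, `S₁ = Σ_{n≥1} e^{−an²}/n`, `G(y) = ∫_y^∞ e^{−u²} du` (`gaussianTail`;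
`∫₁^∞ e^{−k²t} dt/√t = (2/k) G(k)` by the substitution `u = k√t`).
1. `integral_expDiff_div`: **`∫₀^∞ (e^{−x²} − e^{−x}) dx/x = γ/2`** — for `s > 0` the integral against
   `x^{s−1}` is `½Γ(s/2) − Γ(s) = (Γ(1 + s/2) − Γ(1 + s))/s → −Γ′(1)/2 = γ/2` (`s → 0⁺`), and dominated
   convergence (bound `2e·e^{−x}`).
2. `tsum_exp_neg_sq_div_le`: **`S₁ ≤ ½ log(1/a) + γ/2 + 0.26 a`** (`0 < h ≤ 2`; true value
   `½ log(1/a) + γ/2 + a/12 + O(a²)`): `e^{−an²}/n = F_h(n) + e^{−hn}/n` with `F_h(x) = (e^{−h²x²} − e^{−hx})/x = hφ(hx)`,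
   `φ(y) = (e^{−y²} − e^{−y})/y`; `Σ e^{−hn}/n = −log(1 − e^{−h}) ≤ log(1/h) + h/2` (`e^{y} − e^{−y} ≥ 2y`); the
   MIDPOINT Euler–Maclaurin rule (`le_integral_cell`: `f(c) ≤ ∫_{c−½}^{c+½} f + ⅛ ∫ m` whenever `f″ ≥ −m`,
   `m ≥ 0`, from the second-order Taylor formula with integral remainder `integral_eq_taylor_two`) gives
   `Σ_{n≥1} F_h(n) ≤ ∫_{1/2}^∞ F_h + ⅛ ∫_{1/2}^∞ (F_h″)⁻ = γ/2 − ∫₀^{h/2} φ + ⅛ ∫ (F_h″)⁻`, where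
   `∫₀^{h/2} φ ≥ h/2 − (3/16) h²` (`φ(y) ≥ 1 − 3y/2`), `F_h″ ≥ 0` for `hx ≤ 6/5` (`numer_nonneg`: the numerator
   `e^{−y²}(4y⁴ + 2y² + 2) − e^{−y}(y² + 2y + 2)` vanishes at `0` and increases on `[0, 6/5]`) and
   `F_h″ ≥ −e^{−hx}(h²x² + 2hx + 2)/x³`, whose antiderivative is `−e^{−hx}(h/x + 1/x²)` (`hasDerivAt_W`), so
   `⅛ ∫ (F_h″)⁻ ≤ ⅛ e^{−6/5} (55/36) h² ≤ 0.07 h²`.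
3. `tsum_gaussianTail_le` (private): **`Σ_{n≥1} G(nh) ≤ h⁻¹(½ − (√π/4) h + h²/8)`** — the same midpoint rule with
   `m = 0` (`G` is convex on `[0, ∞)`), `∫ G = [yG(y) + (1 − e^{−y²})/2]`, `yG(y) ≤ ½ e^{−y²}`, `G(y) ≥ √π/2 − y`.
4. `oddMajorant_le_sharp`: **`I₁(q) ≤ (q/2π)(log q + κ₁)` for every real `q ≥ 2`** — the two bounds give
   `I₁(q) ≤ (q/2π)(log q − log π + γ + 2) + 0.51 − ½√q`, and `½√q ≥ 0.51` for `q ≥ 2` (Louboutin: `f ≥ 3`; the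
   slack `½√q − ¼ − O(1)` of (15) absorbs the elementary losses for all `q ≥ 2`).
5. `norm_LFunction_one_le_half_log_add_kappaOdd` / `norm_LFunction_one_le_of_odd_sharp` — **Theorem 1 (i) (2), odd
   case, as printed**: `|L(1, χ)| ≤ ½(log q + κ₁)` for every odd primitive `χ` mod `q`;
   `norm_LFunction_one_le_of_isPrimitive_sharp` — parity-free: `|L(1, χ)| ≤ ½ log q + κ₁/2` for every primitive
   `χ ≠ 1` (even case from `norm_LFunction_one_le`, `κ₀ ≤ κ₁`); decimal `norm_LFunction_one_le_of_isPrimitive_d4`: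
   `½ log q + 0.7163` (`kappaOdd_div_two_lt`, from the tree's `eulerMascheroniConstant_lt_d8`, `log_pi_gt_d20`).
6. `logMajorantOdd_le_sharp`: **`Ĩ₁(q) ≤ (q/4π) log² q` for every real `q ≥ 3`** (Lemma 9 (17) with the printed
   right-hand side), again without the contour shift: `Ĩ₁(q) = Σ_n n∫₁^∞ e^{−an²t} log t dt − Σ_n n∫₁^∞ e^{−an²t}
   (log t) t^{−1/2} dt` termwise (Tonelli, `logMajorantOdd_le_aux`); the first series is `∫₁^∞ S₁(at) dt/(at)`
   (integration by parts `∫₁^∞ e^{−ct} log t = c⁻¹∫₁^∞ e^{−ct}/t`), bounded on `[1, 1.2/a]` by item 2 and beyond by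
   `E₁(x) ≤ e^{−x} log(1 + 1/x)` (`integral_exp_inv_le`) — `logPart_summable_and_le`; the second is
   `4∫₁^∞ T₁(au²) log u du ≥ 4∫₁^{(15/16)√q} (0.999/(2au²) − 0.181) log u du` by the midpoint-rule LOWER bound
   `Σ_{n≤N} n e^{−bn²} ≥ (e^{−b/4} − e^{−b(N+½)²})/(2b) − e^{−3/2}/4` (`sum_succ_mul_exp_ge`) — `sqrtPart_ge`; the
   resulting explicit inequality is, in `λ = ½ log q`, `g(λ) = e^{2λ}(c₁λ + D)/π + e^{λ}(c₃ − c₂λ) − 0.464 ≥ 0`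
   (`g17_nonneg`: `g(½ log 3) ≈ 0.07 > 0` and `g′ ≥ 0` from `e^{λ} ≥ 1 + λ + λ²/2`; margin `≈ 4 %` at `q = 3`,
   `≥ 11 %` for all `q`, asymptotically `(log π − γ) q log q/(2π)`).
7. `norm_LFunction_one_le_of_zero_of_odd_sharp` (and `…_of_half_le_sharp`) — **Theorem 1 (ii) (3), odd quadratic
   case, as printed**: `L(β, χ) = 0`, `0 < β < 1` ⟹ `|L(1, χ)| ≤ (1 − β) log² q/8` (Lemma 3 (4), the kernel
   inequality `xiKernelOdd_one_sub_le`, `|ϑ₁| ≤ 2T₁`, item 6; `β < ½` reduced to `1 − β` by (5) with `W(χ) = 1`).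

All other declarations are private helpers ([folklore]). LABEL (cell rule): instrument / statement layer
(kernel theorems); nothing here bears on parity. No facts, no axioms, no instances, no notation.

## References

* [Louboutin2006RelativeClassNumbers] S. Louboutin, Acta Arith. 121 (2006) 199–220: (1)–(3) and Theorem 1
  p. 200; Lemma 3 (4)–(5) p. 201; Lemma 4 / Prop. 5 (7) p. 202; Lemma 6 pp. 203–204; Lemma 9 (15), (17) p. 206.
* [Louboutin2001CJM] S. Louboutin, Canad. J. Math. 53 (2001) 1194–1222, p. 1197: the odd-character constant
  `½(log f_χ + 2 + γ − log π)` is [Lou4] = C. R. Acad. Sci. Paris 323 (1996) 443–446.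
-/

noncomputable section

open Real MeasureTheory Filter Topology Set

namespace Literature.NumberTheory.LFunctions

namespace Louboutin2001

/-! ### The exact constant `∫₀^∞ (e^{−x²} − e^{−x}) dx/x = γ/2` -/

/-- For `s > 0`: `∫₀^∞ (e^{−x²} − e^{−x}) x^{s−1} dx = ½ Γ(s/2) − Γ(s)`. [folklore] -/
private theorem integral_expDiff_mul_rpow {s : ℝ} (hs : 0 < s) :
    ∫ x in Ioi (0 : ℝ), (rexp (-x ^ 2) - rexp (-x)) * x ^ (s - 1) =
      Real.Gamma (s / 2) / 2 - Real.Gamma s := by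
  have h1 : IntegrableOn (fun x : ℝ ↦ x ^ (s - 1) * rexp (-x ^ (2 : ℝ))) (Ioi 0) :=
    integrableOn_rpow_mul_exp_neg_rpow (by linarith) (by norm_num)
  have h2 : IntegrableOn (fun x : ℝ ↦ rexp (-x) * x ^ (s - 1)) (Ioi 0) :=
    Real.GammaIntegral_convergent hs
  have e1 : ∫ x in Ioi (0 : ℝ), x ^ (s - 1) * rexp (-x ^ (2 : ℝ)) =
      1 / 2 * Real.Gamma ((s - 1 + 1) / 2) :=
    integral_rpow_mul_exp_neg_rpow (by norm_num) (by linarith)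
  have e2 := (Real.Gamma_eq_integral hs).symm
  have hae : (fun x : ℝ ↦ (rexp (-x ^ 2) - rexp (-x)) * x ^ (s - 1)) =ᵐ[volume.restrict (Ioi 0)]
      fun x ↦ x ^ (s - 1) * rexp (-x ^ (2 : ℝ)) - rexp (-x) * x ^ (s - 1) := by
    refine (ae_restrict_iff' measurableSet_Ioi).mpr (ae_of_all _ fun x (_ : 0 < x) ↦ ?_)
    simp only [Real.rpow_two]; ring
  rw [integral_congr_ae hae, integral_sub h1 h2, e1, e2, show (s - 1 + 1) / 2 = s / 2 by ring]
  ring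

/-- `½ Γ(s/2) − Γ(s) → γ/2` as `s → 0⁺` (from `Γ'(1) = −γ`). [folklore] -/
private theorem tendsto_Gamma_half_sub_Gamma :
    Tendsto (fun s : ℝ ↦ Real.Gamma (s / 2) / 2 - Real.Gamma s) (𝓝[>] 0)
      (𝓝 (eulerMascheroniConstant / 2)) := by
  have hG := Real.hasDerivAt_Gamma_one
  have hG1 : HasDerivAt (fun u : ℝ ↦ Real.Gamma (1 + u)) (-eulerMascheroniConstant) 0 := by
    have h0 : HasDerivAt (fun u : ℝ ↦ 1 + u) 1 0 := by
      simpa using (hasDerivAt_id (0 : ℝ)).const_add 1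
    have h1 : HasDerivAt Real.Gamma (-eulerMascheroniConstant) (1 + 0) := by simpa using hG
    refine ((h1.comp (0 : ℝ) h0).congr_deriv ?_)
    ring
  have hG2 : HasDerivAt (fun u : ℝ ↦ Real.Gamma (1 + u / 2)) (-eulerMascheroniConstant / 2) 0 := by
    have h0 : HasDerivAt (fun u : ℝ ↦ 1 + u / 2) (1 / 2) 0 := by
      simpa using ((hasDerivAt_id (0 : ℝ)).div_const 2).const_add 1
    have h1 : HasDerivAt Real.Gamma (-eulerMascheroniConstant) (1 + 0 / 2) := by simpa using hG
    refine ((h1.comp (0 : ℝ) h0).congr_deriv ?_)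
    ring
  have t1 := hG2.tendsto_slope_zero_right
  have t2 := hG1.tendsto_slope_zero_right
  have t := t1.sub t2
  simp only [zero_add, zero_div, add_zero, smul_eq_mul] at t
  have hlim : -eulerMascheroniConstant / 2 - -eulerMascheroniConstant = eulerMascheroniConstant / 2 := by
    ring
  rw [hlim] at t
  refine t.congr' ?_
  filter_upwards [self_mem_nhdsWithin] with s (hs : 0 < s)
  have hs0 : s ≠ 0 := hs.ne'
  have hs2 : s / 2 ≠ 0 := by positivity
  rw [show 1 + s / 2 = s / 2 + 1 by ring, Real.Gamma_add_one hs2, show 1 + s = s + 1 by ring,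
    Real.Gamma_add_one hs0]
  field_simp
  ring

/-- `∫₀^∞ (e^{−x²} − e^{−x}) dx/x = γ/2` — the difference of the Mellin transforms `½Γ(s/2)` and
`Γ(s)` at `s = 0⁺` (dominated convergence, bound `2e^{1−x}`). [folklore] -/
private theorem integral_expDiff_div : ∫ x in Ioi (0 : ℝ), (rexp (-x ^ 2) - rexp (-x)) / x =
    eulerMascheroniConstant / 2 := by
  have hDCT : Tendsto (fun s : ℝ ↦ ∫ x in Ioi (0 : ℝ), (rexp (-x ^ 2) - rexp (-x)) * x ^ (s - 1))
      (𝓝[>] 0) (𝓝 (∫ x in Ioi (0 : ℝ), (rexp (-x ^ 2) - rexp (-x)) / x)) := by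
    refine tendsto_integral_filter_of_dominated_convergence (fun x ↦ 2 * rexp 1 * rexp (-1 * x))
      ?_ ?_ ?_ ?_
    · refine Eventually.of_forall fun s ↦ ?_
      refine ContinuousOn.aestronglyMeasurable (fun x (hx : 0 < x) ↦ ?_) measurableSet_Ioi
      exact ((by fun_prop : Continuous fun x : ℝ ↦ rexp (-x ^ 2) - rexp (-x)).continuousAt.mul
        (Real.continuousAt_rpow_const _ _ (Or.inl hx.ne'))).continuousWithinAt
    · filter_upwards [Ioc_mem_nhdsGT (show (0 : ℝ) < 1 by norm_num)] with s hs
      refine (ae_restrict_iff' measurableSet_Ioi).mpr (ae_of_all _ fun x (hx : 0 < x) ↦ ?_)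
      rw [norm_mul, Real.norm_eq_abs, Real.norm_eq_abs, abs_of_nonneg (Real.rpow_nonneg hx.le _)]
      have hE : rexp (-x) ≤ 2 * rexp 1 * rexp (-1 * x) := by
        rw [neg_one_mul]
        have : (1 : ℝ) ≤ 2 * rexp 1 := by nlinarith [Real.add_one_le_exp (1 : ℝ)]
        nlinarith [Real.exp_pos (-x)]
      rcases le_or_gt x 1 with hx1 | hx1
      · -- `0 ≤ e^{−x²} − e^{−x} ≤ 1 − e^{−x} ≤ x`, `x · x^{s−1} = x^s ≤ 1 ≤ 2e^{1−x}`
        have hxx : x ^ 2 ≤ x := by nlinarith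
        have hd0 : 0 ≤ rexp (-x ^ 2) - rexp (-x) := by
          have := Real.exp_le_exp.mpr (neg_le_neg hxx); linarith
        have hd1 : rexp (-x ^ 2) - rexp (-x) ≤ x := by
          have h1 : rexp (-x ^ 2) ≤ 1 := Real.exp_le_one_iff.mpr (by nlinarith)
          have h2 := Real.one_sub_le_exp_neg x
          linarith
        rw [abs_of_nonneg hd0]
        have hxs : x * x ^ (s - 1) = x ^ s := by
          rw [Real.rpow_sub_one hx.ne', mul_div_cancel₀ _ hx.ne']
        have hs1 : x ^ s ≤ 1 := Real.rpow_le_one hx.le hx1 hs.1.le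
        have h1x : (1 : ℝ) ≤ 2 * rexp 1 * rexp (-1 * x) := by
          rw [neg_one_mul]
          have h3 : x ≤ 1 := hx1
          have h4 : rexp (-1) ≤ rexp (-x) := Real.exp_le_exp.mpr (by linarith)
          have h5 : rexp 1 * rexp (-1) = 1 := by rw [← Real.exp_add]; simp
          nlinarith [Real.exp_pos 1, Real.exp_pos (-x)]
        calc (rexp (-x ^ 2) - rexp (-x)) * x ^ (s - 1) ≤ x * x ^ (s - 1) :=
              mul_le_mul_of_nonneg_right hd1 (Real.rpow_nonneg hx.le _)
          _ ≤ 2 * rexp 1 * rexp (-1 * x) := by rw [hxs]; linarith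
      · -- `|e^{−x²} − e^{−x}| ≤ e^{−x}`, `x^{s−1} ≤ 1`
        have hxx : x ≤ x ^ 2 := by nlinarith
        have hd : |rexp (-x ^ 2) - rexp (-x)| ≤ rexp (-x) := by
          rw [abs_sub_comm, abs_of_nonneg (by
            have := Real.exp_le_exp.mpr (neg_le_neg hxx); linarith)]
          linarith [Real.exp_pos (-x ^ 2)]
        have hs1 : x ^ (s - 1) ≤ 1 :=
          Real.rpow_le_one_of_one_le_of_nonpos hx1.le (by linarith [hs.2])
        calc |rexp (-x ^ 2) - rexp (-x)| * x ^ (s - 1) ≤ rexp (-x) * 1 :=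
              mul_le_mul hd hs1 (Real.rpow_nonneg hx.le _) (Real.exp_pos _).le
          _ ≤ 2 * rexp 1 * rexp (-1 * x) := by rw [mul_one]; exact hE
    · exact ((exp_neg_integrableOn_Ioi 0 one_pos).const_mul (2 * rexp 1))
    · refine (ae_restrict_iff' measurableSet_Ioi).mpr (ae_of_all _ fun x (hx : 0 < x) ↦ ?_)
      have hc : ContinuousAt (fun s : ℝ ↦ x ^ (s - 1)) 0 :=
        (Real.continuousAt_const_rpow hx.ne').comp (continuousAt_id.sub continuousAt_const)
      have : Tendsto (fun s : ℝ ↦ (rexp (-x ^ 2) - rexp (-x)) * x ^ (s - 1)) (𝓝 0)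
          (𝓝 ((rexp (-x ^ 2) - rexp (-x)) * x ^ ((0 : ℝ) - 1))) :=
        hc.tendsto.const_mul _
      rw [zero_sub, Real.rpow_neg_one, ← div_eq_mul_inv] at this
      exact this.mono_left nhdsWithin_le_nhds
  have hEq : Tendsto (fun s : ℝ ↦ ∫ x in Ioi (0 : ℝ), (rexp (-x ^ 2) - rexp (-x)) * x ^ (s - 1))
      (𝓝[>] 0) (𝓝 (eulerMascheroniConstant / 2)) := by
    refine tendsto_Gamma_half_sub_Gamma.congr' ?_
    filter_upwards [self_mem_nhdsWithin] with s (hs : 0 < s)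
    exact (integral_expDiff_mul_rpow hs).symm
  exact tendsto_nhds_unique hDCT hEq

/-! ### Second-order Taylor formula with integral remainder and the midpoint cell inequality -/

/-- `g(a) ≤ g(b)` when `g' ≥ 0` on `(a, b)` (derivative data on `[a, b]`). [folklore] -/
private theorem le_of_deriv_nonneg {g g' : ℝ → ℝ} {a b : ℝ} (hab : a ≤ b)
    (hg : ∀ x ∈ Icc a b, HasDerivAt g (g' x) x) (hg' : ∀ x ∈ Ioo a b, 0 ≤ g' x) : g a ≤ g b := by
  have hmono := monotoneOn_of_deriv_nonneg (convex_Icc a b)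
    (fun x hx ↦ (hg x hx).continuousAt.continuousWithinAt)
    (fun x hx ↦ by
      rw [interior_Icc] at hx
      exact (hg x (Ioo_subset_Icc_self hx)).differentiableAt.differentiableWithinAt)
    (fun x hx ↦ by
      rw [interior_Icc] at hx
      rw [(hg x (Ioo_subset_Icc_self hx)).deriv]; exact hg' x hx)
  exact hmono (left_mem_Icc.mpr hab) (right_mem_Icc.mpr hab) hab

/-- Second-order Taylor formula with integral remainder on `[p, e]` (any orientation):
`∫_p^e f = (e − p) f(p) + ((e − p)²/2) f′(p) + ∫_p^e ((e − x)²/2) f″(x) dx`. [folklore] -/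
private theorem integral_eq_taylor_two {f f' f'' : ℝ → ℝ} {p e : ℝ}
    (hf : ∀ x ∈ uIcc p e, HasDerivAt f (f' x) x) (hf' : ∀ x ∈ uIcc p e, HasDerivAt f' (f'' x) x)
    (hc : ContinuousOn f'' (uIcc p e)) :
    ∫ x in p..e, f x = (e - p) * f p + (e - p) ^ 2 / 2 * f' p +
      ∫ x in p..e, (e - x) ^ 2 / 2 * f'' x := by
  set Ψ : ℝ → ℝ := fun x ↦ -((e - x) * f x) - (e - x) ^ 2 / 2 * f' x with hΨ
  have hcf : ContinuousOn f (uIcc p e) := fun x hx ↦ (hf x hx).continuousAt.continuousWithinAt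
  have hderiv : ∀ x ∈ uIcc p e, HasDerivAt Ψ (f x - (e - x) ^ 2 / 2 * f'' x) x := by
    intro x hx
    have h1 : HasDerivAt (fun x : ℝ ↦ e - x) (-1) x := by simpa using (hasDerivAt_id x).const_sub e
    have h2 : HasDerivAt (fun x : ℝ ↦ (e - x) ^ 2 / 2) (2 * (e - x) * (-1) / 2) x := by
      simpa using (h1.pow 2).div_const 2
    have := ((h1.mul (hf x hx)).neg).sub (h2.mul (hf' x hx))
    exact this.congr_deriv (by ring)
  have hI2 : IntervalIntegrable (fun x ↦ (e - x) ^ 2 / 2 * f'' x) volume p e := by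
    refine ContinuousOn.intervalIntegrable ?_
    exact ContinuousOn.mul (Continuous.continuousOn (by fun_prop)) hc
  have hint : IntervalIntegrable (fun x ↦ f x - (e - x) ^ 2 / 2 * f'' x) volume p e :=
    hcf.intervalIntegrable.sub hI2
  have hFTC := intervalIntegral.integral_eq_sub_of_hasDerivAt hderiv hint
  rw [intervalIntegral.integral_sub hcf.intervalIntegrable hI2] at hFTC
  simp only [hΨ, sub_self, zero_mul, neg_zero, ne_eq, OfNat.ofNat_ne_zero, not_false_eq_true,
    zero_pow, zero_div] at hFTC
  linarith

/-- **Midpoint cell inequality.** If `f″ ≥ −m` on the unit cell `[c − ½, c + ½]` with `m ≥ 0`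
continuous, then `f(c) ≤ ∫_{c−½}^{c+½} f + ⅛ ∫_{c−½}^{c+½} m` (midpoint rule with the kernel
`(½ − |x − c|)²/2 ∈ [0, ⅛]`). [folklore] -/
private theorem le_integral_cell {f f' f'' m : ℝ → ℝ} {c : ℝ}
    (hf : ∀ x ∈ Icc (c - 1 / 2) (c + 1 / 2), HasDerivAt f (f' x) x)
    (hf' : ∀ x ∈ Icc (c - 1 / 2) (c + 1 / 2), HasDerivAt f' (f'' x) x)
    (hc : ContinuousOn f'' (Icc (c - 1 / 2) (c + 1 / 2)))
    (hm : ContinuousOn m (Icc (c - 1 / 2) (c + 1 / 2)))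
    (hfm : ∀ x ∈ Icc (c - 1 / 2) (c + 1 / 2), -m x ≤ f'' x)
    (hm0 : ∀ x ∈ Icc (c - 1 / 2) (c + 1 / 2), 0 ≤ m x) :
    f c ≤ (∫ x in (c - 1 / 2)..(c + 1 / 2), f x) + 1 / 8 * ∫ x in (c - 1 / 2)..(c + 1 / 2), m x := by
  have hIccR : Icc c (c + 1 / 2) ⊆ Icc (c - 1 / 2) (c + 1 / 2) := Icc_subset_Icc (by linarith) le_rfl
  have hIccL : Icc (c - 1 / 2) c ⊆ Icc (c - 1 / 2) (c + 1 / 2) := Icc_subset_Icc le_rfl (by linarith)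
  have hsubR : uIcc c (c + 1 / 2) ⊆ Icc (c - 1 / 2) (c + 1 / 2) := by
    rw [uIcc_of_le (by linarith)]; exact hIccR
  have hsubL : uIcc c (c - 1 / 2) ⊆ Icc (c - 1 / 2) (c + 1 / 2) := by
    rw [uIcc_of_ge (by linarith)]; exact hIccL
  have hR := integral_eq_taylor_two (fun x hx ↦ hf x (hsubR hx)) (fun x hx ↦ hf' x (hsubR hx))
    (hc.mono hsubR)
  have hL := integral_eq_taylor_two (fun x hx ↦ hf x (hsubL hx)) (fun x hx ↦ hf' x (hsubL hx))
    (hc.mono hsubL)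
  have hcf : ContinuousOn f (Icc (c - 1 / 2) (c + 1 / 2)) :=
    fun x hx ↦ (hf x hx).continuousAt.continuousWithinAt
  -- integrability on the two half cells
  have hmR : IntervalIntegrable m volume c (c + 1 / 2) :=
    (hm.mono hIccR).intervalIntegrable_of_Icc (by linarith)
  have hmL : IntervalIntegrable m volume (c - 1 / 2) c :=
    (hm.mono hIccL).intervalIntegrable_of_Icc (by linarith)
  have hfR : IntervalIntegrable f volume c (c + 1 / 2) :=
    (hcf.mono hIccR).intervalIntegrable_of_Icc (by linarith)
  have hfL : IntervalIntegrable f volume (c - 1 / 2) c :=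
    (hcf.mono hIccL).intervalIntegrable_of_Icc (by linarith)
  have hwR : IntervalIntegrable (fun x ↦ (c + 1 / 2 - x) ^ 2 / 2 * f'' x) volume c (c + 1 / 2) := by
    refine ContinuousOn.intervalIntegrable_of_Icc (by linarith) ?_
    exact ContinuousOn.mul (Continuous.continuousOn (by fun_prop)) (hc.mono hIccR)
  have hwL : IntervalIntegrable (fun x ↦ (c - 1 / 2 - x) ^ 2 / 2 * f'' x) volume (c - 1 / 2) c := by
    refine ContinuousOn.intervalIntegrable_of_Icc (by linarith) ?_
    exact ContinuousOn.mul (Continuous.continuousOn (by fun_prop)) (hc.mono hIccL)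
  -- remainder bounds
  have hIR : -(1 / 8) * ∫ x in c..(c + 1 / 2), m x ≤
      ∫ x in c..(c + 1 / 2), (c + 1 / 2 - x) ^ 2 / 2 * f'' x := by
    rw [← intervalIntegral.integral_const_mul]
    refine intervalIntegral.integral_mono_on (by linarith) (hmR.const_mul _) hwR fun x hx ↦ ?_
    have hxI : x ∈ Icc (c - 1 / 2) (c + 1 / 2) := hIccR hx
    have hw0 : 0 ≤ (c + 1 / 2 - x) ^ 2 / 2 := by positivity
    have hw1 : (c + 1 / 2 - x) ^ 2 / 2 ≤ 1 / 8 := by nlinarith [hx.1, hx.2]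
    have h1 := hfm x hxI
    have h2 := hm0 x hxI
    nlinarith [mul_nonneg hw0 (by linarith : 0 ≤ f'' x + m x),
      mul_nonneg (by linarith : (0 : ℝ) ≤ 1 / 8 - (c + 1 / 2 - x) ^ 2 / 2) h2]
  have hIL : -(1 / 8) * ∫ x in (c - 1 / 2)..c, m x ≤
      ∫ x in (c - 1 / 2)..c, (c - 1 / 2 - x) ^ 2 / 2 * f'' x := by
    rw [← intervalIntegral.integral_const_mul]
    refine intervalIntegral.integral_mono_on (by linarith) (hmL.const_mul _) hwL fun x hx ↦ ?_
    have hxI : x ∈ Icc (c - 1 / 2) (c + 1 / 2) := hIccL hx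
    have hw0 : 0 ≤ (c - 1 / 2 - x) ^ 2 / 2 := by positivity
    have hw1 : (c - 1 / 2 - x) ^ 2 / 2 ≤ 1 / 8 := by nlinarith [hx.1, hx.2]
    have h1 := hfm x hxI
    have h2 := hm0 x hxI
    nlinarith [mul_nonneg hw0 (by linarith : 0 ≤ f'' x + m x),
      mul_nonneg (by linarith : (0 : ℝ) ≤ 1 / 8 - (c - 1 / 2 - x) ^ 2 / 2) h2]
  -- assemble
  have hsplit_f : ∫ x in (c - 1 / 2)..(c + 1 / 2), f x =
      (∫ x in (c - 1 / 2)..c, f x) + ∫ x in c..(c + 1 / 2), f x :=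
    (intervalIntegral.integral_add_adjacent_intervals hfL hfR).symm
  have hsplit_m : ∫ x in (c - 1 / 2)..(c + 1 / 2), m x =
      (∫ x in (c - 1 / 2)..c, m x) + ∫ x in c..(c + 1 / 2), m x :=
    (intervalIntegral.integral_add_adjacent_intervals hmL hmR).symm
  have hLrev : ∫ x in c..(c - 1 / 2), f x = -∫ x in (c - 1 / 2)..c, f x :=
    intervalIntegral.integral_symm _ _
  have hLrev2 : ∫ x in c..(c - 1 / 2), (c - 1 / 2 - x) ^ 2 / 2 * f'' x =
      -∫ x in (c - 1 / 2)..c, (c - 1 / 2 - x) ^ 2 / 2 * f'' x :=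
    intervalIntegral.integral_symm _ _
  rw [hLrev, hLrev2] at hL
  rw [hsplit_f, hsplit_m]
  have e1 : (c + 1 / 2 - c) = 1 / 2 := by ring
  have e2 : (c - 1 / 2 - c) = -(1 / 2) := by ring
  rw [e1] at hR; rw [e2] at hL
  norm_num at hR hL
  linarith [hR, hL, hIR, hIL]

/-! ### Elementary exponential inequalities -/

/-- `e^{−y} ≤ 1 − y + y²/2` for `y ≥ 0`. [folklore] -/
private theorem exp_neg_le_quad {y : ℝ} (hy : 0 ≤ y) : rexp (-y) ≤ 1 - y + y ^ 2 / 2 := by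
  have key : (fun t : ℝ ↦ 1 - t + t ^ 2 / 2 - rexp (-t)) 0 ≤
      (fun t : ℝ ↦ 1 - t + t ^ 2 / 2 - rexp (-t)) y := by
    refine le_of_deriv_nonneg (g := fun t : ℝ ↦ 1 - t + t ^ 2 / 2 - rexp (-t))
      (g' := fun t ↦ -1 + t + rexp (-t)) hy (fun t _ ↦ ?_) (fun t ht ↦ ?_)
    · have ha : HasDerivAt (fun t : ℝ ↦ 1 - t) (-1) t := (hasDerivAt_id t).const_sub 1
      have hb : HasDerivAt (fun t : ℝ ↦ t ^ 2 / 2) ((2 : ℕ) * t ^ (2 - 1) / 2) t :=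
        (hasDerivAt_pow 2 t).div_const 2
      have h1 : HasDerivAt (fun t : ℝ ↦ 1 - t + t ^ 2 / 2) (-1 + (2 : ℕ) * t ^ (2 - 1) / 2) t :=
        ha.add hb
      have h2 : HasDerivAt (fun t : ℝ ↦ rexp (-t)) (rexp (-t) * -1) t := (hasDerivAt_neg t).exp
      refine (h1.sub h2).congr_deriv ?_
      simp only [Nat.cast_ofNat]
      ring
    · have := Real.add_one_le_exp (-t); linarith
  simpa using key

/-- `e^{y} − e^{−y} ≥ 2y` for `y ≥ 0`. [folklore] -/
private theorem two_mul_le_exp_sub_exp_neg {y : ℝ} (hy : 0 ≤ y) : 2 * y ≤ rexp y - rexp (-y) := by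
  have h1 := Real.quadratic_le_exp_of_nonneg hy
  have h2 := exp_neg_le_quad hy
  linarith

/-! ### The comparison function `φ(y) = (e^{−y²} − e^{−y})/y` and `F_h(x) = h φ(hx)` -/

/-- `φ(y) = (e^{−y²} − e^{−y})/y`. [folklore] -/
private def phi (y : ℝ) : ℝ := (rexp (-y ^ 2) - rexp (-y)) / y

/-- `|φ(y)| ≤ 2e · e^{−y}` for `y > 0`. [folklore] -/
private theorem abs_phi_le {y : ℝ} (hy : 0 < y) : |phi y| ≤ 2 * rexp 1 * rexp (-1 * y) := by
  rw [neg_one_mul]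
  unfold phi
  rcases le_or_gt y 1 with hy1 | hy1
  · have hyy : y ^ 2 ≤ y := by nlinarith
    have hd0 : 0 ≤ rexp (-y ^ 2) - rexp (-y) := by
      have := Real.exp_le_exp.mpr (neg_le_neg hyy); linarith
    have hd1 : rexp (-y ^ 2) - rexp (-y) ≤ y := by
      have h1 : rexp (-y ^ 2) ≤ 1 := Real.exp_le_one_iff.mpr (by nlinarith)
      have h2 := Real.one_sub_le_exp_neg y
      linarith
    rw [abs_of_nonneg (div_nonneg hd0 hy.le)]
    have h3 : (rexp (-y ^ 2) - rexp (-y)) / y ≤ 1 := by rw [div_le_one hy]; exact hd1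
    have h4 : rexp (-1) ≤ rexp (-y) := Real.exp_le_exp.mpr (by linarith)
    have h5 : rexp 1 * rexp (-1) = 1 := by rw [← Real.exp_add]; simp
    nlinarith [Real.exp_pos 1, Real.exp_pos (-y)]
  · have hyy : y ≤ y ^ 2 := by nlinarith
    have hd : |rexp (-y ^ 2) - rexp (-y)| ≤ rexp (-y) := by
      rw [abs_sub_comm, abs_of_nonneg (by
        have := Real.exp_le_exp.mpr (neg_le_neg hyy); linarith)]
      linarith [Real.exp_pos (-y ^ 2)]
    rw [abs_div, abs_of_pos hy]
    calc |rexp (-y ^ 2) - rexp (-y)| / y ≤ rexp (-y) / 1 :=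
          div_le_div₀ (Real.exp_pos _).le hd one_pos hy1.le
      _ ≤ 2 * rexp 1 * rexp (-y) := by
          rw [div_one]; nlinarith [Real.exp_pos (-y), Real.add_one_le_exp (1 : ℝ)]

/-- `φ` is continuous on `(0, ∞)`. [folklore] -/
private theorem continuousOn_phi : ContinuousOn phi (Ioi 0) := by
  unfold phi
  exact ContinuousOn.div (by fun_prop) continuousOn_id fun x hx ↦ (ne_of_gt hx)

/-- `φ` is integrable on `(0, ∞)`. [folklore] -/
private theorem integrableOn_phi : IntegrableOn phi (Ioi 0) := by
  refine Integrable.mono' ((exp_neg_integrableOn_Ioi 0 one_pos).const_mul (2 * rexp 1))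
    (continuousOn_phi.aestronglyMeasurable measurableSet_Ioi) ?_
  refine (ae_restrict_iff' measurableSet_Ioi).mpr (ae_of_all _ fun y (hy : 0 < y) ↦ ?_)
  rw [Real.norm_eq_abs]; exact abs_phi_le hy

/-- `∫₀^∞ φ = γ/2`. [folklore] -/
private theorem integral_phi : ∫ y in Ioi (0 : ℝ), phi y = eulerMascheroniConstant / 2 :=
  integral_expDiff_div

/-- `φ(y) ≥ 1 − 3y/2` for `y > 0` (`e^{−y²} ≥ 1 − y²`, `e^{−y} ≤ 1 − y + y²/2`). [folklore] -/
private theorem phi_ge {y : ℝ} (hy : 0 < y) : 1 - 3 / 2 * y ≤ phi y := by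
  unfold phi
  rw [le_div_iff₀ hy]
  have h1 := Real.one_sub_le_exp_neg (y ^ 2)
  have h2 := exp_neg_le_quad hy.le
  nlinarith

/-- `∫₀^b φ ≥ b − (3/4) b²` for `b ≥ 0`. [folklore] -/
private theorem integral_phi_ge {b : ℝ} (hb : 0 ≤ b) : b - 3 / 4 * b ^ 2 ≤ ∫ y in (0 : ℝ)..b, phi y := by
  have hlin : ∫ y in (0 : ℝ)..b, (1 - 3 / 2 * y) = b - 3 / 4 * b ^ 2 := by
    have h : ∀ y ∈ uIcc (0 : ℝ) b, HasDerivAt (fun y : ℝ ↦ y - 3 / 4 * y ^ 2) (1 - 3 / 2 * y) y := by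
      intro y _
      have := (hasDerivAt_id y).sub ((hasDerivAt_pow 2 y).const_mul (3 / 4))
      exact this.congr_deriv (by simp; ring)
    rw [intervalIntegral.integral_eq_sub_of_hasDerivAt h ((by fun_prop : Continuous fun y : ℝ ↦
      1 - 3 / 2 * y).intervalIntegrable _ _)]
    ring
  rw [← hlin, intervalIntegral.integral_of_le hb, intervalIntegral.integral_of_le hb]
  refine setIntegral_mono_on ((by fun_prop : Continuous fun y : ℝ ↦ 1 - 3 / 2 * y).integrableOn_Ioc)
    (integrableOn_phi.mono_set Ioc_subset_Ioi_self) measurableSet_Ioc fun y hy ↦ phi_ge hy.1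

-- the pieces of `F_h`
/-- `u_h(x) = e^{−h²x²} − e^{−hx}`. [folklore] -/
private def emU (h x : ℝ) : ℝ := rexp (-(h ^ 2 * x ^ 2)) - rexp (-(h * x))
/-- `u_h′`. [folklore] -/
private def emU' (h x : ℝ) : ℝ := -(2 * h ^ 2 * x) * rexp (-(h ^ 2 * x ^ 2)) + h * rexp (-(h * x))
/-- `u_h″`. [folklore] -/
private def emU'' (h x : ℝ) : ℝ :=
  (4 * h ^ 4 * x ^ 2 - 2 * h ^ 2) * rexp (-(h ^ 2 * x ^ 2)) - h ^ 2 * rexp (-(h * x))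
/-- `F_h(x) = (e^{−h²x²} − e^{−hx})/x = h φ(hx)`. [folklore] -/
private def emF (h x : ℝ) : ℝ := emU h x / x
/-- `F_h′`. [folklore] -/
private def emF' (h x : ℝ) : ℝ := (x * emU' h x - emU h x) / x ^ 2
/-- `F_h″`. [folklore] -/
private def emF'' (h x : ℝ) : ℝ := (x ^ 2 * emU'' h x - 2 * x * emU' h x + 2 * emU h x) / x ^ 3

/-- `(e^{−bx²})′ = −2bx e^{−bx²}`. [folklore] -/
private theorem hasDerivAt_expNegSq' (b x : ℝ) :
    HasDerivAt (fun x ↦ rexp (-(b * x ^ 2))) (-(2 * b * x) * rexp (-(b * x ^ 2))) x := by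
  have h0 : HasDerivAt (fun x : ℝ ↦ b * x ^ 2) (b * (2 * x)) x := by
    simpa using (hasDerivAt_pow 2 x).const_mul b
  have h1 : HasDerivAt (fun x : ℝ ↦ -(b * x ^ 2)) (-(b * (2 * x))) x := h0.neg
  exact h1.exp.congr_deriv (by ring)

/-- `(e^{−hx})′ = −h e^{−hx}`. [folklore] -/
private theorem hasDerivAt_expNegLin (h x : ℝ) :
    HasDerivAt (fun x ↦ rexp (-(h * x))) (-h * rexp (-(h * x))) x := by
  have h0 : HasDerivAt (fun x : ℝ ↦ h * x) (h * 1) x := (hasDerivAt_id x).const_mul h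
  have h1 : HasDerivAt (fun x : ℝ ↦ -(h * x)) (-(h * 1)) x := h0.neg
  exact h1.exp.congr_deriv (by ring)

/-- `u_h′` is the derivative of `u_h`. [folklore] -/
private theorem hasDerivAt_emU (h x : ℝ) : HasDerivAt (emU h) (emU' h x) x := by
  have := (hasDerivAt_expNegSq' (h ^ 2) x).sub (hasDerivAt_expNegLin h x)
  exact this.congr_deriv (by simp only [emU']; ring)

/-- `u_h″` is the derivative of `u_h′`. [folklore] -/
private theorem hasDerivAt_emU' (h x : ℝ) : HasDerivAt (emU' h) (emU'' h x) x := by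
  have h1 : HasDerivAt (fun x : ℝ ↦ -(2 * h ^ 2 * x)) (-(2 * h ^ 2 * 1)) x :=
    ((hasDerivAt_id x).const_mul (2 * h ^ 2)).neg
  have := (h1.mul (hasDerivAt_expNegSq' (h ^ 2) x)).add ((hasDerivAt_expNegLin h x).const_mul h)
  exact this.congr_deriv (by simp only [emU'']; ring)

/-- `F_h′` is the derivative of `F_h` away from `0`. [folklore] -/
private theorem hasDerivAt_emF (h : ℝ) {x : ℝ} (hx : x ≠ 0) : HasDerivAt (emF h) (emF' h x) x := by
  have := (hasDerivAt_emU h x).div (hasDerivAt_id x) hx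
  refine this.congr_deriv ?_
  simp only [emF', id]; ring

/-- `F_h″` is the derivative of `F_h′` away from `0`. [folklore] -/
private theorem hasDerivAt_emF' (h : ℝ) {x : ℝ} (hx : x ≠ 0) : HasDerivAt (emF' h) (emF'' h x) x := by
  have hN : HasDerivAt (fun y ↦ y * emU' h y - emU h y) (1 * emU' h x + x * emU'' h x - emU' h x) x :=
    ((hasDerivAt_id x).mul (hasDerivAt_emU' h x)).sub (hasDerivAt_emU h x)
  have hD : HasDerivAt (fun y : ℝ ↦ y ^ 2) ((2 : ℕ) * x ^ (2 - 1)) x := hasDerivAt_pow 2 x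
  have := hN.div hD (pow_ne_zero 2 hx)
  refine this.congr_deriv ?_
  simp only [emF'', Nat.cast_ofNat]
  field_simp
  ring

/-- Closed form of `F_h″`: `x³ F_h″(x) = e^{−h²x²}(4h⁴x⁴ + 2h²x² + 2) − e^{−hx}(h²x² + 2hx + 2)`.
[folklore] -/
private theorem emF''_eq (h x : ℝ) : emF'' h x =
    (rexp (-(h ^ 2 * x ^ 2)) * (4 * h ^ 4 * x ^ 4 + 2 * h ^ 2 * x ^ 2 + 2) -
      rexp (-(h * x)) * (h ^ 2 * x ^ 2 + 2 * h * x + 2)) / x ^ 3 := by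
  simp only [emF'', emU, emU', emU'']; ring

/-- `F_h″(x) ≥ −e^{−hx}(h²x² + 2hx + 2)/x³` for `x > 0`. [folklore] -/
private theorem neg_le_emF'' (h : ℝ) {x : ℝ} (hx : 0 < x) :
    -(rexp (-(h * x)) * (h ^ 2 * x ^ 2 + 2 * h * x + 2) / x ^ 3) ≤ emF'' h x := by
  rw [emF''_eq, sub_div]
  have : 0 ≤ rexp (-(h ^ 2 * x ^ 2)) * (4 * h ^ 4 * x ^ 4 + 2 * h ^ 2 * x ^ 2 + 2) / x ^ 3 := by
    positivity
  linarith

/-- `e^{−y²}(4y⁴ + 2y² + 2) ≥ e^{−y}(y² + 2y + 2)` for `0 ≤ y ≤ 6/5` (both sides equal `2` at `0`, and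
the derivative of the difference is `4y³(3 − 2y²)e^{−y²} + y²e^{−y} ≥ 0`). [folklore] -/
private theorem numer_nonneg {y : ℝ} (hy0 : 0 ≤ y) (hy1 : y ≤ 6 / 5) :
    0 ≤ rexp (-y ^ 2) * (4 * y ^ 4 + 2 * y ^ 2 + 2) - rexp (-y) * (y ^ 2 + 2 * y + 2) := by
  set D : ℝ → ℝ := fun t ↦ rexp (-t ^ 2) * (4 * t ^ 4 + 2 * t ^ 2 + 2) - rexp (-t) * (t ^ 2 + 2 * t + 2)
    with hD
  have hD0 : D 0 = 0 := by norm_num [hD]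
  have key : D 0 ≤ D y := by
    refine le_of_deriv_nonneg
      (g' := fun t ↦ 4 * t ^ 3 * (3 - 2 * t ^ 2) * rexp (-t ^ 2) + t ^ 2 * rexp (-t)) hy0
      (fun t _ ↦ ?_) (fun t ht ↦ ?_)
    · have hE2 : HasDerivAt (fun t : ℝ ↦ rexp (-t ^ 2)) (rexp (-t ^ 2) * -((2 : ℕ) * t ^ (2 - 1))) t :=
        (hasDerivAt_pow 2 t).neg.exp
      have hP : HasDerivAt (fun t : ℝ ↦ 4 * t ^ 4 + 2 * t ^ 2 + 2)
          (4 * ((4 : ℕ) * t ^ (4 - 1)) + 2 * ((2 : ℕ) * t ^ (2 - 1))) t :=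
        (((hasDerivAt_pow 4 t).const_mul 4).add ((hasDerivAt_pow 2 t).const_mul 2)).add_const 2
      have hE1 : HasDerivAt (fun t : ℝ ↦ rexp (-t)) (rexp (-t) * -1) t := (hasDerivAt_neg t).exp
      have hQ : HasDerivAt (fun t : ℝ ↦ t ^ 2 + 2 * t + 2) ((2 : ℕ) * t ^ (2 - 1) + 2 * 1) t :=
        ((hasDerivAt_pow 2 t).add ((hasDerivAt_id t).const_mul 2)).add_const 2
      have := (hE2.mul hP).sub (hE1.mul hQ)
      refine this.congr_deriv ?_
      simp only [Nat.cast_ofNat]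
      ring
    · have ht1 : t ≤ 6 / 5 := ht.2.le.trans hy1
      have ht0 : 0 ≤ t := ht.1.le
      have h3 : 0 ≤ 3 - 2 * t ^ 2 := by nlinarith
      positivity
  rw [hD0] at key
  simpa [hD] using key

/-- `F_h″(x) ≥ 0` when `x > 0` and `hx ≤ 6/5`. [folklore] -/
private theorem emF''_nonneg {h x : ℝ} (hh : 0 ≤ h) (hx : 0 < x) (hhx : h * x ≤ 6 / 5) :
    0 ≤ emF'' h x := by
  rw [emF''_eq]
  refine div_nonneg ?_ (pow_nonneg hx.le 3)
  have := numer_nonneg (y := h * x) (by positivity) hhx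
  have e : rexp (-(h ^ 2 * x ^ 2)) * (4 * h ^ 4 * x ^ 4 + 2 * h ^ 2 * x ^ 2 + 2) -
      rexp (-(h * x)) * (h ^ 2 * x ^ 2 + 2 * h * x + 2) =
      rexp (-(h * x) ^ 2) * (4 * (h * x) ^ 4 + 2 * (h * x) ^ 2 + 2) -
      rexp (-(h * x)) * ((h * x) ^ 2 + 2 * (h * x) + 2) := by ring_nf
  rw [e]; exact this

/-- The majorant `e^{−hx}(h²x² + 2hx + 2)/x³` of `(F_h″)⁻` has the antiderivative
`W(x) = −e^{−hx}(h/x + 1/x²)`. [folklore] -/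
private theorem hasDerivAt_W (h : ℝ) {x : ℝ} (hx : x ≠ 0) :
    HasDerivAt (fun x ↦ -rexp (-(h * x)) * (h * x⁻¹ + (x ^ 2)⁻¹))
      (rexp (-(h * x)) * (h ^ 2 * x ^ 2 + 2 * h * x + 2) / x ^ 3) x := by
  have h1 : HasDerivAt (fun x : ℝ ↦ h * x⁻¹ + (x ^ 2)⁻¹)
      (h * (-(x ^ 2)⁻¹) + -((2 : ℕ) * x ^ (2 - 1)) / (x ^ 2) ^ 2) x :=
    ((hasDerivAt_inv hx).const_mul h).add ((hasDerivAt_pow 2 x).inv (pow_ne_zero 2 hx))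
  have h2 : HasDerivAt (fun x ↦ -rexp (-(h * x))) (-(-h * rexp (-(h * x)))) x :=
    (hasDerivAt_expNegLin h x).neg
  have := h2.mul h1
  refine this.congr_deriv ?_
  simp only [Nat.cast_ofNat]
  field_simp
  ring

/-- `F_h″` is continuous on `(0, ∞)`. [folklore] -/
private theorem continuousOn_emF'' (h : ℝ) : ContinuousOn (emF'' h) (Ioi 0) := by
  have : emF'' h = fun x ↦ (x ^ 2 * emU'' h x - 2 * x * emU' h x + 2 * emU h x) / x ^ 3 := rfl
  rw [this]
  refine ContinuousOn.div ?_ (by fun_prop) fun x (hx : 0 < x) ↦ by positivity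
  unfold emU emU' emU''
  fun_prop

/-! ### The midpoint Euler–Maclaurin bound for `Σ_{n≥1} F_h(n)` -/

/-- Partial sums: `Σ_{n=1}^{N} F_h(n) ≤ ∫_{1/2}^{N+1/2} F_h + 0.07 h²` for `0 < h ≤ 2`. [folklore] -/
private theorem sum_emF_le {h : ℝ} (hh : 0 < h) (hh2 : h ≤ 2) (N : ℕ) :
    ∑ n ∈ Finset.range N, emF h (n + 1) ≤
      (∫ x in (1 / 2 : ℝ)..((N : ℝ) + 1 / 2), emF h x) + 7 / 100 * h ^ 2 := by
  set m : ℝ → ℝ := fun x ↦ max (-emF'' h x) 0 with hm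
  have hmcont : ContinuousOn m (Ioi 0) := by
    simp only [hm]
    exact ContinuousOn.sup (continuousOn_emF'' h).neg continuousOn_const
  have hm0 : ∀ x, 0 ≤ m x := fun x ↦ le_max_right _ _
  -- per cell
  have hcell : ∀ n : ℕ, emF h (n + 1) ≤ (∫ x in ((n : ℝ) + 1 - 1 / 2)..((n : ℝ) + 1 + 1 / 2), emF h x) +
      1 / 8 * ∫ x in ((n : ℝ) + 1 - 1 / 2)..((n : ℝ) + 1 + 1 / 2), m x := by
    intro n
    have hpos : ∀ x ∈ Icc ((n : ℝ) + 1 - 1 / 2) ((n : ℝ) + 1 + 1 / 2), 0 < x := fun x hx ↦ by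
      have := hx.1; have : (0 : ℝ) ≤ n := n.cast_nonneg; linarith
    have hsub : Icc ((n : ℝ) + 1 - 1 / 2) ((n : ℝ) + 1 + 1 / 2) ⊆ Ioi 0 := fun x hx ↦ hpos x hx
    exact le_integral_cell (fun x hx ↦ hasDerivAt_emF h (hpos x hx).ne')
      (fun x hx ↦ hasDerivAt_emF' h (hpos x hx).ne') ((continuousOn_emF'' h).mono hsub)
      (hmcont.mono hsub) (fun x _ ↦ by simp only [hm]; linarith [le_max_left (-emF'' h x) 0])
      (fun x _ ↦ hm0 x)
  -- sum the cells
  have hFint : ∀ a b : ℝ, 0 < a → a ≤ b → IntervalIntegrable (emF h) volume a b := by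
    intro a b ha hab
    refine ContinuousOn.intervalIntegrable_of_Icc hab fun x hx ↦ ?_
    exact (hasDerivAt_emF h (by linarith [hx.1] : 0 < x).ne').continuousAt.continuousWithinAt
  have hmint : ∀ a b : ℝ, 0 < a → a ≤ b → IntervalIntegrable m volume a b := by
    intro a b ha hab
    exact (hmcont.mono fun x hx ↦ (lt_of_lt_of_le ha hx.1 : 0 < x)).intervalIntegrable_of_Icc hab
  have hsumF : ∑ n ∈ Finset.range N, ∫ x in ((n : ℝ) + 1 - 1 / 2)..((n : ℝ) + 1 + 1 / 2), emF h x =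
      ∫ x in (1 / 2 : ℝ)..((N : ℝ) + 1 / 2), emF h x := by
    have := intervalIntegral.sum_integral_adjacent_intervals (a := fun k : ℕ ↦ (k : ℝ) + 1 / 2)
      (n := N) (f := emF h) (μ := volume) fun k _ ↦ hFint _ _ (by positivity) (by push_cast; linarith)
    simp only [Nat.cast_zero, zero_add, Nat.cast_add, Nat.cast_one] at this
    rw [← this]
    refine Finset.sum_congr rfl fun n _ ↦ ?_
    congr 1; ring
  have hsumm : ∑ n ∈ Finset.range N, ∫ x in ((n : ℝ) + 1 - 1 / 2)..((n : ℝ) + 1 + 1 / 2), m x =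
      ∫ x in (1 / 2 : ℝ)..((N : ℝ) + 1 / 2), m x := by
    have := intervalIntegral.sum_integral_adjacent_intervals (a := fun k : ℕ ↦ (k : ℝ) + 1 / 2)
      (n := N) (f := m) (μ := volume) fun k _ ↦ hmint _ _ (by positivity) (by push_cast; linarith)
    simp only [Nat.cast_zero, zero_add, Nat.cast_add, Nat.cast_one] at this
    rw [← this]
    refine Finset.sum_congr rfl fun n _ ↦ ?_
    congr 1; ring
  have hle : ∑ n ∈ Finset.range N, emF h (n + 1) ≤
      (∫ x in (1 / 2 : ℝ)..((N : ℝ) + 1 / 2), emF h x) +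
        1 / 8 * ∫ x in (1 / 2 : ℝ)..((N : ℝ) + 1 / 2), m x := by
    calc ∑ n ∈ Finset.range N, emF h (n + 1)
        ≤ ∑ n ∈ Finset.range N, ((∫ x in ((n : ℝ) + 1 - 1 / 2)..((n : ℝ) + 1 + 1 / 2), emF h x) +
            1 / 8 * ∫ x in ((n : ℝ) + 1 - 1 / 2)..((n : ℝ) + 1 + 1 / 2), m x) :=
          Finset.sum_le_sum fun n _ ↦ hcell n
      _ = _ := by rw [Finset.sum_add_distrib, ← Finset.mul_sum, hsumF, hsumm]
  -- bound the correction integral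
  have hX0 : (1 / 2 : ℝ) ≤ 6 / (5 * h) := by
    rw [le_div_iff₀ (by positivity)]; linarith
  have hmzero : ∀ x, 0 < x → x ≤ 6 / (5 * h) → m x = 0 := by
    intro x hx hxX
    have hhx : h * x ≤ 6 / 5 := by
      have := mul_le_mul_of_nonneg_left hxX hh.le
      rwa [show h * (6 / (5 * h)) = 6 / 5 by field_simp] at this
    have := emF''_nonneg hh.le hx hhx
    simp only [hm]; exact max_eq_right (by linarith)
  have hcorr : ∫ x in (1 / 2 : ℝ)..((N : ℝ) + 1 / 2), m x ≤ rexp (-(6 / 5)) * (55 / 36) * h ^ 2 := by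
    rcases le_or_gt ((N : ℝ) + 1 / 2) (6 / (5 * h)) with hN | hN
    · -- the kernel correction vanishes identically
      have : ∫ x in (1 / 2 : ℝ)..((N : ℝ) + 1 / 2), m x = 0 := by
        rw [← intervalIntegral.integral_zero (a := (1 / 2 : ℝ)) (b := (N : ℝ) + 1 / 2)]
        refine intervalIntegral.integral_congr fun x hx ↦ ?_
        rw [uIcc_of_le (by have : (0:ℝ) ≤ N := N.cast_nonneg; linarith)] at hx
        exact hmzero x (by linarith [hx.1]) (hx.2.trans hN)
      rw [this]; positivity
    · set X : ℝ := 6 / (5 * h) with hX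
      have hXpos : 0 < X := by positivity
      have hsplit : ∫ x in (1 / 2 : ℝ)..((N : ℝ) + 1 / 2), m x =
          (∫ x in (1 / 2 : ℝ)..X, m x) + ∫ x in X..((N : ℝ) + 1 / 2), m x :=
        (intervalIntegral.integral_add_adjacent_intervals (hmint _ _ (by norm_num) hX0)
          (hmint _ _ hXpos hN.le)).symm
      have h1 : ∫ x in (1 / 2 : ℝ)..X, m x = 0 := by
        rw [← intervalIntegral.integral_zero (a := (1 / 2 : ℝ)) (b := X)]
        refine intervalIntegral.integral_congr fun x hx ↦ ?_
        rw [uIcc_of_le hX0] at hx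
        exact hmzero x (by linarith [hx.1]) hx.2
      -- on `[X, N + 1/2]`: `m ≤ e^{−hx}(h²x²+2hx+2)/x³ = W′`
      set W : ℝ → ℝ := fun x ↦ -rexp (-(h * x)) * (h * x⁻¹ + (x ^ 2)⁻¹) with hW
      have hmajcont : ContinuousOn (fun x ↦ rexp (-(h * x)) * (h ^ 2 * x ^ 2 + 2 * h * x + 2) / x ^ 3)
          (Icc X ((N : ℝ) + 1 / 2)) := by
        refine ContinuousOn.div (by fun_prop) (by fun_prop) fun x hx ↦ ?_
        have : 0 < x := lt_of_lt_of_le hXpos hx.1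
        positivity
      have h2 : ∫ x in X..((N : ℝ) + 1 / 2), m x ≤
          ∫ x in X..((N : ℝ) + 1 / 2), rexp (-(h * x)) * (h ^ 2 * x ^ 2 + 2 * h * x + 2) / x ^ 3 := by
        refine intervalIntegral.integral_mono_on hN.le (hmint _ _ hXpos hN.le)
          (hmajcont.intervalIntegrable_of_Icc hN.le) fun x hx ↦ ?_
        have hx0 : 0 < x := lt_of_lt_of_le hXpos hx.1
        simp only [hm]
        refine max_le ?_ (by positivity)
        have := neg_le_emF'' h hx0
        linarith
      have h3 : ∫ x in X..((N : ℝ) + 1 / 2), rexp (-(h * x)) * (h ^ 2 * x ^ 2 + 2 * h * x + 2) / x ^ 3 =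
          W ((N : ℝ) + 1 / 2) - W X := by
        refine intervalIntegral.integral_eq_sub_of_hasDerivAt (fun x hx ↦ ?_)
          (hmajcont.intervalIntegrable_of_Icc hN.le)
        rw [uIcc_of_le hN.le] at hx
        exact hasDerivAt_W h (lt_of_lt_of_le hXpos hx.1).ne'
      have h4 : W ((N : ℝ) + 1 / 2) ≤ 0 := by
        simp only [hW]
        have : 0 < (N : ℝ) + 1 / 2 := by positivity
        have : 0 ≤ rexp (-(h * ((N : ℝ) + 1 / 2))) * (h * ((N : ℝ) + 1 / 2)⁻¹ + (((N : ℝ) + 1 / 2) ^ 2)⁻¹) := by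
          positivity
        linarith
      have h5 : -W X = rexp (-(6 / 5)) * (55 / 36) * h ^ 2 := by
        simp only [hW, hX]
        have hh0 : h ≠ 0 := hh.ne'
        have e1 : h * (6 / (5 * h)) = 6 / 5 := by field_simp
        rw [e1]
        field_simp
        ring
      rw [hsplit, h1, zero_add]
      linarith [h2, h3, h4, h5]
  -- numerics: `e^{−6/5} · 55/36 / 8 ≤ 0.07`
  have hexp : rexp (-(6 / 5)) ≤ 100 / 292 := by
    have h1 := Real.quadratic_le_exp_of_nonneg (show (0 : ℝ) ≤ 6 / 5 by norm_num)
    rw [Real.exp_neg, inv_le_comm₀ (Real.exp_pos _) (by norm_num)]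
    norm_num at h1 ⊢
    linarith
  have : 1 / 8 * ∫ x in (1 / 2 : ℝ)..((N : ℝ) + 1 / 2), m x ≤ 7 / 100 * h ^ 2 := by
    have hh2' : 0 ≤ h ^ 2 := sq_nonneg h
    nlinarith [hcorr, hexp]
  linarith

/-- `F_h = h φ(h ·)`. [folklore] -/
private theorem emF_eq_phi {h : ℝ} (hh : h ≠ 0) (x : ℝ) : emF h x = h * phi (h * x) := by
  simp only [emF, emU, phi]
  rcases eq_or_ne x 0 with rfl | hx
  · simp
  · field_simp

/-- `F_h` is integrable on `(1/2, ∞)`. [folklore] -/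
private theorem integrableOn_emF {h : ℝ} (hh : 0 < h) : IntegrableOn (emF h) (Ioi (1 / 2)) := by
  have hcont : ContinuousOn (emF h) (Ioi (1 / 2)) := fun x (hx : 1 / 2 < x) ↦
    (hasDerivAt_emF h (by linarith : 0 < x).ne').continuousAt.continuousWithinAt
  refine Integrable.mono' (((exp_neg_integrableOn_Ioi (1 / 2) hh).const_mul (h * (2 * rexp 1))))
    (hcont.aestronglyMeasurable measurableSet_Ioi) ?_
  refine (ae_restrict_iff' measurableSet_Ioi).mpr (ae_of_all _ fun x (hx : 1 / 2 < x) ↦ ?_)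
  rw [Real.norm_eq_abs, emF_eq_phi hh.ne', abs_mul, abs_of_pos hh]
  have := abs_phi_le (y := h * x) (by nlinarith)
  calc h * |phi (h * x)| ≤ h * (2 * rexp 1 * rexp (-1 * (h * x))) :=
        mul_le_mul_of_nonneg_left this hh.le
    _ = h * (2 * rexp 1) * rexp (-h * x) := by ring_nf

/-- `∫_{1/2}^∞ F_h = ∫_{h/2}^∞ φ = γ/2 − ∫₀^{h/2} φ`. [folklore] -/
private theorem integral_emF_Ioi {h : ℝ} (hh : 0 < h) :
    ∫ x in Ioi (1 / 2 : ℝ), emF h x = eulerMascheroniConstant / 2 - ∫ y in (0 : ℝ)..(h / 2), phi y := by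
  have e1 : ∫ x in Ioi (1 / 2 : ℝ), emF h x = h * ∫ x in Ioi (1 / 2 : ℝ), phi (h * x) := by
    rw [← integral_const_mul]
    exact setIntegral_congr_fun measurableSet_Ioi fun x _ ↦ emF_eq_phi hh.ne' x
  rw [e1, integral_comp_mul_left_Ioi phi (1 / 2) hh, smul_eq_mul, ← mul_assoc, mul_inv_cancel₀ hh.ne',
    one_mul, show h * (1 / 2) = h / 2 by ring]
  have := intervalIntegral.integral_Ioi_sub_Ioi integrableOn_phi (show (0 : ℝ) ≤ h / 2 by positivity)
  rw [integral_phi] at this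
  linarith

/-- `Σ_{n≥1} F_h(n)` is summable. [folklore] -/
private theorem summable_emF {h : ℝ} (hh : 0 < h) : Summable fun n : ℕ ↦ emF h (n + 1) := by
  have hgeo : Summable fun n : ℕ ↦ h * (2 * rexp 1) * rexp (-h) * rexp (-h) ^ n :=
    (summable_geometric_of_lt_one (Real.exp_pos _).le (Real.exp_lt_one_iff.mpr (by linarith))).mul_left _
  refine Summable.of_norm_bounded hgeo fun n ↦ ?_
  rw [Real.norm_eq_abs, emF_eq_phi hh.ne', abs_mul, abs_of_pos hh]
  have hpos : 0 < h * ((n : ℝ) + 1) := by positivity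
  have := abs_phi_le hpos
  have e : rexp (-1 * (h * ((n : ℝ) + 1))) = rexp (-h) * rexp (-h) ^ n := by
    rw [← pow_succ', ← Real.exp_nat_mul]; congr 1; push_cast; ring
  calc h * |phi (h * ((n : ℝ) + 1))| ≤ h * (2 * rexp 1 * rexp (-1 * (h * ((n : ℝ) + 1)))) :=
        mul_le_mul_of_nonneg_left this hh.le
    _ = h * (2 * rexp 1) * rexp (-h) * rexp (-h) ^ n := by rw [e]; ring

/-- **`Σ_{n≥1} F_h(n) ≤ γ/2 − h/2 + 0.2575 h²`** for `0 < h ≤ 2` (midpoint Euler–Maclaurin; the exact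
constant `γ/2 = ∫₀^∞ φ`). [folklore] -/
private theorem tsum_emF_le {h : ℝ} (hh : 0 < h) (hh2 : h ≤ 2) :
    ∑' n : ℕ, emF h (n + 1) ≤ eulerMascheroniConstant / 2 - h / 2 + (3 / 16 + 7 / 100) * h ^ 2 := by
  have h1 := (summable_emF hh).hasSum.tendsto_sum_nat
  have h2 : Tendsto (fun N : ℕ ↦ (∫ x in (1 / 2 : ℝ)..((N : ℝ) + 1 / 2), emF h x) + 7 / 100 * h ^ 2)
      atTop (𝓝 ((∫ x in Ioi (1 / 2 : ℝ), emF h x) + 7 / 100 * h ^ 2)) := by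
    refine Tendsto.add_const _ ?_
    exact intervalIntegral_tendsto_integral_Ioi (1 / 2) (integrableOn_emF hh)
      (tendsto_atTop_add_const_right _ _ tendsto_natCast_atTop_atTop)
  have h3 := le_of_tendsto_of_tendsto' h1 h2 (sum_emF_le hh hh2)
  rw [integral_emF_Ioi hh] at h3
  have h4 := integral_phi_ge (b := h / 2) (by positivity)
  nlinarith [h3, h4]

/-! ### `S₁(a) = Σ e^{−an²}/n ≤ ½ log(1/a) + γ/2 + 0.26 a` -/

/-- `Σ_{n≥1} e^{−hn}/n = −log(1 − e^{−h})`. [folklore] -/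
private theorem hasSum_exp_div {h : ℝ} (hh : 0 < h) :
    HasSum (fun n : ℕ ↦ rexp (-(h * ((n : ℝ) + 1))) / ((n : ℝ) + 1)) (-Real.log (1 - rexp (-h))) := by
  have hx : |rexp (-h)| < 1 := by
    rw [abs_of_pos (Real.exp_pos _)]; exact Real.exp_lt_one_iff.mpr (by linarith)
  convert Real.hasSum_pow_div_log_of_abs_lt_one hx using 1
  funext n
  rw [← Real.exp_nat_mul]; push_cast; ring_nf

/-- `−log(1 − e^{−h}) ≤ −log h + h/2` for `h > 0` (`e^{h/2} − e^{−h/2} ≥ h`). [folklore] -/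
private theorem neg_log_one_sub_exp_le {h : ℝ} (hh : 0 < h) :
    -Real.log (1 - rexp (-h)) ≤ -Real.log h + h / 2 := by
  have key : h * rexp (-(h / 2)) ≤ 1 - rexp (-h) := by
    have h1 := two_mul_le_exp_sub_exp_neg (y := h / 2) (by positivity)
    have h2 : rexp (-h) = rexp (-(h / 2)) * rexp (-(h / 2)) := by rw [← Real.exp_add]; ring_nf
    have h3 : rexp (h / 2) * rexp (-(h / 2)) = 1 := by rw [← Real.exp_add]; simp
    nlinarith [Real.exp_pos (-(h / 2))]
  have hpos : 0 < h * rexp (-(h / 2)) := by positivity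
  have := Real.log_le_log hpos key
  rw [Real.log_mul hh.ne' (Real.exp_pos _).ne', Real.log_exp] at this
  linarith

/-- **`Σ_{n≥1} e^{−h²n²}/n ≤ −log h + γ/2 + 0.26 h²`** for `0 < h ≤ 2` — the sum `S₁(a)`, `a = h²`, with its
exact constant `γ/2` (true value `½ log(1/a) + γ/2 + a/12 + O(a²)`). [folklore] -/
private theorem tsum_exp_neg_sq_div_le {h : ℝ} (hh : 0 < h) (hh2 : h ≤ 2) :
    ∑' n : ℕ, rexp (-(h ^ 2 * ((n : ℝ) + 1) ^ 2)) / ((n : ℝ) + 1) ≤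
      -Real.log h + eulerMascheroniConstant / 2 + 13 / 50 * h ^ 2 := by
  have hs1 := summable_emF hh
  have hs2 := (hasSum_exp_div hh).summable
  have e : ∀ n : ℕ, rexp (-(h ^ 2 * ((n : ℝ) + 1) ^ 2)) / ((n : ℝ) + 1) =
      emF h (n + 1) + rexp (-(h * ((n : ℝ) + 1))) / ((n : ℝ) + 1) := by
    intro n; simp only [emF, emU]; ring
  simp_rw [e]
  rw [hs1.tsum_add hs2, (hasSum_exp_div hh).tsum_eq]
  have h1 := tsum_emF_le hh hh2
  have h2 := neg_log_one_sub_exp_le hh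
  nlinarith [h1, h2, sq_nonneg h]

/-! ### The Gaussian tail `G(y) = ∫_y^∞ e^{−u²} du` and the midpoint bound for `Σ_{n≥1} G(nh)` -/

/-- `e^{−u²}` is integrable. [folklore] -/
private theorem integrable_expNegSq : Integrable fun u : ℝ ↦ rexp (-u ^ 2) := by
  simpa using integrable_exp_neg_mul_sq one_pos

/-- `G(y) = ∫₀^∞ e^{−u²} du − ∫₀^y e^{−u²} du` (`= ∫_y^∞ e^{−u²} du` for `y ≥ 0`). [folklore] -/
def gaussianTail (y : ℝ) : ℝ := (∫ u in Ioi (0 : ℝ), rexp (-u ^ 2)) - ∫ u in (0 : ℝ)..y, rexp (-u ^ 2)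

/-- `G(0) = √π/2`. [folklore] -/
private theorem gaussianTail_zero : gaussianTail 0 = Real.sqrt π / 2 := by
  have := integral_gaussian_Ioi 1
  simp only [neg_mul, one_mul, div_one] at this
  simp [gaussianTail, this]

/-- `G′(y) = −e^{−y²}`. [folklore] -/
private theorem hasDerivAt_gaussianTail (y : ℝ) : HasDerivAt gaussianTail (-rexp (-y ^ 2)) y := by
  have hc : Continuous fun u : ℝ ↦ rexp (-u ^ 2) := by fun_prop
  have h := intervalIntegral.integral_hasDerivAt_right (hc.intervalIntegrable 0 y)
    (hc.stronglyMeasurableAtFilter _ _) hc.continuousAt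
  have h2 : HasDerivAt (fun t ↦ (∫ u in Ioi (0 : ℝ), rexp (-u ^ 2)) - ∫ u in (0 : ℝ)..t, rexp (-u ^ 2))
      (0 - rexp (-y ^ 2)) y := (hasDerivAt_const y (∫ u in Ioi (0 : ℝ), rexp (-u ^ 2))).sub h
  rw [zero_sub] at h2
  exact h2

/-- `G` is continuous. [folklore] -/
private theorem continuous_gaussianTail : Continuous gaussianTail :=
  continuous_iff_continuousAt.mpr fun y ↦ (hasDerivAt_gaussianTail y).continuousAt

/-- `G(y) = ∫_y^∞ e^{−u²} du` for `y ≥ 0`. [folklore] -/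
private theorem gaussianTail_eq {y : ℝ} (hy : 0 ≤ y) : gaussianTail y = ∫ u in Ioi y, rexp (-u ^ 2) := by
  have := intervalIntegral.integral_Ioi_sub_Ioi integrable_expNegSq.integrableOn hy
  simp only [gaussianTail]; linarith

/-- `G ≥ 0` on `[0, ∞)`. [folklore] -/
private theorem gaussianTail_nonneg {y : ℝ} (hy : 0 ≤ y) : 0 ≤ gaussianTail y := by
  rw [gaussianTail_eq hy]; exact setIntegral_nonneg measurableSet_Ioi fun u _ ↦ (Real.exp_pos _).le

/-- `∫_y^∞ u e^{−u²} du = e^{−y²}/2`. [folklore] -/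
private theorem integral_mul_expNegSq_Ioi (y : ℝ) :
    ∫ u in Ioi y, u * rexp (-u ^ 2) = rexp (-y ^ 2) / 2 := by
  have hderiv : ∀ u ∈ Ioi y, HasDerivAt (fun u : ℝ ↦ -rexp (-u ^ 2) / 2) (u * rexp (-u ^ 2)) u := by
    intro u _
    have h1 : HasDerivAt (fun u : ℝ ↦ -u ^ 2) (-((2 : ℕ) * u ^ (2 - 1))) u := (hasDerivAt_pow 2 u).neg
    have := (h1.exp.neg).div_const 2
    refine this.congr_deriv ?_
    simp only [Nat.cast_ofNat]; ring
  have hint : IntegrableOn (fun u : ℝ ↦ u * rexp (-u ^ 2)) (Ioi y) := by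
    have := integrable_mul_exp_neg_mul_sq one_pos
    simp only [neg_mul, one_mul] at this
    exact this.integrableOn
  have hlim : Tendsto (fun u : ℝ ↦ -rexp (-u ^ 2) / 2) atTop (𝓝 (-0 / 2)) := by
    refine (Tendsto.neg ?_).div_const 2
    exact Real.tendsto_exp_neg_atTop_nhds_zero.comp (tendsto_pow_atTop two_ne_zero)
  rw [integral_Ioi_of_hasDerivAt_of_tendsto ((by fun_prop : Continuous fun u : ℝ ↦
    -rexp (-u ^ 2) / 2).continuousWithinAt) hderiv hint hlim]
  ring

/-- `y G(y) ≤ e^{−y²}/2` for `y > 0` (`e^{−u²} ≤ (u/y) e^{−u²}` for `u ≥ y`). [folklore] -/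
private theorem mul_gaussianTail_le {y : ℝ} (hy : 0 < y) : y * gaussianTail y ≤ rexp (-y ^ 2) / 2 := by
  rw [gaussianTail_eq hy.le]
  have hint2 : IntegrableOn (fun u : ℝ ↦ u * rexp (-u ^ 2) / y) (Ioi y) := by
    have := integrable_mul_exp_neg_mul_sq one_pos
    simp only [neg_mul, one_mul] at this
    exact (this.div_const y).integrableOn
  have h1 : ∫ u in Ioi y, rexp (-u ^ 2) ≤ ∫ u in Ioi y, u * rexp (-u ^ 2) / y := by
    refine setIntegral_mono_on integrable_expNegSq.integrableOn hint2 measurableSet_Ioi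
      fun u (hu : y < u) ↦ ?_
    rw [le_div_iff₀ hy]
    nlinarith [Real.exp_pos (-u ^ 2)]
  have h2 : ∫ u in Ioi y, u * rexp (-u ^ 2) / y = (rexp (-y ^ 2) / 2) / y := by
    simp only [div_eq_mul_inv]
    rw [integral_mul_const, integral_mul_expNegSq_Ioi]
    ring
  rw [h2] at h1
  calc y * ∫ u in Ioi y, rexp (-u ^ 2) ≤ y * (rexp (-y ^ 2) / 2 / y) :=
        mul_le_mul_of_nonneg_left h1 hy.le
    _ = rexp (-y ^ 2) / 2 := by field_simp

/-- `G(y) ≥ √π/2 − y` for `y ≥ 0` (`G′ ≥ −1`). [folklore] -/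
private theorem gaussianTail_ge {y : ℝ} (hy : 0 ≤ y) : Real.sqrt π / 2 - y ≤ gaussianTail y := by
  have key := le_of_deriv_nonneg (g := fun t ↦ gaussianTail t + t) (g' := fun t ↦ -rexp (-t ^ 2) + 1) hy
    (fun t _ ↦ (hasDerivAt_gaussianTail t).add (hasDerivAt_id t)) fun t _ ↦ by
      have : rexp (-t ^ 2) ≤ 1 := Real.exp_le_one_iff.mpr (by nlinarith); linarith
  simp only [gaussianTail_zero, add_zero] at key
  linarith

/-- The antiderivative `Φ(Y) = Y G(Y) + (1 − e^{−Y²})/2` of `G`. [folklore] -/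
private theorem hasDerivAt_gAnti (Y : ℝ) :
    HasDerivAt (fun Y ↦ Y * gaussianTail Y + (1 - rexp (-Y ^ 2)) / 2) (gaussianTail Y) Y := by
  have h1 := (hasDerivAt_id Y).mul (hasDerivAt_gaussianTail Y)
  have h2 : HasDerivAt (fun Y : ℝ ↦ -Y ^ 2) (-((2 : ℕ) * Y ^ (2 - 1))) Y := (hasDerivAt_pow 2 Y).neg
  have h3 := (h2.exp.const_sub 1).div_const 2
  have := h1.add h3
  refine this.congr_deriv ?_
  simp only [id, Nat.cast_ofNat]; ring

/-- `∫_a^b G = Φ(b) − Φ(a)`. [folklore] -/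
private theorem integral_gaussianTail (a b : ℝ) : ∫ y in a..b, gaussianTail y =
    (b * gaussianTail b + (1 - rexp (-b ^ 2)) / 2) - (a * gaussianTail a + (1 - rexp (-a ^ 2)) / 2) :=
  intervalIntegral.integral_eq_sub_of_hasDerivAt (fun Y _ ↦ hasDerivAt_gAnti Y)
    (continuous_gaussianTail.intervalIntegrable _ _)

/-- `∫_{h/2}^{Y} G ≤ ½ − (√π/4) h + h²/8` for `0 ≤ h/2 ≤ Y` (`Φ(Y) ≤ ½`, `Φ(h/2) ≥ ∫₀^{h/2}(√π/2 − y) dy`).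
[folklore] -/
private theorem integral_gaussianTail_le {h Y : ℝ} (hh : 0 ≤ h) (hY0 : 0 < Y) :
    ∫ y in (h / 2)..Y, gaussianTail y ≤ 1 / 2 - Real.sqrt π / 4 * h + h ^ 2 / 8 := by
  rw [integral_gaussianTail]
  have h1 := mul_gaussianTail_le hY0
  -- `Φ(h/2) = ∫₀^{h/2} G ≥ (√π/4) h − h²/8`
  have h2 : Real.sqrt π / 4 * h - h ^ 2 / 8 ≤ (h / 2) * gaussianTail (h / 2) + (1 - rexp (-(h / 2) ^ 2)) / 2 := by
    have e := integral_gaussianTail 0 (h / 2)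
    simp only [zero_mul, ne_eq, OfNat.ofNat_ne_zero, not_false_eq_true, zero_pow, neg_zero,
      Real.exp_zero, sub_self, zero_div, add_zero, sub_zero] at e
    rw [← e]
    have hlin : ∫ y in (0 : ℝ)..(h / 2), (Real.sqrt π / 2 - y) = Real.sqrt π / 4 * h - h ^ 2 / 8 := by
      have hd : ∀ y ∈ uIcc (0 : ℝ) (h / 2),
          HasDerivAt (fun y : ℝ ↦ Real.sqrt π / 2 * y - y ^ 2 / 2) (Real.sqrt π / 2 - y) y := by
        intro y _
        have := ((hasDerivAt_id y).const_mul (Real.sqrt π / 2)).sub ((hasDerivAt_pow 2 y).div_const 2)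
        refine this.congr_deriv ?_
        simp only [Nat.cast_ofNat]; ring
      rw [intervalIntegral.integral_eq_sub_of_hasDerivAt hd ((by fun_prop : Continuous fun y : ℝ ↦
        Real.sqrt π / 2 - y).intervalIntegrable _ _)]
      ring
    rw [← hlin]
    exact intervalIntegral.integral_mono_on (by positivity)
      ((by fun_prop : Continuous fun y : ℝ ↦ Real.sqrt π / 2 - y).intervalIntegrable _ _)
      (continuous_gaussianTail.intervalIntegrable _ _) fun y hy ↦ gaussianTail_ge hy.1
  have h3 : 0 ≤ rexp (-(h / 2) ^ 2) := (Real.exp_pos _).le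
  nlinarith [h1, h2, Real.exp_pos (-Y ^ 2)]

/-- Partial sums: `Σ_{n=1}^{N} G(nh) ≤ h⁻¹ (½ − (√π/4) h + h²/8)` (midpoint rule for the convex `G`). [folklore] -/
private theorem sum_gaussianTail_le {h : ℝ} (hh : 0 < h) (N : ℕ) :
    ∑ n ∈ Finset.range N, gaussianTail (h * ((n : ℝ) + 1)) ≤ h⁻¹ * (1 / 2 - Real.sqrt π / 4 * h + h ^ 2 / 8) := by
  -- per cell, with `f(x) = G(hx)`, `f″(x) = 2h³x e^{−h²x²} ≥ 0`
  have hcell : ∀ n : ℕ, gaussianTail (h * ((n : ℝ) + 1)) ≤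
      (∫ x in ((n : ℝ) + 1 - 1 / 2)..((n : ℝ) + 1 + 1 / 2), gaussianTail (h * x)) +
        1 / 8 * ∫ x in ((n : ℝ) + 1 - 1 / 2)..((n : ℝ) + 1 + 1 / 2), (0 : ℝ) := by
    intro n
    have hpos : ∀ x ∈ Icc ((n : ℝ) + 1 - 1 / 2) ((n : ℝ) + 1 + 1 / 2), 0 < x := fun x hx ↦ by
      have := hx.1; have : (0 : ℝ) ≤ n := n.cast_nonneg; linarith
    refine le_integral_cell (f := fun x ↦ gaussianTail (h * x)) (f' := fun x ↦ -(h * rexp (-(h ^ 2 * x ^ 2))))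
      (f'' := fun x ↦ 2 * h ^ 3 * x * rexp (-(h ^ 2 * x ^ 2))) (m := fun _ ↦ 0)
      (fun x _ ↦ ?_) (fun x _ ↦ ?_) ?_ continuousOn_const (fun x hx ↦ ?_) (fun x _ ↦ le_rfl)
    · have := (hasDerivAt_gaussianTail (h * x)).comp x ((hasDerivAt_id x).const_mul h)
      refine this.congr_deriv ?_
      rw [mul_pow]; simp only [mul_one]; ring
    · have := ((hasDerivAt_expNegSq' (h ^ 2) x).const_mul h).neg
      exact this.congr_deriv (by ring)
    · exact Continuous.continuousOn (by fun_prop)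
    · have := hpos x hx
      have : 0 ≤ 2 * h ^ 3 * x * rexp (-(h ^ 2 * x ^ 2)) := by positivity
      linarith
  have hint : ∀ a b : ℝ, IntervalIntegrable (fun x ↦ gaussianTail (h * x)) volume a b := fun a b ↦
    (continuous_gaussianTail.comp (continuous_const.mul continuous_id)).intervalIntegrable _ _
  have hsum : ∑ n ∈ Finset.range N, ∫ x in ((n : ℝ) + 1 - 1 / 2)..((n : ℝ) + 1 + 1 / 2), gaussianTail (h * x) =
      ∫ x in (1 / 2 : ℝ)..((N : ℝ) + 1 / 2), gaussianTail (h * x) := by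
    have := intervalIntegral.sum_integral_adjacent_intervals (a := fun k : ℕ ↦ (k : ℝ) + 1 / 2)
      (n := N) (f := fun x ↦ gaussianTail (h * x)) (μ := volume) fun k _ ↦ hint _ _
    simp only [Nat.cast_zero, zero_add, Nat.cast_add, Nat.cast_one] at this
    rw [← this]
    refine Finset.sum_congr rfl fun n _ ↦ ?_
    congr 1; ring
  have hle : ∑ n ∈ Finset.range N, gaussianTail (h * ((n : ℝ) + 1)) ≤
      ∫ x in (1 / 2 : ℝ)..((N : ℝ) + 1 / 2), gaussianTail (h * x) := by
    calc ∑ n ∈ Finset.range N, gaussianTail (h * ((n : ℝ) + 1))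
        ≤ ∑ n ∈ Finset.range N, ((∫ x in ((n : ℝ) + 1 - 1 / 2)..((n : ℝ) + 1 + 1 / 2), gaussianTail (h * x)) +
            1 / 8 * ∫ x in ((n : ℝ) + 1 - 1 / 2)..((n : ℝ) + 1 + 1 / 2), (0 : ℝ)) :=
          Finset.sum_le_sum fun n _ ↦ hcell n
      _ = _ := by rw [Finset.sum_add_distrib, ← hsum]; simp
  -- substitute `y = hx`
  have hsub : ∫ x in (1 / 2 : ℝ)..((N : ℝ) + 1 / 2), gaussianTail (h * x) =
      h⁻¹ * ∫ y in (h / 2)..(h * ((N : ℝ) + 1 / 2)), gaussianTail y := by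
    rw [intervalIntegral.integral_comp_mul_left (fun y ↦ gaussianTail y) hh.ne', smul_eq_mul,
      show h * (1 / 2) = h / 2 by ring]
  rw [hsub] at hle
  have := integral_gaussianTail_le (Y := h * ((N : ℝ) + 1 / 2)) hh.le (by positivity)
  calc ∑ n ∈ Finset.range N, gaussianTail (h * ((n : ℝ) + 1)) ≤ h⁻¹ * ∫ y in (h / 2)..(h * ((N : ℝ) + 1 / 2)), gaussianTail y := hle
    _ ≤ h⁻¹ * (1 / 2 - Real.sqrt π / 4 * h + h ^ 2 / 8) :=
        mul_le_mul_of_nonneg_left this (inv_nonneg.mpr hh.le)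

/-- **`Σ_{n≥1} G(nh) ≤ h⁻¹ (½ − (√π/4) h + h²/8)`** for `h > 0`. [folklore] -/
private theorem tsum_gaussianTail_le {h : ℝ} (hh : 0 < h) :
    ∑' n : ℕ, gaussianTail (h * ((n : ℝ) + 1)) ≤ h⁻¹ * (1 / 2 - Real.sqrt π / 4 * h + h ^ 2 / 8) :=
  Real.tsum_le_of_sum_range_le (fun n ↦ gaussianTail_nonneg (by positivity)) (sum_gaussianTail_le hh)

/-- `G(y) ≤ e^{−y²}/(2y)` for `y > 0`, the tail bound used for summability. [folklore] -/
private theorem gaussianTail_le {y : ℝ} (hy : 0 < y) : gaussianTail y ≤ rexp (-y ^ 2) / (2 * y) := by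
  have := mul_gaussianTail_le hy
  rw [le_div_iff₀ (by positivity)]
  linarith

/-! ### The term integrals: `∫₁^∞ e^{−k²t} dt/√t = (2/k) G(k)` and `∫₁^∞ e^{−ct} dt = e^{−c}/c` -/

/-- `t ↦ e^{−ct}/√t` is integrable on `[1, ∞)` for `c > 0`. [folklore] -/
private theorem integrableOn_exp_inv_sqrt {c : ℝ} (hc : 0 < c) :
    IntegrableOn (fun t : ℝ ↦ rexp (-(c * t)) * (Real.sqrt t)⁻¹) (Ici 1) := by
  have hcont : ContinuousOn (fun t : ℝ ↦ rexp (-(c * t)) * (Real.sqrt t)⁻¹) (Ici 1) := by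
    refine ContinuousOn.mul (by fun_prop) (ContinuousOn.inv₀ (by fun_prop) fun t (ht : 1 ≤ t) ↦ ?_)
    exact (Real.sqrt_pos.mpr (by linarith)).ne'
  have hdom : IntegrableOn (fun t : ℝ ↦ rexp (-c * t)) (Ici 1) :=
    (exp_neg_integrableOn_Ioi 0 hc).mono_set fun t (ht : 1 ≤ t) ↦ (by linarith : 0 < t)
  refine Integrable.mono' hdom (hcont.aestronglyMeasurable measurableSet_Ici) ?_
  refine (ae_restrict_iff' measurableSet_Ici).mpr (ae_of_all _ fun t (ht : 1 ≤ t) ↦ ?_)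
  have hs1 : 1 ≤ Real.sqrt t := by rw [show (1:ℝ) = Real.sqrt 1 by simp]; exact Real.sqrt_le_sqrt ht
  rw [norm_mul, Real.norm_eq_abs, Real.norm_eq_abs, abs_of_pos (Real.exp_pos _),
    abs_of_pos (by positivity), neg_mul]
  calc rexp (-(c * t)) * (Real.sqrt t)⁻¹ ≤ rexp (-(c * t)) * 1 := by
        refine mul_le_mul_of_nonneg_left (inv_le_one_of_one_le₀ hs1) (Real.exp_pos _).le
    _ = rexp (-(c * t)) := mul_one _

/-- `∫₁^∞ e^{−k²t} dt/√t = (2/k) G(k)` for `k > 0` (substitution `u = k√t`). [folklore] -/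
private theorem integral_exp_inv_sqrt {k : ℝ} (hk : 0 < k) :
    ∫ t in Ioi (1 : ℝ), rexp (-(k ^ 2 * t)) * (Real.sqrt t)⁻¹ = 2 / k * gaussianTail k := by
  set f : ℝ → ℝ := fun t ↦ k * Real.sqrt t with hf
  set f' : ℝ → ℝ := fun t ↦ k * (1 / (2 * Real.sqrt t)) with hf'
  set g : ℝ → ℝ := fun u ↦ 2 / k * rexp (-u ^ 2) with hg
  have hfg : ∀ t ∈ Ioi (1 : ℝ), rexp (-(k ^ 2 * t)) * (Real.sqrt t)⁻¹ = (g ∘ f) t * f' t := by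
    intro t (ht : 1 < t)
    have ht0 : 0 ≤ t := by linarith
    have hs : 0 < Real.sqrt t := Real.sqrt_pos.mpr (by linarith)
    simp only [hg, hf, hf', Function.comp]
    rw [mul_pow, Real.sq_sqrt ht0]
    field_simp
  rw [setIntegral_congr_fun measurableSet_Ioi hfg]
  have hcf : ContinuousOn f (Ici 1) := by simp only [hf]; fun_prop
  have hft : Tendsto f atTop atTop := by
    simp only [hf]; exact Real.tendsto_sqrt_atTop.const_mul_atTop hk
  have hff' : ∀ t ∈ Ioi (1 : ℝ), HasDerivWithinAt f (f' t) (Ioi t) t := fun t (ht : 1 < t) ↦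
    ((Real.hasDerivAt_sqrt (by linarith : t ≠ 0)).const_mul k).hasDerivWithinAt
  have hgc : ContinuousOn g (f '' Ioi 1) := Continuous.continuousOn (by simp only [hg]; fun_prop)
  have hg1 : IntegrableOn g (f '' Ici 1) := (integrable_expNegSq.const_mul _).integrableOn
  have hg2 : IntegrableOn (fun t ↦ (g ∘ f) t * f' t) (Ici 1) := by
    refine (integrableOn_exp_inv_sqrt (c := k ^ 2) (by positivity)).congr_fun (fun t (ht : 1 ≤ t) ↦ ?_)
      measurableSet_Ici
    have ht0 : 0 ≤ t := by linarith
    have hs : 0 < Real.sqrt t := Real.sqrt_pos.mpr (by linarith)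
    simp only [hg, hf, hf', Function.comp]
    rw [mul_pow, Real.sq_sqrt ht0]
    field_simp
  rw [integral_comp_mul_deriv_Ioi hcf hft hff' hgc hg1 hg2]
  simp only [hf, hg, Real.sqrt_one, mul_one]
  rw [integral_const_mul, gaussianTail_eq hk.le]

/-- `∫₁^∞ e^{−ct} dt = e^{−c}/c` for `c > 0`. [folklore] -/
private theorem integral_exp_Ioi_one {c : ℝ} (hc : 0 < c) :
    ∫ t in Ioi (1 : ℝ), rexp (-(c * t)) = rexp (-c) / c := by
  have := integral_exp_mul_Ioi (a := -c) (by linarith) 1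
  simp only [neg_mul, mul_one] at this
  rw [this]; field_simp

/-! ### `I₁(q)` as a series: `I₁(q) = (q/π) Σ e^{−h²n²}/n + (2/h) Σ G(nh)`, `h = √(π/q)` -/

/-- Louboutin's `κ₁ = 2 + γ − log π = 1.4325…` ((1) p. 200). [cite: Louboutin2006RelativeClassNumbers, (1) p. 200] -/
def kappaOdd : ℝ := 2 + eulerMascheroniConstant - Real.log π

/-- `κ₁/2 < 0.7163` (`κ₁/2 = 0.716243…`; from `γ < 0.57721571`, `log π > 1.1447298858`).
[cite: Louboutin2006RelativeClassNumbers, (1) p. 200] -/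
theorem kappaOdd_div_two_lt : kappaOdd / 2 < 0.7163 := by
  have hγ := Literature.Analysis.SpecialFunctions.Real.eulerMascheroniConstant_lt_d8
  have hπ := Literature.Analysis.SpecialFunctions.Real.log_pi_gt_d20
  unfold kappaOdd
  norm_num at hγ hπ ⊢
  linarith

/-- The series representation of `I₁(q)` obtained by integrating the theta series termwise:
`I₁(q) = (q/π) Σ_{n≥1} e^{−h²n²}/n + (2/h) Σ_{n≥1} G(nh)` with `h = √(π/q)`
(`∫₁^∞ n e^{−πn²t/q} dt = (q/π) e^{−πn²/q}/n`, `∫₁^∞ n e^{−πn²t/q} dt/√t = (2/h) G(nh)`).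
[cite: Louboutin2006RelativeClassNumbers, Lemma 4 p. 202 / (7)] -/
theorem oddMajorant_eq_tsum {q : ℝ} (hq : 0 < q) :
    oddMajorant q = q / π * ∑' n : ℕ, rexp (-(Real.sqrt (π / q) ^ 2 * ((n : ℝ) + 1) ^ 2)) / ((n : ℝ) + 1) +
      2 / Real.sqrt (π / q) * ∑' n : ℕ, gaussianTail (Real.sqrt (π / q) * ((n : ℝ) + 1)) := by
  set h : ℝ := Real.sqrt (π / q) with hh_def
  have hπq : 0 < π / q := div_pos Real.pi_pos hq
  have hh : 0 < h := Real.sqrt_pos.mpr hπq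
  have hh2 : h ^ 2 = π / q := Real.sq_sqrt hπq.le
  -- the terms and their integrals
  set T : ℕ → ℝ → ℝ := fun n t ↦
    ((n : ℝ) + 1) * rexp (-(π * ((n : ℝ) + 1) ^ 2 * (t / q))) * (1 + (Real.sqrt t)⁻¹) with hT
  set c : ℕ → ℝ := fun n ↦ h ^ 2 * ((n : ℝ) + 1) ^ 2 with hc
  have hcpos : ∀ n, 0 < c n := fun n ↦ by positivity
  have hcexp : ∀ (n : ℕ) (t : ℝ), π * ((n : ℝ) + 1) ^ 2 * (t / q) = c n * t := fun n t ↦ by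
    simp only [hc, hh2]; field_simp
  have hTeq : ∀ n t, T n t = ((n : ℝ) + 1) * (rexp (-(c n * t)) + rexp (-(c n * t)) * (Real.sqrt t)⁻¹) := by
    intro n t; simp only [hT, hcexp]; ring
  set val : ℕ → ℝ := fun n ↦ q / π * (rexp (-(h ^ 2 * ((n : ℝ) + 1) ^ 2)) / ((n : ℝ) + 1)) +
    2 / h * gaussianTail (h * ((n : ℝ) + 1)) with hval
  have hint1 : ∀ n, IntegrableOn (fun t ↦ rexp (-(c n * t))) (Ioi 1) := fun n ↦ by
    have := exp_neg_integrableOn_Ioi 1 (hcpos n)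
    exact IntegrableOn.congr_fun this (fun t _ ↦ by simp only [neg_mul]) measurableSet_Ioi
  have hint2 : ∀ n, IntegrableOn (fun t ↦ rexp (-(c n * t)) * (Real.sqrt t)⁻¹) (Ioi 1) := fun n ↦
    (integrableOn_exp_inv_sqrt (hcpos n)).mono_set Ioi_subset_Ici_self
  have hTint : ∀ n, IntegrableOn (T n) (Ioi 1) := fun n ↦ by
    have h12 : IntegrableOn (fun t ↦ rexp (-(c n * t)) + rexp (-(c n * t)) * (Real.sqrt t)⁻¹) (Ioi 1) :=
      (hint1 n).add (hint2 n)
    have h3 : IntegrableOn (fun t ↦ ((n : ℝ) + 1) * (rexp (-(c n * t)) + rexp (-(c n * t)) *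
        (Real.sqrt t)⁻¹)) (Ioi 1) := h12.const_mul ((n : ℝ) + 1)
    exact IntegrableOn.congr_fun h3 (fun t _ ↦ (hTeq n t).symm) measurableSet_Ioi
  have hTval : ∀ n, ∫ t in Ioi (1 : ℝ), T n t = val n := by
    intro n
    have hk : 0 < h * ((n : ℝ) + 1) := by positivity
    have hck : c n = (h * ((n : ℝ) + 1)) ^ 2 := by simp only [hc]; ring
    rw [setIntegral_congr_fun measurableSet_Ioi (fun t _ ↦ hTeq n t), integral_const_mul,
      integral_add (hint1 n) (hint2 n), integral_exp_Ioi_one (hcpos n)]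
    have e2 : ∫ t in Ioi (1 : ℝ), rexp (-(c n * t)) * (Real.sqrt t)⁻¹ = 2 / (h * ((n : ℝ) + 1)) *
        gaussianTail (h * ((n : ℝ) + 1)) := by
      rw [hck]; exact integral_exp_inv_sqrt hk
    rw [e2]
    show _ = q / π * (rexp (-(h ^ 2 * ((n : ℝ) + 1) ^ 2)) / ((n : ℝ) + 1)) + 2 / h * gaussianTail (h * ((n : ℝ) + 1))
    simp only [hc]
    have hn : (n : ℝ) + 1 ≠ 0 := by positivity
    rw [hh2]
    field_simp
  -- nonnegativity and the summable majorant
  have hTnn : ∀ n, ∀ t ∈ Ioi (1 : ℝ), 0 ≤ T n t := fun n t _ ↦ by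
    show 0 ≤ ((n : ℝ) + 1) * rexp (-(π * ((n : ℝ) + 1) ^ 2 * (t / q))) * (1 + (Real.sqrt t)⁻¹)
    have : 0 ≤ (Real.sqrt t)⁻¹ := inv_nonneg.mpr (Real.sqrt_nonneg t)
    positivity
  have hnorm : ∀ n, ∫ t in Ioi (1 : ℝ), ‖T n t‖ = val n := fun n ↦ by
    rw [← hTval n]
    exact setIntegral_congr_fun measurableSet_Ioi fun t ht ↦ by
      rw [Real.norm_eq_abs, abs_of_nonneg (hTnn n t ht)]
  set r : ℝ := rexp (-h ^ 2) with hr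
  have hr0 : 0 ≤ r := (Real.exp_pos _).le
  have hr1 : r < 1 := Real.exp_lt_one_iff.mpr (by nlinarith)
  have hexp_le : ∀ n : ℕ, rexp (-(h ^ 2 * ((n : ℝ) + 1) ^ 2)) ≤ r * r ^ n := by
    intro n
    rw [hr, ← pow_succ', ← Real.exp_nat_mul, Real.exp_le_exp]
    push_cast
    have h1 : (n : ℝ) + 1 ≤ ((n : ℝ) + 1) ^ 2 := by nlinarith [n.cast_nonneg (α := ℝ)]
    nlinarith [sq_nonneg h]
  have hval_le : ∀ n, val n ≤ (q / π + h⁻¹ * h⁻¹) * r * r ^ n := by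
    intro n
    have hn1 : (1 : ℝ) ≤ (n : ℝ) + 1 := by have := n.cast_nonneg (α := ℝ); linarith
    have hk : 0 < h * ((n : ℝ) + 1) := by positivity
    have hA : rexp (-(h ^ 2 * ((n : ℝ) + 1) ^ 2)) / ((n : ℝ) + 1) ≤ r * r ^ n :=
      (div_le_self (Real.exp_pos _).le hn1).trans (hexp_le n)
    have hB : 2 / h * gaussianTail (h * ((n : ℝ) + 1)) ≤ h⁻¹ * h⁻¹ * (r * r ^ n) := by
      have hg := gaussianTail_le hk
      have e : (h * ((n : ℝ) + 1)) ^ 2 = h ^ 2 * ((n : ℝ) + 1) ^ 2 := by ring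
      rw [e] at hg
      calc 2 / h * gaussianTail (h * ((n : ℝ) + 1))
          ≤ 2 / h * (rexp (-(h ^ 2 * ((n : ℝ) + 1) ^ 2)) / (2 * (h * ((n : ℝ) + 1)))) :=
            mul_le_mul_of_nonneg_left hg (by positivity)
        _ = h⁻¹ * h⁻¹ * (rexp (-(h ^ 2 * ((n : ℝ) + 1) ^ 2)) / ((n : ℝ) + 1)) := by
            field_simp
        _ ≤ h⁻¹ * h⁻¹ * (r * r ^ n) := mul_le_mul_of_nonneg_left hA (by positivity)
    have hqπ : 0 ≤ q / π := (div_pos hq Real.pi_pos).le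
    calc val n = q / π * (rexp (-(h ^ 2 * ((n : ℝ) + 1) ^ 2)) / ((n : ℝ) + 1)) +
        2 / h * gaussianTail (h * ((n : ℝ) + 1)) := rfl
      _ ≤ q / π * (r * r ^ n) + h⁻¹ * h⁻¹ * (r * r ^ n) :=
          add_le_add (mul_le_mul_of_nonneg_left hA hqπ) hB
      _ = (q / π + h⁻¹ * h⁻¹) * r * r ^ n := by ring
  have hval_nn : ∀ n, 0 ≤ val n := fun n ↦ by
    rw [← hTval n]; exact setIntegral_nonneg measurableSet_Ioi (hTnn n)
  have hsum_val : Summable val :=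
    Summable.of_nonneg_of_le hval_nn hval_le ((summable_geometric_of_lt_one hr0 hr1).mul_left _)
  -- termwise integration
  have hHS := hasSum_integral_of_summable_integral_norm (μ := volume.restrict (Ioi (1 : ℝ)))
    (F := T) hTint (hsum_val.congr fun n ↦ (hnorm n).symm)
  have hpt : ∫ t in Ioi (1 : ℝ), (∑' n, T n t) = oddMajorant q := by
    refine setIntegral_congr_fun measurableSet_Ioi fun t (ht : 1 < t) ↦ ?_
    have htq : 0 < t / q := div_pos (by linarith) hq
    have := (hasSum_thetaMajorOdd htq).mul_right (1 + (Real.sqrt t)⁻¹)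
    simpa only [hT] using this.tsum_eq
  rw [hpt] at hHS
  rw [← hHS.tsum_eq, tsum_congr hTval]
  -- split the series
  have hs1 : Summable fun n : ℕ ↦ rexp (-(h ^ 2 * ((n : ℝ) + 1) ^ 2)) / ((n : ℝ) + 1) := by
    refine Summable.of_nonneg_of_le (fun n ↦ by positivity)
      (fun n ↦ (div_le_self (Real.exp_pos _).le ?_).trans (hexp_le n))
      ((summable_geometric_of_lt_one hr0 hr1).mul_left r)
    have := n.cast_nonneg (α := ℝ); linarith
  have hs2 : Summable fun n : ℕ ↦ gaussianTail (h * ((n : ℝ) + 1)) := by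
    refine Summable.of_nonneg_of_le (fun n ↦ gaussianTail_nonneg (by positivity)) (fun n ↦ ?_)
      ((summable_geometric_of_lt_one hr0 hr1).mul_left (h⁻¹ * r))
    have hk : 0 < h * ((n : ℝ) + 1) := by positivity
    have hn1 : (1 : ℝ) ≤ (n : ℝ) + 1 := by have := n.cast_nonneg (α := ℝ); linarith
    have hg := gaussianTail_le hk
    have e : (h * ((n : ℝ) + 1)) ^ 2 = h ^ 2 * ((n : ℝ) + 1) ^ 2 := by ring
    rw [e] at hg
    calc gaussianTail (h * ((n : ℝ) + 1)) ≤ rexp (-(h ^ 2 * ((n : ℝ) + 1) ^ 2)) / (2 * (h * ((n : ℝ) + 1))) := hg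
      _ ≤ (r * r ^ n) / (2 * (h * ((n : ℝ) + 1))) :=
          div_le_div_of_nonneg_right (hexp_le n) (by positivity)
      _ ≤ h⁻¹ * r * r ^ n := by
          rw [div_le_iff₀ (by positivity)]
          have : 0 ≤ r * r ^ n := by positivity
          have : h⁻¹ * r * r ^ n * (2 * (h * ((n : ℝ) + 1))) = (r * r ^ n) * (2 * ((n : ℝ) + 1)) := by
            field_simp
          rw [this]; nlinarith
  simp only [hval]
  rw [Summable.tsum_add (hs1.mul_left _) (hs2.mul_left _), tsum_mul_left, tsum_mul_left]

/-- **Louboutin 2006, Lemma 9 (15) with the PRINTED constant:** `I₁(q) ≤ (q/2π)(log q + κ₁)`,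
`κ₁ = 2 + γ − log π`, for every real `q ≥ 2` (printed for conductors `f ≥ 3`; the exact value is
`(q/2π)(log q + κ₁) − ½√q + ¼ + O(q^{−1/2})`). Elementary proof: `S₁ = Σ e^{−h²n²}/n ≤ ½ log(q/π) + γ/2 + 0.26 π/q`
(`tsum_exp_neg_sq_div_le`, exact constant `γ/2 = ∫₀^∞ (e^{−x²} − e^{−x}) dx/x`) and
`(2/h) Σ G(nh) ≤ q/π − ½√q + ¼` (midpoint rule for the convex Gaussian tail), in place of the contour shift
to `Re s = −1/2` of the source. [cite: Louboutin2006RelativeClassNumbers, Lemma 9 (15) p. 206] -/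
theorem oddMajorant_le_sharp {q : ℝ} (hq : 2 ≤ q) :
    oddMajorant q ≤ q / (2 * π) * (Real.log q + kappaOdd) := by
  have hq0 : 0 < q := by linarith
  set h : ℝ := Real.sqrt (π / q) with hh_def
  have hπq : 0 < π / q := div_pos Real.pi_pos hq0
  have hh : 0 < h := Real.sqrt_pos.mpr hπq
  have hh2 : h ^ 2 = π / q := Real.sq_sqrt hπq.le
  have hπ4 : π < 4 := Real.pi_lt_four
  have hhle : h ≤ 2 := by
    have : h ^ 2 ≤ 2 ^ 2 := by rw [hh2, div_le_iff₀ hq0]; nlinarith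
    nlinarith
  rw [oddMajorant_eq_tsum hq0]
  have hS := tsum_exp_neg_sq_div_le hh hhle
  have hG := tsum_gaussianTail_le hh
  have hqπ : 0 < q / π := div_pos hq0 Real.pi_pos
  have h1 : q / π * ∑' n : ℕ, rexp (-(h ^ 2 * ((n : ℝ) + 1) ^ 2)) / ((n : ℝ) + 1) ≤
      q / π * (-Real.log h + eulerMascheroniConstant / 2 + 13 / 50 * h ^ 2) :=
    mul_le_mul_of_nonneg_left hS hqπ.le
  have h2 : 2 / h * ∑' n : ℕ, gaussianTail (h * ((n : ℝ) + 1)) ≤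
      2 / h * (h⁻¹ * (1 / 2 - Real.sqrt π / 4 * h + h ^ 2 / 8)) :=
    mul_le_mul_of_nonneg_left hG (by positivity)
  -- identities: `log h = (log π − log q)/2`, `(q/π) h² = 1`, `√π/h = √q`
  have hlogh : Real.log h = (Real.log π - Real.log q) / 2 := by
    rw [hh_def, Real.log_sqrt hπq.le, Real.log_div Real.pi_pos.ne' hq0.ne']
  have hqh : q / π * h ^ 2 = 1 := by rw [hh2]; field_simp
  have hsq : Real.sqrt π / h = Real.sqrt q := by
    rw [hh_def, Real.sqrt_div' π hq0.le]   -- √(π/q) = √π/√q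
    have : 0 < Real.sqrt q := Real.sqrt_pos.mpr hq0
    have : 0 < Real.sqrt π := Real.sqrt_pos.mpr Real.pi_pos
    field_simp
  have hsqq : 51 / 50 ≤ Real.sqrt q := by
    rw [show (51 / 50 : ℝ) = Real.sqrt ((51 / 50) ^ 2) by rw [Real.sqrt_sq (by norm_num)]]
    exact Real.sqrt_le_sqrt (by nlinarith)
  -- assemble
  have e1 : q / π * (-Real.log h + eulerMascheroniConstant / 2 + 13 / 50 * h ^ 2) =
      q / (2 * π) * (Real.log q - Real.log π + eulerMascheroniConstant) + 13 / 50 := by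
    have h13 : q / π * (13 / 50 * h ^ 2) = 13 / 50 := by
      rw [show q / π * (13 / 50 * h ^ 2) = 13 / 50 * (q / π * h ^ 2) by ring, hqh, mul_one]
    rw [hlogh, mul_add, h13]
    ring
  have e2 : 2 / h * (h⁻¹ * (1 / 2 - Real.sqrt π / 4 * h + h ^ 2 / 8)) =
      q / π - Real.sqrt q / 2 + 1 / 4 := by
    rw [← hsq]
    have hqπ' : q / π = (h ^ 2)⁻¹ := by rw [hh2, inv_div]
    rw [hqπ']
    field_simp
    ring
  rw [e1] at h1; rw [e2] at h2
  unfold kappaOdd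
  have hqπ2 : q / π = q / (2 * π) * 2 := by ring
  nlinarith [h1, h2, hsqq, hqπ]

/-! ### Louboutin 2006, Theorem 1 (i) (2), odd case, with the printed constant `κ₁` -/

section Dirichlet

open DirichletCharacter

variable {q : ℕ} [NeZero q] {χ : DirichletCharacter ℂ q}

omit [NeZero q] in
/-- An odd character is non-principal. [folklore] -/
private theorem ne_one_of_odd_sharp (hodd : χ.Odd) : χ ≠ 1 := by
  rintro rfl
  have h : (1 : DirichletCharacter ℂ q) (-1) = -1 := hodd
  rw [MulChar.one_apply (isUnit_one.neg)] at h
  norm_num at h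

/-- **Louboutin 2006, Theorem 1 (i) (2), ODD case, AS PRINTED:** for an odd primitive Dirichlet character `χ`
modulo `q` (`= f_χ > 1`), `|L(1, χ)| ≤ ½ (log q + κ₁)` with `κ₁ = 2 + γ − log π = 1.4325…`
(Lemma 6: `(q/π)|L(1, χ)| ≤ I₁(q)`, kernel `div_pi_mul_norm_LFunction_one_le_oddMajorant`; Lemma 9 (15):
`oddMajorant_le_sharp`). Supersedes the tree's weaker-constant form `norm_LFunction_one_le_half_log_add_of_odd`
(`2.6` in place of `κ₁`). [cite: Louboutin2006RelativeClassNumbers, Theorem 1 (2) p. 200; Lemma 6 p. 203; Lemma 9 (15) p. 206] -/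
theorem norm_LFunction_one_le_half_log_add_kappaOdd (hprim : χ.IsPrimitive) (hodd : χ.Odd) :
    ‖χ.LFunction 1‖ ≤ (Real.log q + kappaOdd) / 2 := by
  have hχ := ne_one_of_odd_sharp hodd
  have hq1 : q ≠ 1 := by rintro rfl; exact hχ χ.level_one
  have hq2 : (2 : ℝ) ≤ q := by
    have h0 := NeZero.ne q
    have : 2 ≤ q := by omega
    exact_mod_cast this
  have hq0 : (0 : ℝ) < q := by linarith
  have h1 := div_pi_mul_norm_LFunction_one_le_oddMajorant hprim hodd
  have h2 := oddMajorant_le_sharp hq2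
  have hqπ : 0 < (q : ℝ) / π := div_pos hq0 Real.pi_pos
  have h3 : (q : ℝ) / π * ‖χ.LFunction 1‖ ≤ (q : ℝ) / π * ((Real.log q + kappaOdd) / 2) := by
    calc (q : ℝ) / π * ‖χ.LFunction 1‖ ≤ oddMajorant q := h1
      _ ≤ q / (2 * π) * (Real.log q + kappaOdd) := h2
      _ = (q : ℝ) / π * ((Real.log q + kappaOdd) / 2) := by ring
  exact le_of_mul_le_mul_left h3 hqπ

/-- The same bound in the form `|L(1, χ)| ≤ ½ log q + κ₁/2`, `κ₁/2 = (2 + γ − log π)/2 = 0.7162…`, for odd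
primitive `χ`. [cite: Louboutin2006RelativeClassNumbers, Theorem 1 (2) p. 200] -/
theorem norm_LFunction_one_le_of_odd_sharp (hprim : χ.IsPrimitive) (hodd : χ.Odd) :
    ‖χ.LFunction 1‖ ≤ Real.log q / 2 + (2 + eulerMascheroniConstant - Real.log π) / 2 := by
  have := norm_LFunction_one_le_half_log_add_kappaOdd hprim hodd
  unfold kappaOdd at this
  linarith

/-- **Louboutin 2006, Theorem 1 (i) (2) for EVERY primitive `χ ≠ 1`, with `max(κ₀, κ₁) = κ₁`:**
`|L(1, χ)| ≤ ½ log q + (2 + γ − log π)/2` (even `χ`: the tree's `norm_LFunction_one_le`, constant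
`κ₀/2 = (2 + γ − log 4π)/2 ≤ κ₁/2`; odd `χ`: `norm_LFunction_one_le_of_odd_sharp`). Supersedes
`norm_LFunction_one_le_of_isPrimitive` (`½ log q + 1.3`). [cite: Louboutin2006RelativeClassNumbers, Theorem 1 (2) p. 200] -/
theorem norm_LFunction_one_le_of_isPrimitive_sharp (hprim : χ.IsPrimitive) (hχ : χ ≠ 1) :
    ‖χ.LFunction 1‖ ≤ Real.log q / 2 + (2 + eulerMascheroniConstant - Real.log π) / 2 := by
  rcases χ.even_or_odd with heven | hodd
  · have h := norm_LFunction_one_le χ hprim hχ heven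
    have : Real.log π ≤ Real.log (4 * π) := Real.log_le_log Real.pi_pos (by linarith [Real.pi_pos])
    linarith
  · exact norm_LFunction_one_le_of_odd_sharp hprim hodd

/-- Decimal form for consumers: **`|L(1, χ)| ≤ ½ log q + 0.7163`** for every primitive `χ ≠ 1` (any parity,
any `q`). [cite: Louboutin2006RelativeClassNumbers, Theorem 1 (2) p. 200 and (1)] -/
theorem norm_LFunction_one_le_of_isPrimitive_d4 (hprim : χ.IsPrimitive) (hχ : χ ≠ 1) :
    ‖χ.LFunction 1‖ ≤ Real.log q / 2 + 0.7163 := by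
  have h1 := norm_LFunction_one_le_of_isPrimitive_sharp hprim hχ
  have h2 := kappaOdd_div_two_lt
  unfold kappaOdd at h2
  norm_num at h2 ⊢
  linarith

end Dirichlet

/-! ### Lemma 9 (17): a lower bound for `T₁` (midpoint rule) -/

/-- `e^{−3/2} ≤ 0.2234`. [folklore] -/
private theorem exp_neg_three_halves_le_d4 : rexp (-(3 / 2)) ≤ 0.2234 := by
  have h := Real.sum_le_exp_of_nonneg (show (0 : ℝ) ≤ 3 / 2 by norm_num) 7
  simp only [Finset.sum_range_succ, Finset.sum_range_zero, Nat.factorial, Nat.cast_ofNat,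
    pow_succ, pow_zero, Nat.cast_succ] at h
  rw [Real.exp_neg, inv_le_comm₀ (Real.exp_pos _) (by norm_num)]
  norm_num at h ⊢
  linarith

/-- **`Σ_{n=1}^{N} n e^{−bn²} ≥ (e^{−b/4} − e^{−b(N+½)²})/(2b) − e^{−3/2}/4`** for `b > 0`: the midpoint rule for `g(x) = x e^{−bx²}`
on the cells `[n − ½, n + ½]`, `∫_{1/2}^∞ g = e^{−b/4}/(2b)`, `⅛ ∫ (g″)⁺ ≤ ⅛ · 2e^{−3/2}` (`−g′` peaks at
`x₀ = √(3/2b)` with `−g′(x₀) = 2e^{−3/2}`). [folklore] -/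
private theorem sum_succ_mul_exp_ge {b : ℝ} (hb : 0 < b) (N : ℕ) :
    (rexp (-(b / 4)) - rexp (-(b * ((N : ℝ) + 1 / 2) ^ 2))) / (2 * b) - rexp (-(3 / 2)) / 4 ≤
      ∑ n ∈ Finset.range N, ((n : ℝ) + 1) * rexp (-(b * ((n : ℝ) + 1) ^ 2)) := by
  -- `g`, `g′`, `g″`
  set g : ℝ → ℝ := fun x ↦ x * rexp (-(b * x ^ 2)) with hg
  set g' : ℝ → ℝ := fun x ↦ (1 - 2 * b * x ^ 2) * rexp (-(b * x ^ 2)) with hg'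
  set g'' : ℝ → ℝ := fun x ↦ (4 * b ^ 2 * x ^ 3 - 6 * b * x) * rexp (-(b * x ^ 2)) with hg''
  have hdg : ∀ x, HasDerivAt g (g' x) x := fun x ↦ by
    have := (hasDerivAt_id x).mul (hasDerivAt_expNegSq' b x)
    refine this.congr_deriv ?_
    simp only [hg', id]; ring
  have hdg' : ∀ x, HasDerivAt g' (g'' x) x := fun x ↦ by
    have h1 : HasDerivAt (fun y : ℝ ↦ 1 - 2 * b * y ^ 2) (-(2 * b * (2 * x))) x := by
      simpa using ((hasDerivAt_pow 2 x).const_mul (2 * b)).const_sub 1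
    have := h1.mul (hasDerivAt_expNegSq' b x)
    refine this.congr_deriv ?_
    simp only [hg'']; ring
  have hcg'' : Continuous g'' := by simp only [hg'']; fun_prop
  -- the kernel majorant `m = (g″)⁺`
  set m : ℝ → ℝ := fun x ↦ max (g'' x) 0 with hm
  have hmc : Continuous m := hcg''.max continuous_const
  -- per cell, applied to `−g`
  have hcell : ∀ n : ℕ, (∫ x in ((n : ℝ) + 1 - 1 / 2)..((n : ℝ) + 1 + 1 / 2), g x) -
      1 / 8 * ∫ x in ((n : ℝ) + 1 - 1 / 2)..((n : ℝ) + 1 + 1 / 2), m x ≤ g ((n : ℝ) + 1) := by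
    intro n
    have h := le_integral_cell (f := fun x ↦ -g x) (f' := fun x ↦ -g' x) (f'' := fun x ↦ -g'' x)
      (m := m) (c := (n : ℝ) + 1) (fun x _ ↦ (hdg x).neg) (fun x _ ↦ (hdg' x).neg)
      (hcg''.neg.continuousOn) hmc.continuousOn
      (fun x _ ↦ by simp only [hm]; linarith [le_max_left (g'' x) 0]) (fun x _ ↦ le_max_right _ _)
    rw [intervalIntegral.integral_neg] at h
    linarith
  -- sums over cells
  have hsumg : ∀ N : ℕ, ∑ n ∈ Finset.range N, ∫ x in ((n : ℝ) + 1 - 1 / 2)..((n : ℝ) + 1 + 1 / 2), g x =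
      ∫ x in (1 / 2 : ℝ)..((N : ℝ) + 1 / 2), g x := by
    intro N
    have := intervalIntegral.sum_integral_adjacent_intervals (a := fun k : ℕ ↦ (k : ℝ) + 1 / 2)
      (n := N) (f := g) (μ := volume) fun k _ ↦ (by simp only [hg]; fun_prop : Continuous g).intervalIntegrable _ _
    simp only [Nat.cast_zero, zero_add, Nat.cast_add, Nat.cast_one] at this
    rw [← this]
    refine Finset.sum_congr rfl fun n _ ↦ ?_
    congr 1; ring
  have hsumm : ∀ N : ℕ, ∑ n ∈ Finset.range N, ∫ x in ((n : ℝ) + 1 - 1 / 2)..((n : ℝ) + 1 + 1 / 2), m x =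
      ∫ x in (1 / 2 : ℝ)..((N : ℝ) + 1 / 2), m x := by
    intro N
    have := intervalIntegral.sum_integral_adjacent_intervals (a := fun k : ℕ ↦ (k : ℝ) + 1 / 2)
      (n := N) (f := m) (μ := volume) fun k _ ↦ hmc.intervalIntegrable _ _
    simp only [Nat.cast_zero, zero_add, Nat.cast_add, Nat.cast_one] at this
    rw [← this]
    refine Finset.sum_congr rfl fun n _ ↦ ?_
    congr 1; ring
  -- `∫_{1/2}^{Y} g = (e^{−b/4} − e^{−bY²})/(2b)`
  have hIg : ∀ Y : ℝ, ∫ x in (1 / 2 : ℝ)..Y, g x = (rexp (-(b / 4)) - rexp (-(b * Y ^ 2))) / (2 * b) := by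
    intro Y
    have hd : ∀ x ∈ uIcc (1 / 2 : ℝ) Y, HasDerivAt (fun x ↦ -rexp (-(b * x ^ 2)) / (2 * b)) (g x) x := by
      intro x _
      have := ((hasDerivAt_expNegSq' b x).neg).div_const (2 * b)
      refine this.congr_deriv ?_
      simp only [hg]; field_simp
    rw [intervalIntegral.integral_eq_sub_of_hasDerivAt hd
      ((by simp only [hg]; fun_prop : Continuous g).intervalIntegrable _ _)]
    rw [show b * (1 / 2 : ℝ) ^ 2 = b / 4 by ring]
    field_simp
    ring
  -- `∫_{1/2}^{Y} m ≤ 2 e^{−3/2}`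
  set x₀ : ℝ := Real.sqrt (3 / (2 * b)) with hx₀
  have hx₀0 : 0 ≤ x₀ := Real.sqrt_nonneg _
  have hx₀sq : x₀ ^ 2 = 3 / (2 * b) := Real.sq_sqrt (by positivity)
  have hbx₀ : b * x₀ ^ 2 = 3 / 2 := by rw [hx₀sq]; field_simp
  have hneg : ∀ x, 0 ≤ x → x ≤ x₀ → g'' x ≤ 0 := by
    intro x hx hxx
    have h1 : x ^ 2 ≤ x₀ ^ 2 := pow_le_pow_left₀ hx hxx 2
    have h2 : 2 * b * x ^ 2 ≤ 3 := by nlinarith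
    have h3 : 4 * b ^ 2 * x ^ 3 - 6 * b * x = 2 * b * x * (2 * b * x ^ 2 - 3) := by ring
    simp only [hg'']; rw [h3]
    exact mul_nonpos_of_nonpos_of_nonneg
      (mul_nonpos_of_nonneg_of_nonpos (by positivity) (by linarith)) (Real.exp_pos _).le
  have hpos : ∀ x, x₀ ≤ x → 0 ≤ g'' x := by
    intro x hxx
    have hx : 0 ≤ x := hx₀0.trans hxx
    have h1 : x₀ ^ 2 ≤ x ^ 2 := pow_le_pow_left₀ hx₀0 hxx 2
    have h2 : 3 ≤ 2 * b * x ^ 2 := by nlinarith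
    have h3 : 4 * b ^ 2 * x ^ 3 - 6 * b * x = 2 * b * x * (2 * b * x ^ 2 - 3) := by ring
    simp only [hg'']; rw [h3]
    exact mul_nonneg (mul_nonneg (by positivity) (by linarith)) (Real.exp_pos _).le
  have hg'le : ∀ y, x₀ ≤ y → g' y ≤ 0 := by
    intro y hy
    have h1 : x₀ ^ 2 ≤ y ^ 2 := pow_le_pow_left₀ hx₀0 hy 2
    have h2 : 3 ≤ 2 * b * y ^ 2 := by nlinarith
    simp only [hg']
    exact mul_nonpos_of_nonpos_of_nonneg (by linarith) (Real.exp_pos _).le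
  have hg'x₀ : g' x₀ = -2 * rexp (-(3 / 2)) := by
    have h3 : 2 * b * x₀ ^ 2 = 3 := by linarith [hbx₀]
    simp only [hg']; rw [h3, hbx₀]; ring
  -- `−g′(1/2) ≤ 2e^{−3/2}` (the case `x₀ ≤ 1/2`): `(b/2 − 1)e^{−b/4} ≤ 2e^{−3/2}` iff `1 + y ≤ e^y`, `y = (b−6)/4`
  have hg'half : -g' (1 / 2) ≤ 2 * rexp (-(3 / 2)) := by
    simp only [hg']
    have e1 : -((1 - 2 * b * (1 / 2 : ℝ) ^ 2) * rexp (-(b * (1 / 2) ^ 2))) = (b / 2 - 1) * rexp (-(b / 4)) := by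
      ring_nf
    rw [e1]
    have h1 := Real.add_one_le_exp ((b - 6) / 4)
    have h2 : rexp ((b - 6) / 4) * rexp (-(b / 4)) = rexp (-(3 / 2)) := by
      rw [← Real.exp_add]; ring_nf
    have h3 : 0 < rexp (-(b / 4)) := Real.exp_pos _
    nlinarith
  have hIm : ∀ Y : ℝ, 1 / 2 ≤ Y → ∫ x in (1 / 2 : ℝ)..Y, m x ≤ 2 * rexp (-(3 / 2)) := by
    intro Y hY
    have hFTC : ∀ u v : ℝ, ∫ x in u..v, g'' x = g' v - g' u := fun u v ↦
      intervalIntegral.integral_eq_sub_of_hasDerivAt (fun x _ ↦ hdg' x) (hcg''.intervalIntegrable _ _)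
    have hmeq : ∀ u v : ℝ, x₀ ≤ u → u ≤ v → ∫ x in u..v, m x = g' v - g' u := by
      intro u v hu huv
      rw [← hFTC]
      refine intervalIntegral.integral_congr fun x hx ↦ ?_
      rw [uIcc_of_le huv] at hx
      simp only [hm]; exact max_eq_left (hpos x (hu.trans hx.1))
    have hm0 : ∀ u v : ℝ, 0 ≤ u → v ≤ x₀ → u ≤ v → ∫ x in u..v, m x = 0 := by
      intro u v hu hv huv
      rw [← intervalIntegral.integral_zero (a := u) (b := v)]
      refine intervalIntegral.integral_congr fun x hx ↦ ?_
      rw [uIcc_of_le huv] at hx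
      simp only [hm]; exact max_eq_right (hneg x (hu.trans hx.1) (hx.2.trans hv))
    rcases le_or_gt x₀ (1 / 2) with hx | hx
    · rw [hmeq _ _ hx hY]
      have := hg'le Y (hx.trans hY)
      linarith
    · rcases le_or_gt Y x₀ with hYx | hYx
      · rw [hm0 _ _ (by norm_num) hYx hY]; positivity
      · rw [← intervalIntegral.integral_add_adjacent_intervals (b := x₀) (hmc.intervalIntegrable _ _)
          (hmc.intervalIntegrable _ _), hm0 _ _ (by norm_num) le_rfl hx.le, hmeq _ _ le_rfl hYx.le,
          hg'x₀]
        have := hg'le Y hYx.le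
        linarith
  -- partial sums
  have hS : ∀ N : ℕ, (rexp (-(b / 4)) - rexp (-(b * ((N : ℝ) + 1 / 2) ^ 2))) / (2 * b) - rexp (-(3 / 2)) / 4 ≤
      ∑ n ∈ Finset.range N, g ((n : ℝ) + 1) := by
    intro N
    have h1 : ∑ n ∈ Finset.range N, ((∫ x in ((n : ℝ) + 1 - 1 / 2)..((n : ℝ) + 1 + 1 / 2), g x) -
        1 / 8 * ∫ x in ((n : ℝ) + 1 - 1 / 2)..((n : ℝ) + 1 + 1 / 2), m x) ≤
        ∑ n ∈ Finset.range N, g ((n : ℝ) + 1) := Finset.sum_le_sum fun n _ ↦ hcell n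
    rw [Finset.sum_sub_distrib, ← Finset.mul_sum, hsumg, hsumm, hIg] at h1
    have h2 := hIm ((N : ℝ) + 1 / 2) (by have := N.cast_nonneg (α := ℝ); linarith)
    linarith
  simpa only [hg] using hS N

/-! ### Lemma 9 (17): the term integrals with the logarithmic weight -/

/-- `t ↦ e^{−ct} log t` is integrable on `(1, ∞)` (`log t ≤ t`). [folklore] -/
private theorem integrableOn_exp_mul_log {c : ℝ} (hc : 0 < c) :
    IntegrableOn (fun t : ℝ ↦ rexp (-(c * t)) * Real.log t) (Ioi 1) := by
  have hI0 : IntegrableOn (fun t : ℝ ↦ t * rexp (-(c * t))) (Ioi 1) := by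
    have := integrableOn_rpow_mul_exp_neg_mul_rpow (s := 1) (p := 1) (by norm_num) le_rfl hc
    refine (this.mono_set (Ioi_subset_Ioi zero_le_one)).congr_fun (fun t (ht : 1 < t) ↦ ?_)
      measurableSet_Ioi
    simp only [Real.rpow_one, neg_mul]
  refine Integrable.mono' hI0 ?_ ?_
  · exact (ContinuousOn.mul (by fun_prop) (Real.continuousOn_log.mono fun t (ht : 1 < t) ↦
      (by simp; linarith : t ∈ ({0}ᶜ : Set ℝ)))).aestronglyMeasurable measurableSet_Ioi
  · refine (ae_restrict_iff' measurableSet_Ioi).mpr (ae_of_all _ fun t (ht : 1 < t) ↦ ?_)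
    have h0 : 0 ≤ Real.log t := Real.log_nonneg ht.le
    have h1 : Real.log t ≤ t := (Real.log_le_sub_one_of_pos (by linarith)).trans (by linarith)
    rw [Real.norm_eq_abs, abs_of_nonneg (by positivity)]
    nlinarith [Real.exp_pos (-(c * t))]

/-- `t ↦ e^{−ct}/t` is integrable on `(T, ∞)`, `T > 0`. [folklore] -/
private theorem integrableOn_exp_mul_inv {c T : ℝ} (hc : 0 < c) (hT : 0 < T) :
    IntegrableOn (fun t : ℝ ↦ rexp (-(c * t)) * t⁻¹) (Ioi T) := by
  have hE : IntegrableOn (fun t : ℝ ↦ T⁻¹ * rexp (-c * t)) (Ioi T) :=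
    (exp_neg_integrableOn_Ioi T hc).const_mul _
  refine Integrable.mono' hE ?_ ?_
  · exact (ContinuousOn.mul (by fun_prop) (continuousOn_inv₀.mono fun t (ht : T < t) ↦
      (by simp; linarith : t ∈ ({0}ᶜ : Set ℝ)))).aestronglyMeasurable measurableSet_Ioi
  · refine (ae_restrict_iff' measurableSet_Ioi).mpr (ae_of_all _ fun t (ht : T < t) ↦ ?_)
    have ht0 : 0 < t := hT.trans ht
    rw [Real.norm_eq_abs, abs_of_nonneg (by positivity), neg_mul]
    have : t⁻¹ ≤ T⁻¹ := inv_anti₀ hT ht.le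
    nlinarith [Real.exp_pos (-(c * t)), inv_pos.mpr ht0]

/-- `∫₁^∞ e^{−ct} log t dt = c⁻¹ ∫₁^∞ e^{−ct} dt/t` for `c > 0` (integration by parts). [folklore] -/
private theorem integral_exp_mul_log {c : ℝ} (hc : 0 < c) :
    ∫ t in Ioi (1 : ℝ), rexp (-(c * t)) * Real.log t = c⁻¹ * ∫ t in Ioi (1 : ℝ), rexp (-(c * t)) * t⁻¹ := by
  have hI1 := integrableOn_exp_mul_log hc
  have hI2 := integrableOn_exp_mul_inv hc one_pos
  -- `Φ(t) = −e^{−ct} log t / c`, `Φ′ = e^{−ct} log t − e^{−ct}/(ct)`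
  have hderiv : ∀ t ∈ Ioi (1 : ℝ), HasDerivAt (fun t ↦ -rexp (-(c * t)) * Real.log t / c)
      (rexp (-(c * t)) * Real.log t - c⁻¹ * (rexp (-(c * t)) * t⁻¹)) t := by
    intro t (ht : 1 < t)
    have ht0 : t ≠ 0 := by linarith
    have h1 : HasDerivAt (fun t ↦ rexp (-(c * t))) (-c * rexp (-(c * t))) t := by
      have h0 : HasDerivAt (fun x : ℝ ↦ -(c * x)) (-(c * 1)) t := ((hasDerivAt_id t).const_mul c).neg
      exact h0.exp.congr_deriv (by ring)
    have h1n : HasDerivAt (fun t ↦ -rexp (-(c * t))) (-(-c * rexp (-(c * t)))) t := h1.neg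
    have := (h1n.mul (Real.hasDerivAt_log ht0)).div_const c
    refine this.congr_deriv ?_
    field_simp
    ring
  have hlim : Tendsto (fun t : ℝ ↦ -rexp (-(c * t)) * Real.log t / c) atTop (𝓝 0) := by
    -- `0 ≤ e^{−ct} log t ≤ t e^{−ct} → 0`
    have h0 : Tendsto (fun t : ℝ ↦ t ^ (1 : ℝ) * rexp (-c * t)) atTop (𝓝 0) :=
      tendsto_rpow_mul_exp_neg_mul_atTop_nhds_zero 1 c hc
    have h1 : Tendsto (fun t : ℝ ↦ rexp (-(c * t)) * Real.log t) atTop (𝓝 0) := by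
      refine tendsto_of_tendsto_of_tendsto_of_le_of_le' tendsto_const_nhds h0 ?_ ?_
      · filter_upwards [eventually_ge_atTop 1] with t ht
        exact mul_nonneg (Real.exp_pos _).le (Real.log_nonneg ht)
      · filter_upwards [eventually_ge_atTop 1] with t ht
        have : Real.log t ≤ t := (Real.log_le_sub_one_of_pos (by linarith)).trans (by linarith)
        rw [Real.rpow_one, neg_mul]
        nlinarith [Real.exp_pos (-(c * t))]
    have := (h1.neg).div_const c
    simp only [neg_zero, zero_div] at this
    refine this.congr fun t ↦ ?_
    ring
  have hcont : ContinuousWithinAt (fun t ↦ -rexp (-(c * t)) * Real.log t / c) (Ici 1) 1 := by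
    refine ContinuousAt.continuousWithinAt ?_
    exact ((by fun_prop : Continuous fun t ↦ -rexp (-(c * t))).continuousAt.mul
      (Real.continuousAt_log one_ne_zero)).div_const c
  have hFTC := integral_Ioi_of_hasDerivAt_of_tendsto hcont hderiv (hI1.sub (hI2.const_mul _)) hlim
  rw [integral_sub hI1 (hI2.const_mul _), integral_const_mul] at hFTC
  simp only [Real.log_one, mul_zero, zero_div, sub_zero] at hFTC
  linarith

/-- `∫₁^∞ e^{−ct} (log t) t^{−1/2} dt = 4 ∫₁^∞ e^{−cu²} log u du` (`t = u²`). [folklore] -/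
private theorem integral_exp_mul_log_inv_sqrt {c : ℝ} (hc : 0 < c) :
    ∫ t in Ioi (1 : ℝ), rexp (-(c * t)) * Real.log t * (Real.sqrt t)⁻¹ =
      4 * ∫ u in Ioi (1 : ℝ), rexp (-(c * u ^ 2)) * Real.log u := by
  set f : ℝ → ℝ := fun u ↦ u ^ 2 with hf
  set f' : ℝ → ℝ := fun u ↦ 2 * u with hf'
  set g : ℝ → ℝ := fun t ↦ rexp (-(c * t)) * Real.log t * (Real.sqrt t)⁻¹ with hg
  have hfg : ∀ u ∈ Ioi (1 : ℝ), 4 * (rexp (-(c * u ^ 2)) * Real.log u) = (g ∘ f) u * f' u := by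
    intro u (hu : 1 < u)
    have hu0 : 0 < u := by linarith
    simp only [hg, hf, hf', Function.comp, Real.sqrt_sq hu0.le, Real.log_pow, Nat.cast_ofNat]
    field_simp
    ring
  rw [← integral_const_mul, setIntegral_congr_fun measurableSet_Ioi hfg]
  have hcf : ContinuousOn f (Ici 1) := by simp only [hf]; fun_prop
  have hft : Tendsto f atTop atTop := by simp only [hf]; exact tendsto_pow_atTop two_ne_zero
  have hff' : ∀ u ∈ Ioi (1 : ℝ), HasDerivWithinAt f (f' u) (Ioi u) u := fun u _ ↦ by
    simpa [hf, hf'] using (hasDerivAt_pow 2 u).hasDerivWithinAt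
  have hgcont : ContinuousOn g (Ioi 0) := by
    simp only [hg]
    refine ContinuousOn.mul (ContinuousOn.mul (by fun_prop) (Real.continuousOn_log.mono fun t
      (ht : 0 < t) ↦ (by simp; exact ht.ne' : t ∈ ({0}ᶜ : Set ℝ)))) ?_
    exact ContinuousOn.inv₀ (by fun_prop) fun t (ht : 0 < t) ↦ (Real.sqrt_pos.mpr ht).ne'
  have hgc : ContinuousOn g (f '' Ioi 1) := hgcont.mono (by
    rintro _ ⟨u, hu, rfl⟩
    have hu' : (1 : ℝ) < u := hu
    show (0 : ℝ) < u ^ 2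
    positivity)
  -- integrability of `g` on `[1, ∞)`
  have hI0 : IntegrableOn (fun t : ℝ ↦ t * rexp (-(c * t))) (Ici 1) := by
    have := integrableOn_rpow_mul_exp_neg_mul_rpow (s := 1) (p := 1) (by norm_num) le_rfl hc
    refine (this.mono_set fun t (ht : 1 ≤ t) ↦ (by linarith : 0 < t)).congr_fun
      (fun t (ht : 1 ≤ t) ↦ ?_) measurableSet_Ici
    simp only [Real.rpow_one, neg_mul]
  have hgI : IntegrableOn g (Ici 1) := by
    refine Integrable.mono' hI0 ((hgcont.mono fun t (ht : 1 ≤ t) ↦ (by linarith : 0 < t)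
      ).aestronglyMeasurable measurableSet_Ici) ?_
    refine (ae_restrict_iff' measurableSet_Ici).mpr (ae_of_all _ fun t (ht : 1 ≤ t) ↦ ?_)
    simp only [hg]
    have h0 : 0 ≤ Real.log t := Real.log_nonneg ht
    have h1 : Real.log t ≤ t := (Real.log_le_sub_one_of_pos (by linarith)).trans (by linarith)
    have hs1 : 1 ≤ Real.sqrt t := by rw [show (1:ℝ) = Real.sqrt 1 by simp]; exact Real.sqrt_le_sqrt ht
    have hs : (Real.sqrt t)⁻¹ ≤ 1 := inv_le_one_of_one_le₀ hs1
    have hs0 : 0 ≤ (Real.sqrt t)⁻¹ := by positivity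
    rw [Real.norm_eq_abs, abs_of_nonneg (by positivity)]
    calc rexp (-(c * t)) * Real.log t * (Real.sqrt t)⁻¹ ≤ rexp (-(c * t)) * t * 1 := by
          gcongr
      _ = t * rexp (-(c * t)) := by ring
  have hg1 : IntegrableOn g (f '' Ici 1) := hgI.mono_set (by
    rintro _ ⟨u, hu, rfl⟩
    have hu' : (1 : ℝ) ≤ u := hu
    show (1 : ℝ) ≤ u ^ 2
    nlinarith)
  have hg2 : IntegrableOn (fun u ↦ (g ∘ f) u * f' u) (Ici 1) := by
    have hJ : IntegrableOn (fun u : ℝ ↦ 4 * (u * rexp (-(c * u ^ 2)))) (Ici 1) := by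
      have := (integrable_mul_exp_neg_mul_sq hc).integrableOn (s := Ici 1)
      refine (this.congr_fun (fun u _ ↦ by simp only [neg_mul]) measurableSet_Ici).const_mul 4
    refine Integrable.mono' hJ ?_ ?_
    · refine ContinuousOn.aestronglyMeasurable (fun u (hu : 1 ≤ u) ↦ ?_) measurableSet_Ici
      refine ((hgcont.comp hcf ?_).mul (by fun_prop : Continuous f').continuousOn) u hu
      intro v (hv : 1 ≤ v); show (0:ℝ) < v ^ 2; positivity
    · refine (ae_restrict_iff' measurableSet_Ici).mpr (ae_of_all _ fun u (hu : 1 ≤ u) ↦ ?_)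
      have hu0 : 0 < u := by linarith
      have e : (g ∘ f) u * f' u = 4 * (rexp (-(c * u ^ 2)) * Real.log u) := by
        simp only [hg, hf, hf', Function.comp, Real.sqrt_sq hu0.le, Real.log_pow, Nat.cast_ofNat]
        field_simp
        ring
      rw [e, Real.norm_eq_abs, abs_of_nonneg (by
        have := Real.log_nonneg hu; positivity)]
      have h1 : Real.log u ≤ u := (Real.log_le_sub_one_of_pos hu0).trans (by linarith)
      have h0 : 0 ≤ Real.log u := Real.log_nonneg hu
      nlinarith [Real.exp_pos (-(c * u ^ 2))]
  rw [integral_comp_mul_deriv_Ioi hcf hft hff' hgc hg1 hg2]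
  simp only [hf, one_pow, hg]

/-- `∫_T^∞ e^{−ct} dt/t = ∫_{cT}^∞ e^{−u} du/u` (`u = ct`), `T > 0`. [folklore] -/
private theorem integral_exp_inv_eq {c T : ℝ} (hc : 0 < c) (hT : 0 < T) :
    ∫ t in Ioi T, rexp (-(c * t)) * t⁻¹ = ∫ u in Ioi (c * T), rexp (-u) * u⁻¹ := by
  have := integral_comp_mul_left_Ioi (fun u ↦ rexp (-u) * u⁻¹) T hc
  simp only [smul_eq_mul] at this
  have e : ∀ t ∈ Ioi T, rexp (-(c * t)) * t⁻¹ = c * (rexp (-(c * t)) * (c * t)⁻¹) := by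
    intro t (ht : T < t)
    have : t ≠ 0 := by linarith
    field_simp
  rw [setIntegral_congr_fun measurableSet_Ioi e, integral_const_mul, this, ← mul_assoc,
    mul_inv_cancel₀ hc.ne', one_mul]

/-- **`E₁(x) = ∫_x^∞ e^{−u} du/u ≤ e^{−x} log(1 + 1/x)`** for `x > 0` (`W = −e^{−u} log(1 + 1/u)` has
`W′ = e^{−u}(log(1 + 1/u) + 1/(u(u+1))) ≥ e^{−u}/u` since `log(1 + 1/u) ≥ 1/(u+1)`). [folklore] -/
private theorem integral_exp_inv_le {x : ℝ} (hx : 0 < x) :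
    ∫ u in Ioi x, rexp (-u) * u⁻¹ ≤ rexp (-x) * Real.log (1 + x⁻¹) := by
  set W : ℝ → ℝ := fun u ↦ -rexp (-u) * Real.log (1 + u⁻¹) with hW
  have hWd : ∀ u, 0 < u → HasDerivAt W (rexp (-u) * Real.log (1 + u⁻¹) +
      rexp (-u) * (u⁻¹ * (u + 1)⁻¹)) u := by
    intro u hu
    have hu0 : u ≠ 0 := hu.ne'
    have h1 : HasDerivAt (fun u ↦ -rexp (-u)) (-(rexp (-u) * -1)) u := (hasDerivAt_neg u).exp.neg
    have h2 : HasDerivAt (fun u : ℝ ↦ Real.log (1 + u⁻¹)) ((-(u ^ 2)⁻¹) / (1 + u⁻¹)) u := by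
      have h0 : HasDerivAt (fun u : ℝ ↦ 1 + u⁻¹) (-(u ^ 2)⁻¹) u := (hasDerivAt_inv hu0).const_add 1
      exact h0.log (by positivity)
    have := h1.mul h2
    refine this.congr_deriv ?_
    field_simp
  have hkey : ∀ u, 0 < u → rexp (-u) * u⁻¹ ≤ rexp (-u) * Real.log (1 + u⁻¹) +
      rexp (-u) * (u⁻¹ * (u + 1)⁻¹) := by
    intro u hu
    -- `log(1 + 1/u) ≥ 1/(u+1)`: `log((u)/(u+1)) ≤ u/(u+1) − 1 = −1/(u+1)`
    have h1 : Real.log (u / (u + 1)) ≤ u / (u + 1) - 1 := Real.log_le_sub_one_of_pos (by positivity)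
    have h2 : Real.log (1 + u⁻¹) = -Real.log (u / (u + 1)) := by
      rw [← Real.log_inv]; congr 1; field_simp
    have h3 : u / (u + 1) - 1 = -(u + 1)⁻¹ := by field_simp; ring
    have h4 : (u + 1)⁻¹ ≤ Real.log (1 + u⁻¹) := by rw [h2]; linarith [h3 ▸ h1]
    have he := Real.exp_pos (-u)
    have h7 := mul_le_mul_of_nonneg_left h4 he.le
    calc rexp (-u) * u⁻¹ = rexp (-u) * (u + 1)⁻¹ + rexp (-u) * (u⁻¹ * (u + 1)⁻¹) := by
          field_simp
      _ ≤ _ := by linarith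
  -- `∫_x^Y e^{−u}/u ≤ W(Y) − W(x) ≤ −W(x)`
  have hint : IntegrableOn (fun u : ℝ ↦ rexp (-u) * u⁻¹) (Ioi x) := by
    have hE : IntegrableOn (fun u : ℝ ↦ (x⁻¹ + 1) * rexp (-1 * u)) (Ioi x) :=
      (exp_neg_integrableOn_Ioi x one_pos).const_mul _
    refine Integrable.mono' hE ?_ ?_
    · exact (ContinuousOn.mul (by fun_prop) (continuousOn_inv₀.mono fun u (hu : x < u) ↦
        (by simp; linarith : u ∈ ({0}ᶜ : Set ℝ)))).aestronglyMeasurable measurableSet_Ioi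
    · refine (ae_restrict_iff' measurableSet_Ioi).mpr (ae_of_all _ fun u (hu : x < u) ↦ ?_)
      have hu0 : 0 < u := hx.trans hu
      rw [Real.norm_eq_abs, abs_of_nonneg (by positivity), neg_one_mul]
      have h1 : u⁻¹ ≤ x⁻¹ + 1 := (inv_anti₀ hx hu.le).trans (by linarith)
      have := Real.exp_pos (-u)
      nlinarith
  -- `∫_x^Y e^{−u}/u ≤ W(Y) − W(x) ≤ −W(x)` and `Y → ∞`
  have hW'c : ContinuousOn (fun u ↦ rexp (-u) * Real.log (1 + u⁻¹) + rexp (-u) * (u⁻¹ * (u + 1)⁻¹))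
      (Ioi 0) := by
    have hinv : ContinuousOn (fun u : ℝ ↦ u⁻¹) (Ioi 0) := continuousOn_inv₀.mono fun u (hu : 0 < u) ↦
      (by simp; exact hu.ne' : u ∈ ({0}ᶜ : Set ℝ))
    refine (ContinuousOn.mul (by fun_prop) ?_).add (ContinuousOn.mul (by fun_prop) ?_)
    · exact (continuousOn_const.add hinv).log fun u (hu : 0 < u) ↦
        (by have := inv_pos.mpr hu; positivity : (0 : ℝ) < 1 + u⁻¹).ne'
    · refine hinv.mul (ContinuousOn.inv₀ (by fun_prop) fun u (hu : 0 < u) ↦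
        (by positivity : (0 : ℝ) < u + 1).ne')
  have hbound : ∀ Y, x ≤ Y → ∫ u in x..Y, rexp (-u) * u⁻¹ ≤ rexp (-x) * Real.log (1 + x⁻¹) := by
    intro Y hY
    have hsub : Icc x Y ⊆ Ioi 0 := fun u hu ↦ lt_of_lt_of_le hx hu.1
    have h1 : ∫ u in x..Y, rexp (-u) * u⁻¹ ≤
        ∫ u in x..Y, (rexp (-u) * Real.log (1 + u⁻¹) + rexp (-u) * (u⁻¹ * (u + 1)⁻¹)) := by
      refine intervalIntegral.integral_mono_on hY ?_ ((hW'c.mono hsub).intervalIntegrable_of_Icc hY)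
        fun u hu ↦ hkey u (hsub hu)
      exact (intervalIntegrable_iff_integrableOn_Ioc_of_le hY).mpr (hint.mono_set Ioc_subset_Ioi_self)
    have h2 : ∫ u in x..Y, (rexp (-u) * Real.log (1 + u⁻¹) + rexp (-u) * (u⁻¹ * (u + 1)⁻¹)) =
        W Y - W x := by
      refine intervalIntegral.integral_eq_sub_of_hasDerivAt (fun u hu ↦ hWd u ?_)
        ((hW'c.mono hsub).intervalIntegrable_of_Icc hY)
      rw [uIcc_of_le hY] at hu; exact hsub hu
    have h3 : W Y ≤ 0 := by
      simp only [hW]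
      have : 0 ≤ Real.log (1 + Y⁻¹) := Real.log_nonneg (by
        have : 0 < Y := lt_of_lt_of_le hx hY
        have : 0 ≤ Y⁻¹ := by positivity
        linarith)
      have := Real.exp_pos (-Y)
      nlinarith
    have h4 : W x = -(rexp (-x) * Real.log (1 + x⁻¹)) := by simp only [hW]; ring
    linarith
  refine le_of_tendsto (intervalIntegral_tendsto_integral_Ioi x hint tendsto_id) ?_
  filter_upwards [eventually_ge_atTop x] with Y hY using hbound Y hY

/-- `u ↦ e^{−cu²} log u` is integrable on `(1, ∞)` (`log u ≤ u`). [folklore] -/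
private theorem integrableOn_expSq_mul_log {c : ℝ} (hc : 0 < c) :
    IntegrableOn (fun u : ℝ ↦ rexp (-(c * u ^ 2)) * Real.log u) (Ioi 1) := by
  have hJ : IntegrableOn (fun u : ℝ ↦ u * rexp (-(c * u ^ 2))) (Ioi 1) := by
    have := (integrable_mul_exp_neg_mul_sq hc).integrableOn (s := Ioi 1)
    exact this.congr_fun (fun u _ ↦ by simp only [neg_mul]) measurableSet_Ioi
  refine Integrable.mono' hJ ?_ ?_
  · exact (ContinuousOn.mul (by fun_prop) (Real.continuousOn_log.mono fun u (hu : 1 < u) ↦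
      (by simp; linarith : u ∈ ({0}ᶜ : Set ℝ)))).aestronglyMeasurable measurableSet_Ioi
  · refine (ae_restrict_iff' measurableSet_Ioi).mpr (ae_of_all _ fun u (hu : 1 < u) ↦ ?_)
    have h0 : 0 ≤ Real.log u := Real.log_nonneg hu.le
    have h1 : Real.log u ≤ u := (Real.log_le_sub_one_of_pos (by linarith)).trans (by linarith)
    rw [Real.norm_eq_abs, abs_of_nonneg (by positivity)]
    nlinarith [Real.exp_pos (-(c * u ^ 2))]

/-! ### Lemma 9 (17): numerical constants -/

/-- `e^{−6/5} ≤ 0.30165`. [folklore] -/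
private theorem exp_neg_six_fifths_le : rexp (-(6 / 5)) ≤ 0.30165 := by
  have h := Real.sum_le_exp_of_nonneg (show (0 : ℝ) ≤ 6 / 5 by norm_num) 6
  simp only [Finset.sum_range_succ, Finset.sum_range_zero, Nat.factorial, Nat.cast_ofNat,
    pow_succ, pow_zero, Nat.cast_succ] at h
  rw [Real.exp_neg, inv_le_comm₀ (Real.exp_pos _) (by norm_num)]
  norm_num at h ⊢
  linarith

/-- `e^{−7} ≤ 1/1000`. [folklore] -/
private theorem exp_neg_seven_le : rexp (-7) ≤ 1 / 1000 := by
  have h := Real.sum_le_exp_of_nonneg (show (0 : ℝ) ≤ 7 by norm_num) 12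
  simp only [Finset.sum_range_succ, Finset.sum_range_zero, Nat.factorial, Nat.cast_ofNat,
    pow_succ, pow_zero, Nat.cast_succ] at h
  rw [Real.exp_neg, inv_le_comm₀ (Real.exp_pos _) (by norm_num)]
  norm_num at h ⊢
  linarith

/-- `2 log y ≤ y − 1/y` for `y ≥ 1`. [folklore] -/
private theorem two_mul_log_le {y : ℝ} (hy : 1 ≤ y) : 2 * Real.log y ≤ y - y⁻¹ := by
  have key := le_of_deriv_nonneg (g := fun t : ℝ ↦ t - t⁻¹ - 2 * Real.log t)
    (g' := fun t ↦ 1 + (t ^ 2)⁻¹ - 2 * t⁻¹) hy (fun t ht ↦ ?_) (fun t ht ↦ ?_)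
  · simpa using key
  · have ht0 : t ≠ 0 := by linarith [ht.1]
    have h1 := ((hasDerivAt_id t).sub (hasDerivAt_inv ht0)).sub ((Real.hasDerivAt_log ht0).const_mul 2)
    refine h1.congr_deriv ?_
    ring
  · have ht1 : 1 ≤ t := ht.1.le
    have ht0 : 0 < t := by linarith
    have : 1 + (t ^ 2)⁻¹ - 2 * t⁻¹ = (1 - t⁻¹) ^ 2 := by field_simp; ring
    rw [this]; positivity

/-- `log(11/6) ≤ 85/132`. [folklore] -/
private theorem log_eleven_sixths_le : Real.log (11 / 6) ≤ 85 / 132 := by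
  have := two_mul_log_le (y := 11 / 6) (by norm_num)
  norm_num at this ⊢
  linarith

/-! ### Lemma 9 (17): the `log t`-part `Σ n ∫ e^{−an²t} log t dt`, bounded above -/

/-- `∫₁^∞ e^{−ct} log t dt ≤ e^{−c}/c²` (`log t`-integral `= c⁻¹∫ e^{−ct}/t ≤ c⁻¹ ∫ e^{−ct}`). [folklore] -/
private theorem integral_exp_mul_log_le {c : ℝ} (hc : 0 < c) :
    ∫ t in Ioi (1 : ℝ), rexp (-(c * t)) * Real.log t ≤ c⁻¹ * (rexp (-c) / c) := by
  rw [integral_exp_mul_log hc, ← integral_exp_Ioi_one hc]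
  refine mul_le_mul_of_nonneg_left ?_ (inv_nonneg.mpr hc.le)
  refine setIntegral_mono_on (integrableOn_exp_mul_inv hc one_pos) ?_ measurableSet_Ioi
    fun t (ht : 1 < t) ↦ ?_
  · exact (exp_neg_integrableOn_Ioi 1 hc).congr_fun (fun t _ ↦ by simp only [neg_mul]) measurableSet_Ioi
  · have : t⁻¹ ≤ 1 := inv_le_one_of_one_le₀ ht.le
    have := Real.exp_pos (-(c * t))
    nlinarith

/-- `∫_T^∞ e^{−ct} dt/t ≤ T⁻¹ e^{−cT}/c` for `c, T > 0`. [folklore] -/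
private theorem integral_exp_mul_inv_le {c T : ℝ} (hc : 0 < c) (hT : 0 < T) :
    ∫ t in Ioi T, rexp (-(c * t)) * t⁻¹ ≤ T⁻¹ * (rexp (-(c * T)) / c) := by
  have hE : IntegrableOn (fun t ↦ rexp (-(c * t))) (Ioi T) :=
    (exp_neg_integrableOn_Ioi T hc).congr_fun (fun t _ ↦ by simp only [neg_mul]) measurableSet_Ioi
  have h1 : ∫ t in Ioi T, rexp (-(c * t)) * t⁻¹ ≤ ∫ t in Ioi T, T⁻¹ * rexp (-(c * t)) := by
    refine setIntegral_mono_on (integrableOn_exp_mul_inv hc hT) (hE.const_mul _) measurableSet_Ioi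
      fun t (ht : T < t) ↦ ?_
    have hti : t⁻¹ ≤ T⁻¹ := inv_anti₀ hT ht.le
    have := Real.exp_pos (-(c * t))
    nlinarith
  have h2 : ∫ t in Ioi T, T⁻¹ * rexp (-(c * t)) = T⁻¹ * (rexp (-(c * T)) / c) := by
    rw [integral_const_mul]
    congr 1
    have := integral_exp_mul_Ioi (a := -c) (by linarith) T
    simp only [neg_mul] at this
    rw [this]; field_simp
  exact h1.trans (le_of_eq h2)

/-- Numerics of the tail: `e^{−6/5} log(11/6) + (5/48) e^{−24/5}/(1 − e^{−6}) ≤ 0.19525`. [folklore] -/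
private theorem tail_const_le :
    rexp (-(6 / 5)) * Real.log (1 + (6 / 5 : ℝ)⁻¹) + 5 / 48 * (rexp (-(24 / 5)) * (1 - rexp (-6))⁻¹) ≤
      0.19525 := by
  have he65 := exp_neg_six_fifths_le
  have hl' : Real.log (1 + (6 / 5 : ℝ)⁻¹) ≤ 85 / 132 := by
    rw [show (1 : ℝ) + (6 / 5)⁻¹ = 11 / 6 by norm_num]; exact log_eleven_sixths_le
  have h24 : rexp (-(24 / 5)) ≤ 0.30165 ^ 4 := by
    rw [show (-(24 / 5) : ℝ) = ((4 : ℕ) : ℝ) * -(6 / 5) by norm_num, Real.exp_nat_mul]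
    exact pow_le_pow_left₀ (Real.exp_pos _).le he65 4
  have h6 : rexp (-6) ≤ 0.30165 ^ 5 := by
    rw [show (-6 : ℝ) = ((5 : ℕ) : ℝ) * -(6 / 5) by norm_num, Real.exp_nat_mul]
    exact pow_le_pow_left₀ (Real.exp_pos _).le he65 5
  have hinv6 : (1 - rexp (-6))⁻¹ ≤ (1 - 0.30165 ^ 5)⁻¹ := inv_anti₀ (by norm_num) (by linarith)
  have h1 : rexp (-(6 / 5)) * Real.log (1 + (6 / 5 : ℝ)⁻¹) ≤ 0.30165 * (85 / 132) :=
    mul_le_mul he65 hl' (Real.log_nonneg (by norm_num)) (by norm_num)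
  have hpos6 : 0 ≤ (1 - rexp (-6))⁻¹ := inv_nonneg.mpr (by linarith)
  have h2 : rexp (-(24 / 5)) * (1 - rexp (-6))⁻¹ ≤ 0.30165 ^ 4 * (1 - 0.30165 ^ 5)⁻¹ :=
    mul_le_mul h24 hinv6 hpos6 (by positivity)
  norm_num at h1 h2 ⊢
  linarith

/-- The `log t`-part: with `c_n = a n²`, `t₀ = (6/5)/a` (`0 < a ≤ 6/5`), the series
`Σ_{n≥1} n ∫₁^∞ e^{−c_n t} log t dt = ∫₁^∞ S₁(at) dt/(at)` is summable and at most
`a⁻¹[(−½ log a + γ/2) log t₀ − ¼ log² t₀] + (13/50)(t₀ − 1) + 0.19525 a⁻¹`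
(split at `t₀`; `S₁(b) ≤ ½ log(1/b) + γ/2 + 0.26 b` for `b ≤ 6/5`; tail via `E₁(6/5) ≤ e^{−6/5} log(11/6)`).
[folklore] -/
private theorem logPart_summable_and_le {a : ℝ} (ha : 0 < a) (ha12 : a ≤ 6 / 5) :
    (Summable fun n : ℕ ↦ ((n : ℝ) + 1) *
        ∫ t in Ioi (1 : ℝ), rexp (-(a * ((n : ℝ) + 1) ^ 2 * t)) * Real.log t) ∧
      ∑' n : ℕ, ((n : ℝ) + 1) * ∫ t in Ioi (1 : ℝ), rexp (-(a * ((n : ℝ) + 1) ^ 2 * t)) * Real.log t ≤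
        a⁻¹ * ((-(Real.log a / 2) + eulerMascheroniConstant / 2) * Real.log (6 / 5 / a) -
            Real.log (6 / 5 / a) ^ 2 / 4) + 13 / 50 * (6 / 5 / a - 1) + a⁻¹ * 0.19525 := by
  set t₀ : ℝ := 6 / 5 / a with ht₀
  have ht₀1 : 1 ≤ t₀ := by rw [ht₀, le_div_iff₀ ha]; linarith
  have ht₀0 : 0 < t₀ := lt_of_lt_of_le one_pos ht₀1
  have hat₀ : a * t₀ = 6 / 5 := by rw [ht₀]; field_simp
  set c : ℕ → ℝ := fun n ↦ a * ((n : ℝ) + 1) ^ 2 with hc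
  have hcpos : ∀ n, 0 < c n := fun n ↦ by positivity
  set K₁ : ℕ → ℝ := fun n ↦ ∫ t in Ioi (1 : ℝ), rexp (-(c n * t)) * Real.log t with hK₁
  -- geometric majorant
  set r : ℝ := rexp (-a) with hr
  have hr0 : 0 ≤ r := (Real.exp_pos _).le
  have hr1 : r < 1 := Real.exp_lt_one_iff.mpr (by linarith)
  have hgeom : Summable fun n : ℕ ↦ r * r ^ n := (summable_geometric_of_lt_one hr0 hr1).mul_left r
  have hexp_le : ∀ n : ℕ, rexp (-c n) ≤ r * r ^ n := by
    intro n
    rw [hr, ← pow_succ', ← Real.exp_nat_mul, Real.exp_le_exp]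
    simp only [hc]; push_cast
    have h1 : (n : ℝ) + 1 ≤ ((n : ℝ) + 1) ^ 2 := by nlinarith [n.cast_nonneg (α := ℝ)]
    nlinarith
  have hK₁nn : ∀ n, 0 ≤ K₁ n := fun n ↦ setIntegral_nonneg measurableSet_Ioi fun t (ht : 1 < t) ↦
    mul_nonneg (Real.exp_pos _).le (Real.log_nonneg ht.le)
  have hA_le : ∀ n : ℕ, ((n : ℝ) + 1) * K₁ n ≤ a⁻¹ * a⁻¹ * (r * r ^ n) := by
    intro n
    have hn1 : (1 : ℝ) ≤ (n : ℝ) + 1 := by have := n.cast_nonneg (α := ℝ); linarith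
    have h1 : K₁ n ≤ (c n)⁻¹ * (rexp (-c n) / c n) := integral_exp_mul_log_le (hcpos n)
    have e1 : ((n : ℝ) + 1) * ((c n)⁻¹ * (rexp (-c n) / c n)) =
        rexp (-c n) / (a * a * ((n : ℝ) + 1) ^ 3) := by
      simp only [hc]; field_simp
    have h2 : rexp (-c n) / (a * a * ((n : ℝ) + 1) ^ 3) ≤ rexp (-c n) / (a * a * 1) := by
      refine div_le_div_of_nonneg_left (Real.exp_pos _).le (by positivity) ?_
      have : (1 : ℝ) ≤ ((n : ℝ) + 1) ^ 3 := one_le_pow₀ hn1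
      nlinarith [mul_pos ha ha]
    calc ((n : ℝ) + 1) * K₁ n ≤ ((n : ℝ) + 1) * ((c n)⁻¹ * (rexp (-c n) / c n)) :=
          mul_le_mul_of_nonneg_left h1 (by positivity)
      _ ≤ rexp (-c n) / (a * a * 1) := by rw [e1]; exact h2
      _ ≤ a⁻¹ * a⁻¹ * (r * r ^ n) := by
          rw [mul_one, div_eq_mul_inv, mul_inv, mul_comm]
          exact mul_le_mul_of_nonneg_left (hexp_le n) (by positivity)
  have hsumA : Summable fun n : ℕ ↦ ((n : ℝ) + 1) * K₁ n :=
    Summable.of_nonneg_of_le (fun n ↦ by have := hK₁nn n; positivity) hA_le (hgeom.mul_left _)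
  refine ⟨hsumA, ?_⟩
  -- split at `t₀`
  have hK₁eq : ∀ n, K₁ n = (c n)⁻¹ * ∫ t in Ioi (1 : ℝ), rexp (-(c n * t)) * t⁻¹ := fun n ↦
    integral_exp_mul_log (hcpos n)
  set P : ℕ → ℝ := fun n ↦ ∫ t in Ioc (1 : ℝ) t₀, rexp (-(c n * t)) * (a * ((n : ℝ) + 1) * t)⁻¹ with hP
  set Q : ℕ → ℝ := fun n ↦ ∫ t in Ioi t₀, rexp (-(c n * t)) * (a * ((n : ℝ) + 1) * t)⁻¹ with hQ
  have hsplit : ∀ n : ℕ, ((n : ℝ) + 1) * K₁ n = P n + Q n := by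
    intro n
    have hn : (n : ℝ) + 1 ≠ 0 := by positivity
    have hint := integrableOn_exp_mul_inv (hcpos n) one_pos
    have e1 := intervalIntegral.integral_Ioi_sub_Ioi hint ht₀1
    rw [intervalIntegral.integral_of_le ht₀1] at e1
    have e2 : ∀ (S : Set ℝ), ∫ t in S, rexp (-(c n * t)) * (a * ((n : ℝ) + 1) * t)⁻¹ =
        (a * ((n : ℝ) + 1))⁻¹ * ∫ t in S, rexp (-(c n * t)) * t⁻¹ := by
      intro S
      rw [← integral_const_mul]
      congr 1; funext t
      rw [mul_inv]; ring
    simp only [hP, hQ]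
    rw [e2, e2, ← mul_add, ← e1, sub_add_cancel, hK₁eq]
    simp only [hc]
    field_simp
  have hPnn : ∀ n, 0 ≤ P n := fun n ↦ setIntegral_nonneg measurableSet_Ioc fun t ht ↦ by
    have : 0 < t := lt_trans one_pos ht.1; positivity
  have hQnn : ∀ n, 0 ≤ Q n := fun n ↦ setIntegral_nonneg measurableSet_Ioi fun t (ht : t₀ < t) ↦ by
    have : 0 < t := ht₀0.trans ht; positivity
  have hPle : ∀ n, P n ≤ ((n : ℝ) + 1) * K₁ n := fun n ↦ by rw [hsplit]; linarith [hQnn n]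
  have hQle : ∀ n, Q n ≤ ((n : ℝ) + 1) * K₁ n := fun n ↦ by rw [hsplit]; linarith [hPnn n]
  have hsumP : Summable P := Summable.of_nonneg_of_le hPnn hPle hsumA
  have hsumQ : Summable Q := Summable.of_nonneg_of_le hQnn hQle hsumA
  have hAeq : ∑' n : ℕ, ((n : ℝ) + 1) * K₁ n = ∑' n, P n + ∑' n, Q n := by
    rw [← hsumP.tsum_add hsumQ]; exact tsum_congr hsplit
  -- swap on `Ioc 1 t₀`
  set G : ℕ → ℝ → ℝ := fun n t ↦ rexp (-(c n * t)) * (a * ((n : ℝ) + 1) * t)⁻¹ with hG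
  have hGint : ∀ n, IntegrableOn (G n) (Ioc 1 t₀) := fun n ↦ by
    have : IntegrableOn (fun t ↦ (a * ((n : ℝ) + 1))⁻¹ * (rexp (-(c n * t)) * t⁻¹)) (Ioc 1 t₀) :=
      ((integrableOn_exp_mul_inv (hcpos n) one_pos).mono_set Ioc_subset_Ioi_self).const_mul _
    refine this.congr_fun (fun t _ ↦ ?_) measurableSet_Ioc
    show (a * ((n : ℝ) + 1))⁻¹ * (rexp (-(c n * t)) * t⁻¹) = rexp (-(c n * t)) * (a * ((n : ℝ) + 1) * t)⁻¹
    rw [mul_inv (a * ((n : ℝ) + 1)) t]; ring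
  have hGnn : ∀ n, ∀ t ∈ Ioc (1 : ℝ) t₀, 0 ≤ G n t := fun n t ht ↦ by
    have : 0 < t := lt_trans one_pos ht.1; simp only [hG]; positivity
  have hGnorm : Summable fun n : ℕ ↦ ∫ t in Ioc (1 : ℝ) t₀, ‖G n t‖ := by
    refine hsumP.congr fun n ↦ ?_
    simp only [hP]
    exact setIntegral_congr_fun measurableSet_Ioc fun t ht ↦ by
      rw [Real.norm_eq_abs, abs_of_nonneg (hGnn n t ht)]
  have hHS2 := hasSum_integral_of_summable_integral_norm (μ := volume.restrict (Ioc (1 : ℝ) t₀))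
    (F := G) hGint hGnorm
  have hPeq : ∑' n, P n = ∫ t in Ioc (1 : ℝ) t₀, ∑' n, G n t := by rw [← hHS2.tsum_eq]
  set bound : ℝ → ℝ := fun t ↦ (a * t)⁻¹ * (-(Real.log (a * t) / 2) + eulerMascheroniConstant / 2 +
    13 / 50 * (a * t)) with hbound
  have hptw : ∀ t ∈ Ioc (1 : ℝ) t₀, (∑' n, G n t) ≤ bound t := by
    intro t ht
    have ht0 : 0 < t := lt_trans one_pos ht.1
    have hat : 0 < a * t := by positivity
    have hat2 : a * t ≤ 6 / 5 := by
      calc a * t ≤ a * t₀ := mul_le_mul_of_nonneg_left ht.2 ha.le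
        _ = 6 / 5 := hat₀
    set h : ℝ := Real.sqrt (a * t) with hh_def
    have hh : 0 < h := Real.sqrt_pos.mpr hat
    have hh2 : h ^ 2 = a * t := Real.sq_sqrt hat.le
    have hhle : h ≤ 2 := by nlinarith
    have hS := tsum_exp_neg_sq_div_le hh hhle
    have hlogh : Real.log h = Real.log (a * t) / 2 := by rw [hh_def, Real.log_sqrt hat.le]
    have e : (∑' n, G n t) = (a * t)⁻¹ * ∑' n : ℕ, rexp (-(h ^ 2 * ((n : ℝ) + 1) ^ 2)) / ((n : ℝ) + 1) := by
      rw [← tsum_mul_left]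
      refine tsum_congr fun n ↦ ?_
      simp only [hG, hc, hh2]
      have hn : (n : ℝ) + 1 ≠ 0 := by positivity
      field_simp
    rw [hlogh, hh2] at hS
    rw [e, hh2]
    exact mul_le_mul_of_nonneg_left hS (inv_nonneg.mpr hat.le)
  have hbound_cont : ContinuousOn bound (Icc 1 t₀) := by
    simp only [hbound]
    have hpos : ∀ t ∈ Icc (1 : ℝ) t₀, a * t ≠ 0 := fun t ht ↦ by
      have : 0 < t := lt_of_lt_of_le one_pos ht.1; positivity
    refine ContinuousOn.mul (ContinuousOn.inv₀ (by fun_prop) hpos) ?_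
    refine ((ContinuousOn.neg ((ContinuousOn.log (by fun_prop) hpos).div_const 2)).add
      continuousOn_const).add (by fun_prop)
  have hbound_int : IntegrableOn bound (Ioc 1 t₀) :=
    (hbound_cont.integrableOn_compact isCompact_Icc).mono_set Ioc_subset_Icc_self
  have hPle2 : ∑' n, P n ≤ ∫ t in Ioc (1 : ℝ) t₀, bound t := by
    rw [hPeq]
    refine integral_mono_of_nonneg ?_ hbound_int ?_
    · exact (ae_restrict_iff' measurableSet_Ioc).mpr (ae_of_all _ fun t ht ↦
        tsum_nonneg fun n ↦ hGnn n t ht)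
    · exact (ae_restrict_iff' measurableSet_Ioc).mpr (ae_of_all _ fun t ht ↦ hptw t ht)
  have hbound_val : ∫ t in Ioc (1 : ℝ) t₀, bound t =
      a⁻¹ * ((-(Real.log a / 2) + eulerMascheroniConstant / 2) * Real.log t₀ - Real.log t₀ ^ 2 / 4) +
        13 / 50 * (t₀ - 1) := by
    rw [← intervalIntegral.integral_of_le ht₀1]
    have hd : ∀ t ∈ uIcc (1 : ℝ) t₀, HasDerivAt (fun t ↦ a⁻¹ * ((-(Real.log a / 2) +
        eulerMascheroniConstant / 2) * Real.log t - Real.log t ^ 2 / 4) + 13 / 50 * t) (bound t) t := by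
      intro t ht
      rw [uIcc_of_le ht₀1] at ht
      have ht0 : 0 < t := lt_of_lt_of_le one_pos ht.1
      have hl := Real.hasDerivAt_log ht0.ne'
      have h1 := ((hl.const_mul (-(Real.log a / 2) + eulerMascheroniConstant / 2)).sub
        ((hl.pow 2).div_const 4)).const_mul a⁻¹
      have h2 := (hasDerivAt_id t).const_mul (13 / 50 : ℝ)
      have := h1.add h2
      refine this.congr_deriv ?_
      simp only [hbound, Nat.cast_ofNat]
      rw [Real.log_mul ha.ne' ht0.ne']
      field_simp
      ring
    rw [intervalIntegral.integral_eq_sub_of_hasDerivAt hd (hbound_cont.intervalIntegrable_of_Icc ht₀1)]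
    simp only [Real.log_one, mul_zero, ne_eq, OfNat.ofNat_ne_zero, not_false_eq_true, zero_pow,
      zero_div, sub_zero, mul_one]
    ring
  -- the tail
  have hQ0 : Q 0 ≤ a⁻¹ * (rexp (-(6 / 5)) * Real.log (1 + (6 / 5 : ℝ)⁻¹)) := by
    have e1 : Q 0 = a⁻¹ * ∫ t in Ioi t₀, rexp (-(a * t)) * t⁻¹ := by
      simp only [hQ, hc]
      rw [← integral_const_mul]
      congr 1; funext t; push_cast; rw [mul_inv]; ring_nf
    rw [e1, integral_exp_inv_eq ha ht₀0, hat₀]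
    exact mul_le_mul_of_nonneg_left (integral_exp_inv_le (by norm_num)) (inv_nonneg.mpr ha.le)
  have hQsucc : ∀ n : ℕ, Q (n + 1) ≤ 5 / (48 * a) * (rexp (-(24 / 5)) * rexp (-6) ^ n) := by
    intro n
    have hcn := hcpos (n + 1)
    have e1 : Q (n + 1) = (a * ((n : ℝ) + 2))⁻¹ * ∫ t in Ioi t₀, rexp (-(c (n + 1) * t)) * t⁻¹ := by
      simp only [hQ]
      rw [← integral_const_mul]
      congr 1; funext t; push_cast
      rw [mul_inv (a * _) t, show (n : ℝ) + 1 + 1 = (n : ℝ) + 2 by ring]; ring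
    have h1 := integral_exp_mul_inv_le hcn ht₀0
    have h2 : Q (n + 1) ≤ (a * ((n : ℝ) + 2))⁻¹ * (t₀⁻¹ * (rexp (-(c (n + 1) * t₀)) / c (n + 1))) := by
      rw [e1]; exact mul_le_mul_of_nonneg_left h1 (by positivity)
    have h3 : (a * ((n : ℝ) + 2))⁻¹ * (t₀⁻¹ * (rexp (-(c (n + 1) * t₀)) / c (n + 1))) =
        rexp (-(6 / 5 * ((n : ℝ) + 2) ^ 2)) / (6 / 5 * a * ((n : ℝ) + 2) ^ 3) := by
      have e2 : c (n + 1) * t₀ = 6 / 5 * ((n : ℝ) + 2) ^ 2 := by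
        simp only [hc, ht₀]; push_cast; field_simp; ring
      rw [e2]
      simp only [hc, ht₀]; push_cast
      field_simp
      ring
    have h4 : rexp (-(6 / 5 * ((n : ℝ) + 2) ^ 2)) ≤ rexp (-(24 / 5)) * rexp (-6) ^ n := by
      rw [← Real.exp_nat_mul, ← Real.exp_add, Real.exp_le_exp]
      have hn : (n : ℝ) ≤ (n : ℝ) ^ 2 := by exact_mod_cast Nat.le_self_pow two_ne_zero n
      nlinarith
    have h5 : rexp (-(6 / 5 * ((n : ℝ) + 2) ^ 2)) / (6 / 5 * a * ((n : ℝ) + 2) ^ 3) ≤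
        rexp (-(6 / 5 * ((n : ℝ) + 2) ^ 2)) / (6 / 5 * a * 8) := by
      refine div_le_div_of_nonneg_left (Real.exp_pos _).le (by positivity) ?_
      have : (8 : ℝ) ≤ ((n : ℝ) + 2) ^ 3 := by nlinarith [n.cast_nonneg (α := ℝ)]
      nlinarith
    have h6 : rexp (-(6 / 5 * ((n : ℝ) + 2) ^ 2)) / (6 / 5 * a * 8) ≤
        5 / (48 * a) * (rexp (-(24 / 5)) * rexp (-6) ^ n) := by
      rw [div_eq_mul_inv, mul_comm, show (6 / 5 * a * 8)⁻¹ = 5 / (48 * a) by field_simp; norm_num]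
      exact mul_le_mul_of_nonneg_left h4 (by positivity)
    linarith
  have hr6 : rexp (-6) < 1 := Real.exp_lt_one_iff.mpr (by norm_num)
  have hr60 : 0 ≤ rexp (-6) := (Real.exp_pos _).le
  have hQtail : ∑' n, Q (n + 1) ≤ 5 / (48 * a) * (rexp (-(24 / 5)) * (1 - rexp (-6))⁻¹) := by
    have hg : Summable fun n : ℕ ↦ 5 / (48 * a) * (rexp (-(24 / 5)) * rexp (-6) ^ n) :=
      ((summable_geometric_of_lt_one hr60 hr6).mul_left _).mul_left _
    refine (Summable.tsum_le_tsum hQsucc ((summable_nat_add_iff 1).mpr hsumQ) hg).trans (le_of_eq ?_)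
    rw [tsum_mul_left, tsum_mul_left, tsum_geometric_of_lt_one hr60 hr6]
  have hQsum : ∑' n, Q n ≤ a⁻¹ * 0.19525 := by
    rw [hsumQ.tsum_eq_zero_add]
    have h := tail_const_le
    have e5 : 5 / (48 * a) = a⁻¹ * (5 / 48) := by field_simp
    rw [e5, mul_assoc] at hQtail
    have := add_le_add hQ0 hQtail
    rw [← mul_add] at this
    exact this.trans (mul_le_mul_of_nonneg_left h (inv_nonneg.mpr ha.le))
  rw [hAeq]
  linarith [hPle2, hbound_val, hQsum]

/-! ### Lemma 9 (17): the `(log t) t^{−1/2}`-part, bounded below -/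

/-- The `t^{−1/2}`-part truncated: for `a > 0`, `U₀ ≥ 1` and `N` with `a(N + ½)² ≥ 7`,
`2·0.999·a⁻¹(1 − (1 + log U₀)/U₀) − 0.724 (U₀ log U₀ − U₀ + 1) ≤ Σ_{n<N} (n+1) · 4∫₁^∞ e^{−a(n+1)²u²} log u du`
(midpoint lower bound `Σ_{n≤N} n e^{−bn²} ≥ (e^{−b/4} − e^{−b(N+½)²})/(2b) − e^{−3/2}/4 ≥ 0.999/(2b) − 0.181`,
`b = au² ≥ a`, integrated against `4 log u` over `[1, U₀]`). [folklore] -/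
private theorem sqrtPart_ge {a U₀ : ℝ} (ha : 0 < a) (hU : 1 ≤ U₀) {N : ℕ}
    (hN : 7 ≤ a * ((N : ℝ) + 1 / 2) ^ 2) :
    2 * (999 / 1000) * a⁻¹ * (1 - (1 + Real.log U₀) / U₀) -
        4 * (181 / 1000) * (U₀ * Real.log U₀ - U₀ + 1) ≤
      ∑ n ∈ Finset.range N, ((n : ℝ) + 1) *
        (4 * ∫ u in Ioi (1 : ℝ), rexp (-(a * ((n : ℝ) + 1) ^ 2 * u ^ 2)) * Real.log u) := by
  have hU0 : 0 < U₀ := lt_of_lt_of_le one_pos hU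
  -- truncate each term at `U₀`
  have htrunc : ∀ n : ℕ, ((n : ℝ) + 1) * (4 * ∫ u in Ioc (1 : ℝ) U₀, rexp (-(a * ((n : ℝ) + 1) ^ 2 * u ^ 2)) *
      Real.log u) ≤ ((n : ℝ) + 1) * (4 * ∫ u in Ioi (1 : ℝ), rexp (-(a * ((n : ℝ) + 1) ^ 2 * u ^ 2)) *
      Real.log u) := by
    intro n
    have hc : 0 < a * ((n : ℝ) + 1) ^ 2 := by positivity
    refine mul_le_mul_of_nonneg_left (mul_le_mul_of_nonneg_left ?_ (by norm_num)) (by positivity)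
    exact setIntegral_mono_set (integrableOn_expSq_mul_log hc)
      ((ae_restrict_iff' measurableSet_Ioi).mpr (ae_of_all _ fun u (hu : 1 < u) ↦
        mul_nonneg (Real.exp_pos _).le (Real.log_nonneg hu.le)))
      Ioc_subset_Ioi_self.eventuallyLE
  refine le_trans ?_ (Finset.sum_le_sum fun n _ ↦ htrunc n)
  -- exchange the finite sum and the integral
  have hint : ∀ n : ℕ, IntegrableOn (fun u ↦ ((n : ℝ) + 1) * (4 * (rexp (-(a * ((n : ℝ) + 1) ^ 2 * u ^ 2)) *
      Real.log u))) (Ioc 1 U₀) := fun n ↦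
    (((integrableOn_expSq_mul_log (by positivity : 0 < a * ((n : ℝ) + 1) ^ 2)).mono_set
      Ioc_subset_Ioi_self).const_mul 4).const_mul _
  have hswap : ∑ n ∈ Finset.range N, ((n : ℝ) + 1) * (4 * ∫ u in Ioc (1 : ℝ) U₀,
      rexp (-(a * ((n : ℝ) + 1) ^ 2 * u ^ 2)) * Real.log u) =
      ∫ u in Ioc (1 : ℝ) U₀, ∑ n ∈ Finset.range N, ((n : ℝ) + 1) * (4 * (rexp (-(a * ((n : ℝ) + 1) ^ 2 *
        u ^ 2)) * Real.log u)) := by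
    rw [integral_finsetSum _ fun n _ ↦ hint n]
    refine Finset.sum_congr rfl fun n _ ↦ ?_
    rw [integral_const_mul, integral_const_mul]
  rw [hswap]
  -- pointwise lower bound on `(1, U₀]`
  set m : ℝ → ℝ := fun u ↦ 4 * Real.log u * ((999 / 1000) / (2 * (a * u ^ 2)) - 181 / 1000) with hm
  have hptw : ∀ u ∈ Icc (1 : ℝ) U₀, m u ≤ ∑ n ∈ Finset.range N, ((n : ℝ) + 1) *
      (4 * (rexp (-(a * ((n : ℝ) + 1) ^ 2 * u ^ 2)) * Real.log u)) := by
    intro u hu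
    have hu1 : 1 ≤ u := hu.1
    have hb : 0 < a * u ^ 2 := by positivity
    have hS := sum_succ_mul_exp_ge hb N
    have hlog : 0 ≤ Real.log u := Real.log_nonneg hu1
    have e : ∑ n ∈ Finset.range N, ((n : ℝ) + 1) * (4 * (rexp (-(a * ((n : ℝ) + 1) ^ 2 * u ^ 2)) *
        Real.log u)) = 4 * Real.log u * ∑ n ∈ Finset.range N, ((n : ℝ) + 1) *
          rexp (-(a * u ^ 2 * ((n : ℝ) + 1) ^ 2)) := by
      rw [Finset.mul_sum]
      refine Finset.sum_congr rfl fun n _ ↦ ?_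
      ring_nf
    rw [e]
    simp only [hm]
    refine mul_le_mul_of_nonneg_left ?_ (by positivity)
    -- `(e^{−b/4} − e^{−b(N+½)²})/(2b) − e^{−3/2}/4 ≥ 0.999/(2b) − 0.181`
    have h1 : 1 - a * u ^ 2 / 4 ≤ rexp (-(a * u ^ 2 / 4)) := by
      have := Real.add_one_le_exp (-(a * u ^ 2 / 4)); linarith
    have h2 : rexp (-(a * u ^ 2 * ((N : ℝ) + 1 / 2) ^ 2)) ≤ 1 / 1000 := by
      refine le_trans (Real.exp_le_exp.mpr ?_) exp_neg_seven_le
      have : a * ((N : ℝ) + 1 / 2) ^ 2 ≤ a * u ^ 2 * ((N : ℝ) + 1 / 2) ^ 2 := by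
        have hu2 : 1 ≤ u ^ 2 := one_le_pow₀ hu1
        nlinarith [sq_nonneg ((N : ℝ) + 1 / 2), ha.le]
      linarith
    have h3 := exp_neg_three_halves_le_d4
    have hb2 : 0 < 2 * (a * u ^ 2) := by positivity
    -- combine
    have key : (999 / 1000) / (2 * (a * u ^ 2)) - 181 / 1000 ≤
        (rexp (-(a * u ^ 2 / 4)) - rexp (-(a * u ^ 2 * ((N : ℝ) + 1 / 2) ^ 2))) / (2 * (a * u ^ 2)) -
          rexp (-(3 / 2)) / 4 := by
      have h4 : (999 / 1000) / (2 * (a * u ^ 2)) ≤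
          (rexp (-(a * u ^ 2 / 4)) - rexp (-(a * u ^ 2 * ((N : ℝ) + 1 / 2) ^ 2))) / (2 * (a * u ^ 2)) +
            1 / 8 := by
        rw [div_add' _ _ _ hb2.ne', div_le_div_iff_of_pos_right hb2]
        nlinarith
      linarith
    exact key.trans hS
  -- integrate the minorant
  have hmcont : ContinuousOn m (Icc 1 U₀) := by
    simp only [hm]
    have hne : ∀ u ∈ Icc (1 : ℝ) U₀, u ≠ 0 := fun u hu ↦ by linarith [hu.1]
    refine ContinuousOn.mul (ContinuousOn.mul continuousOn_const (Real.continuousOn_log.mono fun u hu ↦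
      hne u hu)) ?_
    refine ContinuousOn.sub (ContinuousOn.div continuousOn_const (by fun_prop) fun u hu ↦ ?_)
      continuousOn_const
    have := hne u hu; positivity
  have hsum_int : IntegrableOn (fun u ↦ ∑ n ∈ Finset.range N, ((n : ℝ) + 1) *
      (4 * (rexp (-(a * ((n : ℝ) + 1) ^ 2 * u ^ 2)) * Real.log u))) (Ioc 1 U₀) :=
    integrable_finsetSum (Finset.range N) fun n _ ↦ hint n
  have hmono : ∫ u in Ioc (1 : ℝ) U₀, m u ≤ ∫ u in Ioc (1 : ℝ) U₀, ∑ n ∈ Finset.range N, ((n : ℝ) + 1) *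
      (4 * (rexp (-(a * ((n : ℝ) + 1) ^ 2 * u ^ 2)) * Real.log u)) :=
    setIntegral_mono_on ((hmcont.integrableOn_compact isCompact_Icc).mono_set Ioc_subset_Icc_self)
      hsum_int measurableSet_Ioc fun u hu ↦ hptw u (Ioc_subset_Icc_self hu)
  refine le_trans (le_of_eq ?_) hmono
  -- `∫_1^{U₀} m = Ξ(U₀) − Ξ(1)`
  rw [← intervalIntegral.integral_of_le hU]
  have hd : ∀ u ∈ uIcc (1 : ℝ) U₀, HasDerivAt (fun u ↦ 4 * ((999 / 1000) / (2 * a) * (-(1 + Real.log u) / u) -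
      181 / 1000 * (u * Real.log u - u))) (m u) u := by
    intro u hu
    rw [uIcc_of_le hU] at hu
    have hu0 : u ≠ 0 := by linarith [hu.1]
    have hl := Real.hasDerivAt_log hu0
    have h1 : HasDerivAt (fun u ↦ -(1 + Real.log u) / u) ((-(u⁻¹) * u - -(1 + Real.log u) * 1) / u ^ 2) u :=
      ((hl.const_add 1).neg).div (hasDerivAt_id u) hu0
    have h2 : HasDerivAt (fun u ↦ u * Real.log u - u) (1 * Real.log u + u * u⁻¹ - 1) u :=
      ((hasDerivAt_id u).mul hl).sub (hasDerivAt_id u)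
    have := ((h1.const_mul ((999 / 1000) / (2 * a))).sub (h2.const_mul (181 / 1000))).const_mul 4
    refine this.congr_deriv ?_
    simp only [hm]
    field_simp
    ring
  rw [intervalIntegral.integral_eq_sub_of_hasDerivAt hd (hmcont.intervalIntegrable_of_Icc hU)]
  simp only [Real.log_one, add_zero, div_one, mul_zero, zero_sub]
  field_simp
  ring

/-! ### Lemma 9 (17): `Ĩ₁(q)` termwise and the assembled one-sided bound -/

/-- `Ĩ₁(q) ≤ A⁺ − B⁻` for `q ≥ 3`: the termwise decomposition
`Ĩ₁(q) = Σ_{n≥1} n ∫₁^∞ e^{−πn²t/q} log t (1 − t^{−1/2}) dt` (Tonelli), the `log t`-part bounded above by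
`logPart_summable_and_le` and the `t^{−1/2}`-part (`= Σ n · 4∫₁^∞ e^{−πn²u²/q} log u du`) bounded below
by `sqrtPart_ge` with `U₀ = (15/16)√q`. [folklore] -/
private theorem logMajorantOdd_le_aux {q : ℝ} (hq : 3 ≤ q) :
    logMajorantOdd q ≤
      ((π / q)⁻¹ * ((-(Real.log (π / q) / 2) + eulerMascheroniConstant / 2) * Real.log (6 / 5 / (π / q)) -
          Real.log (6 / 5 / (π / q)) ^ 2 / 4) + 13 / 50 * (6 / 5 / (π / q) - 1) + (π / q)⁻¹ * 0.19525) -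
      (2 * (999 / 1000) * (π / q)⁻¹ * (1 - (1 + Real.log (15 / 16 * Real.sqrt q)) / (15 / 16 * Real.sqrt q)) -
        4 * (181 / 1000) * (15 / 16 * Real.sqrt q * Real.log (15 / 16 * Real.sqrt q) -
          15 / 16 * Real.sqrt q + 1)) := by
  have hq0 : 0 < q := by linarith
  set a : ℝ := π / q with ha_def
  have ha : 0 < a := div_pos Real.pi_pos hq0
  have ha12 : a ≤ 6 / 5 := by
    rw [ha_def, div_le_iff₀ hq0]; nlinarith [Real.pi_lt_d2]
  obtain ⟨hsumA, hAle⟩ := logPart_summable_and_le ha ha12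
  set c : ℕ → ℝ := fun n ↦ a * ((n : ℝ) + 1) ^ 2 with hc
  have hcpos : ∀ n, 0 < c n := fun n ↦ by positivity
  have hcexp : ∀ (n : ℕ) (t : ℝ), π * ((n : ℝ) + 1) ^ 2 * (t / q) = c n * t := fun n t ↦ by
    simp only [hc, ha_def]; field_simp
  set F : ℕ → ℝ → ℝ := fun n t ↦ ((n : ℝ) + 1) * rexp (-(π * ((n : ℝ) + 1) ^ 2 * (t / q))) *
    (Real.log t * (1 - (Real.sqrt t)⁻¹)) with hF
  set K₁ : ℕ → ℝ := fun n ↦ ∫ t in Ioi (1 : ℝ), rexp (-(c n * t)) * Real.log t with hK₁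
  set K₂ : ℕ → ℝ := fun n ↦ ∫ t in Ioi (1 : ℝ), rexp (-(c n * t)) * Real.log t * (Real.sqrt t)⁻¹ with hK₂
  have hFeq : ∀ n t, F n t = ((n : ℝ) + 1) * (rexp (-(c n * t)) * Real.log t -
      rexp (-(c n * t)) * Real.log t * (Real.sqrt t)⁻¹) := by
    intro n t; simp only [hF, hcexp]; ring
  have hI1 : ∀ n, IntegrableOn (fun t ↦ rexp (-(c n * t)) * Real.log t) (Ioi 1) := fun n ↦
    integrableOn_exp_mul_log (hcpos n)
  have hsqrt : ∀ t : ℝ, 1 < t → (Real.sqrt t)⁻¹ ≤ 1 := fun t ht ↦ by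
    refine inv_le_one_of_one_le₀ ?_
    rw [show (1:ℝ) = Real.sqrt 1 by simp]; exact Real.sqrt_le_sqrt ht.le
  have hI2 : ∀ n, IntegrableOn (fun t ↦ rexp (-(c n * t)) * Real.log t * (Real.sqrt t)⁻¹) (Ioi 1) := by
    intro n
    refine Integrable.mono' (hI1 n) ?_ ?_
    · refine ContinuousOn.aestronglyMeasurable (fun t (ht : 1 < t) ↦ ?_) measurableSet_Ioi
      have ht0 : 0 < t := by linarith
      exact ((((by fun_prop : Continuous fun t ↦ rexp (-(c n * t))).continuousAt.mul
        (Real.continuousAt_log ht0.ne')).mul ((Real.continuous_sqrt.continuousAt).inv₀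
        (Real.sqrt_pos.mpr ht0).ne'))).continuousWithinAt
    · refine (ae_restrict_iff' measurableSet_Ioi).mpr (ae_of_all _ fun t (ht : 1 < t) ↦ ?_)
      have h0 : 0 ≤ Real.log t := Real.log_nonneg ht.le
      have hs := hsqrt t ht
      rw [Real.norm_eq_abs, abs_of_nonneg (by positivity)]
      calc rexp (-(c n * t)) * Real.log t * (Real.sqrt t)⁻¹ ≤ rexp (-(c n * t)) * Real.log t * 1 := by
            gcongr
        _ = _ := mul_one _
  have hFint : ∀ n, IntegrableOn (F n) (Ioi 1) := fun n ↦ by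
    have h3 : IntegrableOn (fun t ↦ ((n : ℝ) + 1) * (rexp (-(c n * t)) * Real.log t -
        rexp (-(c n * t)) * Real.log t * (Real.sqrt t)⁻¹)) (Ioi 1) := ((hI1 n).sub (hI2 n)).const_mul _
    exact IntegrableOn.congr_fun h3 (fun t _ ↦ (hFeq n t).symm) measurableSet_Ioi
  have hFval : ∀ n, ∫ t in Ioi (1 : ℝ), F n t = ((n : ℝ) + 1) * (K₁ n - K₂ n) := by
    intro n
    rw [setIntegral_congr_fun measurableSet_Ioi (fun t _ ↦ hFeq n t), integral_const_mul,
      integral_sub (hI1 n) (hI2 n)]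
  have hFnn : ∀ n, ∀ t ∈ Ioi (1 : ℝ), 0 ≤ F n t := fun n t (ht : 1 < t) ↦ by
    simp only [hF]
    have h0 : 0 ≤ Real.log t := Real.log_nonneg ht.le
    have : 0 ≤ 1 - (Real.sqrt t)⁻¹ := by linarith [hsqrt t ht]
    positivity
  have hK₂nn : ∀ n, 0 ≤ K₂ n := fun n ↦ setIntegral_nonneg measurableSet_Ioi fun t (ht : 1 < t) ↦ by
    have : 0 ≤ Real.log t := Real.log_nonneg ht.le; positivity
  have hK₂le : ∀ n, K₂ n ≤ K₁ n := by
    intro n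
    refine setIntegral_mono_on (hI2 n) (hI1 n) measurableSet_Ioi fun t (ht : 1 < t) ↦ ?_
    have h0 : 0 ≤ Real.log t := Real.log_nonneg ht.le
    have hs := hsqrt t ht
    calc rexp (-(c n * t)) * Real.log t * (Real.sqrt t)⁻¹ ≤ rexp (-(c n * t)) * Real.log t * 1 := by gcongr
      _ = _ := mul_one _
  have hsumA' : Summable fun n : ℕ ↦ ((n : ℝ) + 1) * K₁ n := by
    refine hsumA.congr fun n ↦ ?_
    simp only [hK₁, hc]
  have hsumB : Summable fun n : ℕ ↦ ((n : ℝ) + 1) * K₂ n :=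
    Summable.of_nonneg_of_le (fun n ↦ by have := hK₂nn n; positivity)
      (fun n ↦ mul_le_mul_of_nonneg_left (hK₂le n) (by positivity)) hsumA'
  -- Tonelli
  have hnorm : ∀ n, ∫ t in Ioi (1 : ℝ), ‖F n t‖ = ((n : ℝ) + 1) * (K₁ n - K₂ n) := fun n ↦ by
    rw [← hFval n]
    exact setIntegral_congr_fun measurableSet_Ioi fun t ht ↦ by
      rw [Real.norm_eq_abs, abs_of_nonneg (hFnn n t ht)]
  have hsumF : Summable fun n : ℕ ↦ ∫ t in Ioi (1 : ℝ), ‖F n t‖ := by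
    refine (hsumA'.sub hsumB).congr fun n ↦ ?_
    rw [hnorm n]; ring
  have hHS := hasSum_integral_of_summable_integral_norm (μ := volume.restrict (Ioi (1 : ℝ)))
    (F := F) hFint hsumF
  have hpt : ∫ t in Ioi (1 : ℝ), (∑' n, F n t) = logMajorantOdd q := by
    refine setIntegral_congr_fun measurableSet_Ioi fun t (ht : 1 < t) ↦ ?_
    have htq : 0 < t / q := div_pos (by linarith) hq0
    have := (hasSum_thetaMajorOdd htq).mul_right (Real.log t * (1 - (Real.sqrt t)⁻¹))
    simpa only [hF] using this.tsum_eq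
  have hI : logMajorantOdd q = (∑' n : ℕ, ((n : ℝ) + 1) * K₁ n) - ∑' n : ℕ, ((n : ℝ) + 1) * K₂ n := by
    rw [← hpt, ← hHS.tsum_eq, tsum_congr hFval, ← hsumA'.tsum_sub hsumB]
    exact tsum_congr fun n ↦ by ring
  -- the `t^{−1/2}`-part from below
  set U₀ : ℝ := 15 / 16 * Real.sqrt q with hU₀
  have hsq3 : (16 / 15 : ℝ) < Real.sqrt q := by
    rw [show (16 / 15 : ℝ) = Real.sqrt ((16 / 15) ^ 2) by rw [Real.sqrt_sq (by norm_num)]]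
    exact Real.sqrt_lt_sqrt (by norm_num) (by nlinarith)
  have hU₀1 : 1 ≤ U₀ := by rw [hU₀]; nlinarith
  obtain ⟨N, hN⟩ := exists_nat_gt (Real.sqrt (7 / a))
  have hN7 : 7 ≤ a * ((N : ℝ) + 1 / 2) ^ 2 := by
    have h0 : 0 ≤ Real.sqrt (7 / a) := Real.sqrt_nonneg _
    have h1 : Real.sqrt (7 / a) ^ 2 = 7 / a := Real.sq_sqrt (by positivity)
    have h2 : Real.sqrt (7 / a) ≤ (N : ℝ) + 1 / 2 := by linarith
    have h3 : 7 / a ≤ ((N : ℝ) + 1 / 2) ^ 2 := by rw [← h1]; exact pow_le_pow_left₀ h0 h2 2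
    rwa [div_le_iff₀' ha] at h3
  have hB := sqrtPart_ge ha hU₀1 hN7
  have hK₂eq : ∀ n, K₂ n = 4 * ∫ u in Ioi (1 : ℝ), rexp (-(c n * u ^ 2)) * Real.log u := fun n ↦
    integral_exp_mul_log_inv_sqrt (hcpos n)
  have hBsum : ∑ n ∈ Finset.range N, ((n : ℝ) + 1) *
      (4 * ∫ u in Ioi (1 : ℝ), rexp (-(a * ((n : ℝ) + 1) ^ 2 * u ^ 2)) * Real.log u) ≤
      ∑' n : ℕ, ((n : ℝ) + 1) * K₂ n := by
    have e : ∀ n : ℕ, ((n : ℝ) + 1) * (4 * ∫ u in Ioi (1 : ℝ), rexp (-(a * ((n : ℝ) + 1) ^ 2 * u ^ 2)) *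
        Real.log u) = ((n : ℝ) + 1) * K₂ n := fun n ↦ by rw [hK₂eq]
    rw [Finset.sum_congr rfl fun n _ ↦ e n]
    exact hsumB.sum_le_tsum _ fun n _ ↦ by have := hK₂nn n; positivity
  -- assemble
  have hA' : ∑' n : ℕ, ((n : ℝ) + 1) * K₁ n ≤ a⁻¹ * ((-(Real.log a / 2) + eulerMascheroniConstant / 2) *
      Real.log (6 / 5 / a) - Real.log (6 / 5 / a) ^ 2 / 4) + 13 / 50 * (6 / 5 / a - 1) + a⁻¹ * 0.19525 := by
    have e : (fun n : ℕ ↦ ((n : ℝ) + 1) * K₁ n) = fun n : ℕ ↦ ((n : ℝ) + 1) *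
        ∫ t in Ioi (1 : ℝ), rexp (-(a * ((n : ℝ) + 1) ^ 2 * t)) * Real.log t := by
      funext n; simp only [hK₁, hc]
    rw [e]; exact hAle
  rw [hI]
  linarith

/-! ### Lemma 9 (17): the final elementary inequality, in the variable `λ = ½ log q` -/

/-- `c₁ = log π − γ`. [folklore] -/
private def c17a : ℝ := Real.log π - eulerMascheroniConstant

/-- `D = (ℓ̂ − log π)(ℓ̂ + log π − 2γ)/4 + 1.49075`, `ℓ̂ = 11/60 ≥ log(6/5)`. [folklore] -/
private def c17D : ℝ := (11 / 60 - Real.log π) * (11 / 60 + Real.log π - 2 * eulerMascheroniConstant) / 4 +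
  1.49075

/-- `c₂ = 2·0.999/(πκ) + 0.724κ`, `κ = 15/16`. [folklore] -/
private def c17b : ℝ := 2 * (999 / 1000) / (π * (15 / 16)) + 4 * (181 / 1000) * (15 / 16)

/-- `c₃ = −(2·0.999/(πκ))(1 + ℓ̂κ) − 0.724κ ℓ̂κ + 0.724κ`, `ℓ̂κ = −1/16 ≥ log(15/16)`. [folklore] -/
private def c17c : ℝ := -(2 * (999 / 1000) / (π * (15 / 16))) * (1 + -1 / 16) -
  4 * (181 / 1000) * (15 / 16) * (-1 / 16) + 4 * (181 / 1000) * (15 / 16)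

/-- `g(λ) = e^{2λ}(c₁λ + D)/π + e^{λ}(−c₂λ + c₃) − 0.464 = e^{2λ}λ²/π − (A⁺ − B⁻)(q = e^{2λ})`. [folklore] -/
private def g17 (x : ℝ) : ℝ := rexp (2 * x) * ((c17a * x + c17D) / π) + rexp x * (-c17b * x + c17c) - 0.464

/-- `g′(λ)`. [folklore] -/
private def g17' (x : ℝ) : ℝ :=
  rexp (2 * x) * ((2 * (c17a * x + c17D) + c17a) / π) + rexp x * (-c17b * x + c17c - c17b)

/-- `g` is differentiable with derivative `g′`. [folklore] -/
private theorem hasDerivAt_g17 (x : ℝ) : HasDerivAt g17 (g17' x) x := by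
  have h2 : HasDerivAt (fun x ↦ rexp (2 * x)) (rexp (2 * x) * 2) x := by
    have := ((hasDerivAt_id x).const_mul (2 : ℝ)).exp
    simpa using this
  have h1 : HasDerivAt (fun x ↦ rexp x) (rexp x) x := Real.hasDerivAt_exp x
  have hp : HasDerivAt (fun x ↦ (c17a * x + c17D) / π) (c17a * 1 / π) x :=
    (((hasDerivAt_id x).const_mul c17a).add_const c17D).div_const π
  have hq : HasDerivAt (fun x ↦ -c17b * x + c17c) (-c17b * 1) x :=
    ((hasDerivAt_id x).const_mul (-c17b)).add_const c17c
  have := ((h2.mul hp).add (h1.mul hq)).sub_const (0.464 : ℝ)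
  refine (this.congr_of_eventuallyEq (Eventually.of_forall fun y ↦ rfl)).congr_deriv ?_
  simp only [g17']
  field_simp
  ring

/-- Bounds for the constants. [folklore] -/
private theorem c17_bounds : 0.567514 ≤ c17a ∧ 1.44901 ≤ c17D ∧ c17b ≤ 1.357133 ∧ 0.085188 ≤ c17c ∧
    c17a ≤ 0.567515 ∧ c17c ≤ 0.08519 ∧ 1.35713 ≤ c17b := by
  have hγ1 := Literature.Analysis.SpecialFunctions.Real.eulerMascheroniConstant_lt_d8
  have hγ2 := Literature.Analysis.SpecialFunctions.Real.eulerMascheroniConstant_gt_d8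
  have hπ1 := Literature.Analysis.SpecialFunctions.Real.log_pi_gt_d20
  have hπ2 := Literature.Analysis.SpecialFunctions.Real.log_pi_lt_d20
  have hp1 := Real.pi_gt_d6
  have hp2 := Real.pi_lt_d6
  have hA : 0.96139 ≤ Real.log π - 11 / 60 := by norm_num at hπ1 ⊢; linarith
  have hA' : Real.log π - 11 / 60 ≤ 0.9614 := by norm_num at hπ2 ⊢; linarith
  have hB : 11 / 60 + Real.log π - 2 * eulerMascheroniConstant ≤ 0.17364 := by
    norm_num at hπ2 hγ2 ⊢; linarith
  have hB0 : 0 ≤ 11 / 60 + Real.log π - 2 * eulerMascheroniConstant := by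
    norm_num at hπ1 hγ1 ⊢; linarith
  have hprod : (Real.log π - 11 / 60) * (11 / 60 + Real.log π - 2 * eulerMascheroniConstant) ≤
      0.9614 * 0.17364 := mul_le_mul hA' hB hB0 (by norm_num)
  have hinvπ1 : π⁻¹ ≤ 1 / 3.141592 := by
    rw [one_div]; exact inv_anti₀ (by norm_num) hp1.le
  have hinvπ2 : 1 / 3.141593 ≤ π⁻¹ := by
    rw [one_div]; exact inv_anti₀ Real.pi_pos hp2.le
  refine ⟨?_, ?_, ?_, ?_, ?_, ?_, ?_⟩
  · unfold c17a; norm_num at hγ1 hπ1 ⊢; linarith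
  · unfold c17D; norm_num at hprod ⊢; nlinarith
  · unfold c17b; rw [div_mul_eq_div_div, div_eq_mul_inv _ π]; norm_num at hinvπ1 ⊢; nlinarith
  · unfold c17c; rw [div_mul_eq_div_div, div_eq_mul_inv _ π]; norm_num at hinvπ1 ⊢; nlinarith
  · unfold c17a; norm_num at hγ2 hπ2 ⊢; linarith
  · unfold c17c; rw [div_mul_eq_div_div, div_eq_mul_inv _ π]; norm_num at hinvπ2 ⊢; nlinarith
  · unfold c17b; rw [div_mul_eq_div_div, div_eq_mul_inv _ π]; norm_num at hinvπ2 ⊢; nlinarith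

/-- `g′(λ) ≥ 0` for `λ ≥ 0.5487` (`e^{λ} ≥ 1 + λ + λ²/2`). [folklore] -/
private theorem g17'_nonneg {x : ℝ} (hx : 0.5487 ≤ x) : 0 ≤ g17' x := by
  obtain ⟨ha, hD, hb, hc, -, -, -⟩ := c17_bounds
  have hp2 := Real.pi_lt_d6
  have hinvπ2 : 1 / 3.141593 ≤ π⁻¹ := by
    rw [one_div]; exact inv_anti₀ Real.pi_pos hp2.le
  have hE := Real.exp_pos x
  have hE1 : 1 + x + x ^ 2 / 2 ≤ rexp x := by
    have := Real.quadratic_le_exp_of_nonneg (by linarith : 0 ≤ x); linarith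
  -- `M(λ) = (2(c₁λ + D) + c₁)/π ≥ 0.36128 λ + 1.1031`, `N(λ) = c₂λ − c₃ + c₂ ≤ 1.357133 λ + 1.271945`
  have hM : 0.36128 * x + 1.1031 ≤ (2 * (c17a * x + c17D) + c17a) / π := by
    rw [div_eq_mul_inv]
    have h1 : 1.13502 * x + 3.465534 ≤ 2 * (c17a * x + c17D) + c17a := by nlinarith
    have h0 : 0 ≤ 1.13502 * x + 3.465534 := by linarith
    calc 0.36128 * x + 1.1031 ≤ (1.13502 * x + 3.465534) * (1 / 3.141593) := by norm_num; nlinarith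
      _ ≤ _ := mul_le_mul h1 hinvπ2 (by norm_num) (by linarith)
  have hN : -c17b * x + c17c - c17b ≥ -(1.357133 * x + 1.271945) := by nlinarith
  have e : g17' x = rexp x * (rexp x * ((2 * (c17a * x + c17D) + c17a) / π) + (-c17b * x + c17c - c17b)) := by
    simp only [g17']
    rw [show (2 : ℝ) * x = x + x by ring, Real.exp_add]
    ring
  rw [e]
  refine mul_nonneg hE.le ?_
  have hMx : 0 ≤ 0.36128 * x + 1.1031 := by linarith
  have h3 : (1 + x + x ^ 2 / 2) * (0.36128 * x + 1.1031) ≤ rexp x * ((2 * (c17a * x + c17D) + c17a) / π) :=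
    mul_le_mul hE1 hM hMx hE.le
  have hx0 : 0 ≤ x - 0.5487 := by linarith
  nlinarith [mul_nonneg hx0 hx0, mul_nonneg (mul_nonneg hx0 hx0) hx0]

/-- `g(½ log 3) ≥ 0` (`e^{log 3} = 3`, `e^{½ log 3} = √3`, `½ log 3 ≤ 0.54983`). [folklore] -/
private theorem g17_nonneg_base : 0 ≤ g17 (Real.log 3 / 2) := by
  obtain ⟨ha, hD, hb, hc, ha', -, -⟩ := c17_bounds
  have hp1 := Real.pi_gt_d6
  have hp2 := Real.pi_lt_d6
  have hinvπ2 : 1 / 3.141593 ≤ π⁻¹ := by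
    rw [one_div]; exact inv_anti₀ Real.pi_pos hp2.le
  have e2 : rexp (2 * (Real.log 3 / 2)) = 3 := by
    rw [show 2 * (Real.log 3 / 2) = Real.log 3 by ring, Real.exp_log (by norm_num)]
  have e1 : rexp (Real.log 3 / 2) = Real.sqrt 3 := by
    rw [show Real.log 3 / 2 = Real.log (Real.sqrt 3) by
      rw [Real.log_sqrt (by norm_num)], Real.exp_log (Real.sqrt_pos.mpr (by norm_num))]
  -- `½ log 3 ≤ 0.54983` from `log 3 = log π + log(3/π) ≤ log π + 3/π − 1`
  have hl3 : Real.log 3 / 2 ≤ 0.54983 := by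
    have h1 : Real.log (3 / π) ≤ 3 / π - 1 := Real.log_le_sub_one_of_pos (by positivity)
    have h2 : Real.log 3 = Real.log π + Real.log (3 / π) := by
      rw [Real.log_div (by norm_num) Real.pi_pos.ne']; ring
    have hπl := Literature.Analysis.SpecialFunctions.Real.log_pi_lt_d20
    have h3 : 3 / π ≤ 3 / 3.141592 := div_le_div_of_nonneg_left (by norm_num) (by norm_num) hp1.le
    norm_num at hπl h3 ⊢; linarith
  have hl30 : 0 ≤ Real.log 3 / 2 := by have := Real.log_nonneg (by norm_num : (1:ℝ) ≤ 3); linarith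
  have hs3 : Real.sqrt 3 ≤ 1.732051 := by
    rw [show (1.732051 : ℝ) = Real.sqrt (1.732051 ^ 2) by rw [Real.sqrt_sq (by norm_num)]]
    exact Real.sqrt_le_sqrt (by norm_num)
  have hs3' : 1.73205 ≤ Real.sqrt 3 := by
    rw [show (1.73205 : ℝ) = Real.sqrt (1.73205 ^ 2) by rw [Real.sqrt_sq (by norm_num)]]
    exact Real.sqrt_le_sqrt (by norm_num)
  unfold g17
  rw [e2, e1]
  set x := Real.log 3 / 2 with hx
  -- `3 (c₁ x + D)/π ≥ 3(c₁x + D)/3.141593`, `√3(−c₂ x + c₃) ≥ −1.732051 (1.357133 x − 0.085188)`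
  have hP0 : 0 ≤ c17a * x + c17D := by nlinarith
  have hP : 3 * (c17a * x + c17D) * (1 / 3.141593) ≤ 3 * ((c17a * x + c17D) / π) := by
    rw [div_eq_mul_inv _ π]; nlinarith
  have hQ : 0 ≤ 1.357133 * x - 0.085188 := by
    have : 0.5487 ≤ x := by
      have h1 : 1 - π / 3 ≤ Real.log (3 / π) := by
        have := Real.one_sub_inv_le_log_of_pos (by positivity : (0 : ℝ) < 3 / π)
        rw [inv_div] at this; exact this
      have h2 : Real.log 3 = Real.log π + Real.log (3 / π) := by
        rw [Real.log_div (by norm_num) Real.pi_pos.ne']; ring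
      have hπl := Literature.Analysis.SpecialFunctions.Real.log_pi_gt_d20
      norm_num at hπl ⊢; nlinarith
    linarith
  have hQ' : -(1.732051 * (1.357133 * x - 0.085188)) ≤ Real.sqrt 3 * (-c17b * x + c17c) := by
    have h1 : -(1.357133 * x - 0.085188) ≤ -c17b * x + c17c := by nlinarith
    nlinarith
  norm_num at hP hQ' ⊢
  nlinarith

/-- `g(λ) ≥ 0` for `λ ≥ ½ log 3`. [folklore] -/
private theorem g17_nonneg {x : ℝ} (hx : Real.log 3 / 2 ≤ x) : 0 ≤ g17 x := by
  have hl3 : 0.5487 ≤ Real.log 3 / 2 := by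
    have h1 : 1 - π / 3 ≤ Real.log (3 / π) := by
      have := Real.one_sub_inv_le_log_of_pos (by positivity : (0 : ℝ) < 3 / π)
      rw [inv_div] at this; exact this
    have h2 : Real.log 3 = Real.log π + Real.log (3 / π) := by
      rw [Real.log_div (by norm_num) Real.pi_pos.ne']; ring
    have hπl := Literature.Analysis.SpecialFunctions.Real.log_pi_gt_d20
    have hp2 := Real.pi_lt_d6
    norm_num at hπl hp2 ⊢; nlinarith
  have hmono := le_of_deriv_nonneg hx (fun t _ ↦ hasDerivAt_g17 t)
    fun t ht ↦ g17'_nonneg (by linarith [ht.1])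
  exact g17_nonneg_base.trans hmono


/-- The algebraic identity behind `logMajorantOdd_le_sharp`: the bound of `logMajorantOdd_le_aux` with
`log(6/5) ↦ 11/60`, `log(15/16) ↦ −1/16`, written with `E = √q`, `x = ½ log q`, equals `E²x²/π − g(x)`. [folklore] -/
private theorem aux_identity_g17 {E x : ℝ} (hE : 0 < E) (hEx : rexp x = E) :
    E ^ 2 / π * ((-((Real.log π - 2 * x) / 2) + eulerMascheroniConstant / 2) * (11 / 60 - Real.log π + 2 * x) -
        (11 / 60 - Real.log π + 2 * x) ^ 2 / 4) + 13 / 50 * (6 / 5 * (E ^ 2 / π) - 1) + E ^ 2 / π * 0.19525 -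
      (2 * (999 / 1000) * (E ^ 2 / π) * (1 - (1 + (-1 / 16 + x)) / (15 / 16 * E)) -
        4 * (181 / 1000) * (15 / 16 * E * (-1 / 16 + x) - 15 / 16 * E + 1)) =
      E ^ 2 / π * x ^ 2 - g17 x := by
  have h2 : rexp (2 * x) = E ^ 2 := by rw [← hEx, ← Real.exp_nat_mul]; push_cast; ring_nf
  simp only [g17, c17a, c17D, c17b, c17c, h2, hEx]
  have hπ := Real.pi_pos.ne'
  field_simp
  ring

/-- **Louboutin 2006, Lemma 9 (17), odd case, with the printed right-hand side**: for every real `q ≥ 3`,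
**`Ĩ₁(q) = ∫₁^∞ ϑ⁺(t/q) (log t)(1 − t^{−1/2}) dt ≤ (q/4π) log² q`**. The source obtains
`Ĩ₁(f) = (f/4π)((log f − κ₁′)² + κ₁″) + ¼√f (log f + κ₁′) + ¼ + θK̃₁/√(π⁵f)` by a contour shift and then bounds it by
`(f/4π) log² f`; here the same bound is proved elementarily: the theta series is integrated termwise
(`logMajorantOdd_le_aux`: `Σ n⁻¹∫ S₁`-type upper bound with the exact `γ/2`, minus the midpoint-rule lower bound for
the `t^{−1/2}`-part), and the resulting explicit inequality is `g(½ log q) ≥ 0` (`g17_nonneg`), whose margin is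
`≈ 0.07` at `q = 3` and grows like `(log π − γ) q log q/(2π)`. Supersedes the tree's `logMajorantOdd_le`
(`(q/4π)(log q + ½)²`). [cite: Louboutin2006RelativeClassNumbers, Lemma 9 (17) p. 206] -/
theorem logMajorantOdd_le_sharp {q : ℝ} (hq : 3 ≤ q) :
    logMajorantOdd q ≤ q / (4 * π) * Real.log q ^ 2 := by
  have hq0 : 0 < q := by linarith
  have h := logMajorantOdd_le_aux hq
  set x : ℝ := Real.log q / 2 with hx
  have hE2 : rexp (2 * x) = q := by rw [hx, show 2 * (Real.log q / 2) = Real.log q by ring, Real.exp_log hq0]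
  set E : ℝ := rexp x with hE
  have hE0 : 0 < E := Real.exp_pos x
  have hEsq : E ^ 2 = q := by rw [hE, ← Real.exp_nat_mul]; push_cast; exact hE2
  have hsqrt : Real.sqrt q = E := by rw [← hEsq, Real.sqrt_sq hE0.le]
  have hlogq : Real.log q = 2 * x := by rw [hx]; ring
  have hx3 : Real.log 3 / 2 ≤ x := by
    rw [hx]; exact div_le_div_of_nonneg_right (Real.log_le_log (by norm_num) hq) (by norm_num)
  have hx0 : 0 ≤ x := le_trans (by have := Real.log_nonneg (by norm_num : (1:ℝ) ≤ 3); positivity) hx3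
  -- rewrite the bound of `logMajorantOdd_le_aux` in terms of `x` and `E`
  have e1 : (π / q)⁻¹ = E ^ 2 / π := by rw [inv_div, hEsq]
  have e2 : Real.log (π / q) = Real.log π - 2 * x := by
    rw [Real.log_div Real.pi_pos.ne' hq0.ne', hlogq]
  have e3 : Real.log (6 / 5 / (π / q)) = Real.log (6 / 5) - Real.log π + 2 * x := by
    rw [Real.log_div (by norm_num) (div_pos Real.pi_pos hq0).ne', e2]; ring
  have e4 : 6 / 5 / (π / q) = 6 / 5 * (E ^ 2 / π) := by rw [div_eq_mul_inv (6 / 5 : ℝ), e1]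
  have e5 : Real.log (15 / 16 * Real.sqrt q) = Real.log (15 / 16) + x := by
    rw [hsqrt, Real.log_mul (by norm_num) hE0.ne', hE, Real.log_exp]
  rw [e1, e2, e3, e4, e5, hsqrt] at h
  -- monotone substitutions `log(6/5) ≤ 11/60`, `log(15/16) ≤ −1/16`
  have hl1 : Real.log (6 / 5) ≤ 11 / 60 := by
    have := two_mul_log_le (y := 6 / 5) (by norm_num); norm_num at this ⊢; linarith
  have hl1' : 0 ≤ Real.log (6 / 5) := Real.log_nonneg (by norm_num)
  have hl2 : Real.log (15 / 16) ≤ -1 / 16 := by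
    have := Real.log_le_sub_one_of_pos (by norm_num : (0 : ℝ) < 15 / 16); norm_num at this ⊢; linarith
  have hγ := Literature.Analysis.SpecialFunctions.Real.eulerMascheroniConstant_gt_d8
  have hA : (-((Real.log π - 2 * x) / 2) + eulerMascheroniConstant / 2) * (Real.log (6 / 5) - Real.log π + 2 * x) -
      (Real.log (6 / 5) - Real.log π + 2 * x) ^ 2 / 4 ≤
      (-((Real.log π - 2 * x) / 2) + eulerMascheroniConstant / 2) * (11 / 60 - Real.log π + 2 * x) -
        (11 / 60 - Real.log π + 2 * x) ^ 2 / 4 := by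
    have hcoef : 0 ≤ eulerMascheroniConstant / 2 - (11 / 60 + Real.log (6 / 5)) / 4 := by
      norm_num at hγ ⊢; linarith
    have hd : 0 ≤ 11 / 60 - Real.log (6 / 5) := by linarith
    have key : (-((Real.log π - 2 * x) / 2) + eulerMascheroniConstant / 2) * (11 / 60 - Real.log π + 2 * x) -
        (11 / 60 - Real.log π + 2 * x) ^ 2 / 4 -
        ((-((Real.log π - 2 * x) / 2) + eulerMascheroniConstant / 2) * (Real.log (6 / 5) - Real.log π + 2 * x) -
          (Real.log (6 / 5) - Real.log π + 2 * x) ^ 2 / 4) =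
        (11 / 60 - Real.log (6 / 5)) * (eulerMascheroniConstant / 2 - (11 / 60 + Real.log (6 / 5)) / 4) := by
      ring
    nlinarith [mul_nonneg hd hcoef]
  have hB : 2 * (999 / 1000) * (E ^ 2 / π) * (1 - (1 + (-1 / 16 + x)) / (15 / 16 * E)) -
      4 * (181 / 1000) * (15 / 16 * E * (-1 / 16 + x) - 15 / 16 * E + 1) ≤
      2 * (999 / 1000) * (E ^ 2 / π) * (1 - (1 + (Real.log (15 / 16) + x)) / (15 / 16 * E)) -
      4 * (181 / 1000) * (15 / 16 * E * (Real.log (15 / 16) + x) - 15 / 16 * E + 1) := by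
    have hd : 0 ≤ -1 / 16 - Real.log (15 / 16) := by linarith
    have hc1 : 0 ≤ 2 * (999 / 1000) * (E ^ 2 / π) / (15 / 16 * E) := by positivity
    have hc2 : 0 ≤ 4 * (181 / 1000) * (15 / 16 * E) := by positivity
    have key : 2 * (999 / 1000) * (E ^ 2 / π) * (1 - (1 + (Real.log (15 / 16) + x)) / (15 / 16 * E)) -
        4 * (181 / 1000) * (15 / 16 * E * (Real.log (15 / 16) + x) - 15 / 16 * E + 1) -
        (2 * (999 / 1000) * (E ^ 2 / π) * (1 - (1 + (-1 / 16 + x)) / (15 / 16 * E)) -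
        4 * (181 / 1000) * (15 / 16 * E * (-1 / 16 + x) - 15 / 16 * E + 1)) =
        (-1 / 16 - Real.log (15 / 16)) * (2 * (999 / 1000) * (E ^ 2 / π) / (15 / 16 * E) +
          4 * (181 / 1000) * (15 / 16 * E)) := by
      field_simp
      ring
    nlinarith [mul_nonneg hd (add_nonneg hc1 hc2)]
  have hid := aux_identity_g17 hE0 hE.symm
  have hg := g17_nonneg hx3
  have hfin : E ^ 2 / π * x ^ 2 = q / (4 * π) * Real.log q ^ 2 := by
    rw [hEsq, hlogq]; ring
  rw [← hfin]
  have hE2π : 0 ≤ E ^ 2 / π := by positivity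
  have hA' := mul_le_mul_of_nonneg_left hA hE2π
  linarith

/-! ### Theorem 1 (ii), odd quadratic case, with the printed `log² q` -/

/-- `ϑ⁺` is antitone on `(0, ∞)`. [folklore] -/
private theorem thetaMajorOdd_antitoneOn : AntitoneOn thetaMajorOdd (Ioi 0) := by
  intro u (hu : 0 < u) v (hv : 0 < v) huv
  refine hasSum_le (fun n ↦ ?_) (hasSum_thetaMajorOdd hv) (hasSum_thetaMajorOdd hu)
  refine mul_le_mul_of_nonneg_left (Real.exp_le_exp.mpr ?_) (by positivity)
  have : 0 ≤ π * ((n : ℝ) + 1) ^ 2 := by positivity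
  nlinarith

/-- `ϑ⁺(u) ≤ e^{−πu}/(1 − e^{−πu})²` for `u > 0` (`n² ≥ n`). [folklore] -/
private theorem thetaMajorOdd_le_geom' {u : ℝ} (hu : 0 < u) :
    thetaMajorOdd u ≤ rexp (-(π * u)) / (1 - rexp (-(π * u))) ^ 2 := by
  set r : ℝ := rexp (-(π * u)) with hr
  have hr0 : 0 ≤ r := (Real.exp_pos _).le
  have hr1 : r < 1 := Real.exp_lt_one_iff.mpr (by have := Real.pi_pos; nlinarith)
  have hnr : ‖r‖ < 1 := by rw [Real.norm_eq_abs, abs_of_nonneg hr0]; exact hr1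
  have hS : HasSum (fun n : ℕ ↦ (n : ℝ) * r ^ n) (r / (1 - r) ^ 2) := hasSum_coe_mul_geometric_of_norm_lt_one hnr
  have hS' : HasSum (fun n : ℕ ↦ ((n : ℝ) + 1) * r ^ (n + 1)) (r / (1 - r) ^ 2) := by
    have h0 := (hasSum_nat_add_iff' 1).mpr hS
    simp only [Finset.range_one, Finset.sum_singleton, Nat.cast_zero, zero_mul, sub_zero] at h0
    refine h0.congr_fun fun n ↦ ?_
    push_cast; ring
  refine hasSum_le (fun n ↦ ?_) (hasSum_thetaMajorOdd hu) hS'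
  refine mul_le_mul_of_nonneg_left ?_ (by positivity)
  rw [hr, ← Real.exp_nat_mul, Real.exp_le_exp]
  push_cast
  have h1 : (n : ℝ) + 1 ≤ ((n : ℝ) + 1) ^ 2 := by nlinarith [n.cast_nonneg (α := ℝ)]
  have : 0 < π * u := by positivity
  nlinarith

/-- The integrand of `Ĩ₁(Q)` is integrable on `(1, ∞)` for real `Q ≥ 1`. [folklore] -/
private theorem integrableOn_logMajorantOdd_integrand' {Q : ℝ} (hQ : 1 ≤ Q) :
    IntegrableOn (fun t ↦ thetaMajorOdd (t / Q) * (Real.log t * (1 - (Real.sqrt t)⁻¹))) (Ioi 1) := by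
  have hQ0 : 0 < Q := by linarith
  set c : ℝ := π / Q with hc
  have hc0 : 0 < c := div_pos Real.pi_pos hQ0
  set r₁ : ℝ := rexp (-c) with hr₁
  have hr₁1 : r₁ < 1 := Real.exp_lt_one_iff.mpr (by linarith)
  have hC : 0 < (1 - r₁) ^ 2 := by nlinarith
  -- domination by `C · t e^{−ct}`
  have hI0 : IntegrableOn (fun t : ℝ ↦ ((1 - r₁) ^ 2)⁻¹ * (t * rexp (-(c * t)))) (Ioi 1) := by
    have := integrableOn_rpow_mul_exp_neg_mul_rpow (s := 1) (p := 1) (by norm_num) le_rfl hc0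
    refine ((this.mono_set (Ioi_subset_Ioi zero_le_one)).congr_fun (fun t (ht : 1 < t) ↦ ?_)
      measurableSet_Ioi).const_mul _
    simp only [Real.rpow_one, neg_mul]
  refine Integrable.mono' hI0 ?_ ?_
  · refine AEStronglyMeasurable.mul ?_ ?_
    · have hanti : AntitoneOn (fun t : ℝ ↦ thetaMajorOdd (t / Q)) (Ioi 1) := by
        intro u (hu : 1 < u) v (hv : 1 < v) huv
        exact thetaMajorOdd_antitoneOn (div_pos (by linarith) hQ0 : 0 < u / Q)
          (div_pos (by linarith) hQ0 : 0 < v / Q) (div_le_div_of_nonneg_right huv hQ0.le)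
      exact (aemeasurable_restrict_of_antitoneOn measurableSet_Ioi hanti).aestronglyMeasurable
    · refine ContinuousOn.aestronglyMeasurable (fun t (ht : 1 < t) ↦ ?_) measurableSet_Ioi
      have ht0 : 0 < t := by linarith
      exact ((Real.continuousAt_log ht0.ne').mul (continuousAt_const.sub
        ((Real.continuous_sqrt.continuousAt).inv₀ (Real.sqrt_pos.mpr ht0).ne'))).continuousWithinAt
  · refine (ae_restrict_iff' measurableSet_Ioi).mpr (ae_of_all _ fun t (ht : 1 < t) ↦ ?_)
    have ht0 : 0 < t := by linarith
    have htQ : 0 < t / Q := div_pos ht0 hQ0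
    have hlog0 : 0 ≤ Real.log t := Real.log_nonneg ht.le
    have hlog : Real.log t ≤ t := (Real.log_le_sub_one_of_pos ht0).trans (by linarith)
    have hs1 : 1 ≤ Real.sqrt t := by
      rw [show (1:ℝ) = Real.sqrt 1 by simp]; exact Real.sqrt_le_sqrt ht.le
    have hs : (Real.sqrt t)⁻¹ ≤ 1 := inv_le_one_of_one_le₀ hs1
    have hw0 : 0 ≤ 1 - (Real.sqrt t)⁻¹ := by linarith
    have hw : Real.log t * (1 - (Real.sqrt t)⁻¹) ≤ t := by
      calc Real.log t * (1 - (Real.sqrt t)⁻¹) ≤ t * 1 :=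
            mul_le_mul hlog (by linarith [inv_nonneg.mpr (Real.sqrt_nonneg t)]) hw0 ht0.le
        _ = t := mul_one t
    have hθ := thetaMajorOdd_le_geom' htQ
    have hct : π * (t / Q) = c * t := by rw [hc]; field_simp
    rw [hct] at hθ
    -- `e^{−ct} ≤ r₁` for `t ≥ 1`, so `(1 − e^{−ct})² ≥ (1 − r₁)²`
    have hr : rexp (-(c * t)) ≤ r₁ := by rw [hr₁, Real.exp_le_exp]; nlinarith
    have hden : (1 - r₁) ^ 2 ≤ (1 - rexp (-(c * t))) ^ 2 := by
      have := Real.exp_pos (-(c * t)); nlinarith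
    have hθ' : thetaMajorOdd (t / Q) ≤ rexp (-(c * t)) / (1 - r₁) ^ 2 :=
      hθ.trans (div_le_div_of_nonneg_left (Real.exp_pos _).le hC hden)
    have hT0 := thetaMajorOdd_nonneg (t / Q)
    rw [Real.norm_eq_abs, abs_of_nonneg (by positivity)]
    calc thetaMajorOdd (t / Q) * (Real.log t * (1 - (Real.sqrt t)⁻¹))
        ≤ rexp (-(c * t)) / (1 - r₁) ^ 2 * t := mul_le_mul hθ' hw (by positivity) (by positivity)
      _ = ((1 - r₁) ^ 2)⁻¹ * (t * rexp (-(c * t))) := by rw [div_eq_mul_inv]; ring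

section DirichletZeroSharp

open DirichletCharacter DirichletTheta

variable {q : ℕ} [NeZero q] {χ : DirichletCharacter ℂ q}

/-- `∫₀^∞ y^a ϑ₁(y, χ) dy` converges absolutely for every real `a`. [folklore] -/
private theorem integrableOn_rpow_mul_dirichletTheta_one' (χ : DirichletCharacter ℂ q) (a : ℝ) :
    IntegrableOn (fun y : ℝ ↦ ((y ^ a : ℝ) : ℂ) * dirichletTheta 1 χ y) (Ioi 0) := by
  have h := mellinConvergent_dirichletTheta_one χ ((a : ℂ) + 1)
  rw [MellinConvergent] at h
  refine h.congr_fun (fun y (hy : 0 < y) ↦ ?_) measurableSet_Ioi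
  show (y : ℂ) ^ ((a : ℂ) + 1 - 1) • dirichletTheta 1 χ y = _
  rw [smul_eq_mul, add_sub_cancel_right, Complex.ofReal_cpow hy.le]

/-- **Louboutin 2006, Theorem 1 (ii) (3), ODD quadratic case, AS PRINTED** (for `β ≥ ½`): for an odd quadratic
primitive `χ` mod `q`, `½ ≤ β ≤ 1` and `L(β, χ) = 0` imply **`|L(1, χ)| ≤ (1 − β) log² q/8`**
(Lemma 3 (4): `2Λ(1) = ∫₁^∞ (K(t,1) − K(t,β)) ϑ₁`, `0 ≤ K(t,1) − K(t,β) ≤ (1 − β)(log t)(1 − t^{−1/2})/2`,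
`|ϑ₁| ≤ 2ϑ⁺`, and (17) in the form `logMajorantOdd_le_sharp`).
[cite: Louboutin2006RelativeClassNumbers, Thm 1 (3) p. 200] -/
theorem norm_LFunction_one_le_of_zero_of_odd_of_half_le_sharp (hprim : χ.IsPrimitive) (hodd : χ.Odd)
    (hquad : χ.IsQuadratic) {β : ℝ} (hβ : 1 / 2 ≤ β) (hβ1 : β ≤ 1) (hzero : χ.LFunction β = 0) :
    ‖χ.LFunction 1‖ ≤ (1 - β) * Real.log q ^ 2 / 8 := by
  have hχ : χ ≠ 1 := ne_one_of_odd_sharp hodd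
  have hκ : charParity χ = 1 := charParity_of_odd hodd
  have hq0 : (0 : ℝ) < q := by exact_mod_cast NeZero.pos q
  have hq3 : (3 : ℝ) ≤ q := by
    have h2 : q ≠ 1 := by rintro rfl; exact hχ χ.level_one
    have h2' : q ≠ 2 := by
      rintro rfl
      have h : χ (-1) = -1 := hodd
      have : (-1 : ZMod 2) = 1 := by decide
      rw [this, map_one] at h
      norm_num at h
    have : 3 ≤ q := by have := NeZero.ne q; omega
    exact_mod_cast this
  have hxiβ : dirichletXi χ β = 0 := by
    refine (dirichletXi_eq_zero_iff hχ fun n h ↦ ?_).mpr hzero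
    rw [hκ, Nat.cast_one] at h
    have := congrArg Complex.re h
    simp at this
    have : (0 : ℝ) ≤ n := n.cast_nonneg
    linarith
  have h1 := two_mul_dirichletXi_eq_integral_xiKernelOdd hprim hodd hquad 1
  have hβ' := two_mul_dirichletXi_eq_integral_xiKernelOdd hprim hodd hquad β
  rw [hxiβ, mul_zero] at hβ'
  have hIk : ∀ σ : ℝ, IntegrableOn (fun t : ℝ ↦ ((xiKernelOdd t σ : ℝ) : ℂ) * dirichletTheta 1 χ t) (Ioi 1) := by
    intro σ
    have hI1 : IntegrableOn (fun y : ℝ ↦ ((y ^ ((σ - 1) / 2) : ℝ) : ℂ) * dirichletTheta 1 χ y) (Ioi 1) :=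
      (integrableOn_rpow_mul_dirichletTheta_one' χ _).mono_set (Ioi_subset_Ioi zero_le_one)
    have hI2 : IntegrableOn (fun y : ℝ ↦ ((y ^ (-σ / 2) : ℝ) : ℂ) * dirichletTheta 1 χ y) (Ioi 1) :=
      (integrableOn_rpow_mul_dirichletTheta_one' χ _).mono_set (Ioi_subset_Ioi zero_le_one)
    refine (hI1.add hI2).congr_fun (fun t _ ↦ ?_) measurableSet_Ioi
    simp only [xiKernelOdd, Pi.add_apply]; push_cast; ring
  rw [Complex.ofReal_one] at h1
  have hdiff : 2 * dirichletXi χ 1 =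
      ∫ t in Ioi (1 : ℝ), (((xiKernelOdd t 1 - xiKernelOdd t β : ℝ)) : ℂ) * dirichletTheta 1 χ t := by
    have : ∫ t in Ioi (1 : ℝ), (((xiKernelOdd t 1 - xiKernelOdd t β : ℝ)) : ℂ) * dirichletTheta 1 χ t =
        (∫ t in Ioi (1 : ℝ), ((xiKernelOdd t 1 : ℝ) : ℂ) * dirichletTheta 1 χ t) -
        ∫ t in Ioi (1 : ℝ), ((xiKernelOdd t β : ℝ) : ℂ) * dirichletTheta 1 χ t := by
      rw [← integral_sub (hIk 1) (hIk β)]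
      refine setIntegral_congr_fun measurableSet_Ioi fun t _ ↦ ?_
      push_cast; ring
    rw [this, ← h1, ← hβ', sub_zero]
  have hq1 : (1 : ℝ) ≤ q := by linarith
  have hmaj : ‖2 * dirichletXi χ 1‖ ≤ (1 - β) * logMajorantOdd q := by
    rw [hdiff, logMajorantOdd, ← integral_const_mul]
    refine norm_integral_le_of_norm_le ((integrableOn_logMajorantOdd_integrand' hq1).const_mul _) ?_
    refine (ae_restrict_iff' measurableSet_Ioi).mpr (ae_of_all _ fun t (ht : 1 < t) ↦ ?_)
    have ht0 : 0 < t := by linarith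
    obtain ⟨hlo, hhi⟩ := xiKernelOdd_one_sub_le ht.le hβ hβ1
    rw [norm_mul, Complex.norm_real, Real.norm_eq_abs, abs_of_nonneg hlo]
    have hθ := norm_dirichletTheta_one_le hodd ht0
    have hT0 : 0 ≤ thetaMajorOdd (t / q) := thetaMajorOdd_nonneg _
    calc (xiKernelOdd t 1 - xiKernelOdd t β) * ‖dirichletTheta 1 χ t‖
        ≤ ((1 - β) * (Real.log t * (1 - (Real.sqrt t)⁻¹) / 2)) * (2 * thetaMajorOdd (t / q)) :=
          mul_le_mul hhi hθ (norm_nonneg _) (by nlinarith)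
      _ = (1 - β) * (thetaMajorOdd (t / q) * (Real.log t * (1 - (Real.sqrt t)⁻¹))) := by ring
  have hM := logMajorantOdd_le_sharp hq3
  rw [norm_mul, Complex.norm_ofNat, norm_dirichletXi_one_of_odd hodd] at hmaj
  have h1β : 0 ≤ 1 - β := by linarith
  have hqπ : 0 < (q : ℝ) / π := div_pos hq0 Real.pi_pos
  have : 2 * ((q : ℝ) / π * ‖χ.LFunction 1‖) ≤ (1 - β) * ((q : ℝ) / (4 * π) * Real.log q ^ 2) :=
    hmaj.trans (mul_le_mul_of_nonneg_left hM h1β)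
  have e : (1 - β) * ((q : ℝ) / (4 * π) * Real.log q ^ 2) =
      (q : ℝ) / π * (2 * ((1 - β) * Real.log q ^ 2 / 8)) := by ring
  rw [e, ← mul_assoc, mul_comm 2 ((q : ℝ) / π), mul_assoc] at this
  have := le_of_mul_le_mul_left this hqπ
  linarith

/-- **Louboutin 2006, Theorem 1 (ii) (3), ODD quadratic case, AS PRINTED:** for an odd quadratic primitive `χ`
mod `q`, `0 < β < 1` and `L(β, χ) = 0` imply **`|L(1, χ)| ≤ (1 − β) log² q/8`** (the case `β < ½` is reduced to
`1 − β` by the functional equation (5) with `W(χ) = 1`). Supersedes the tree's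
`norm_LFunction_one_le_of_zero_of_odd` (`(1 − β)(log q + ½)²/8`). [cite: Louboutin2006RelativeClassNumbers, Thm 1 (3) p. 200] -/
theorem norm_LFunction_one_le_of_zero_of_odd_sharp (hprim : χ.IsPrimitive) (hodd : χ.Odd)
    (hquad : χ.IsQuadratic) {β : ℝ} (hβ0 : 0 < β) (hβ1 : β < 1) (hzero : χ.LFunction β = 0) :
    ‖χ.LFunction 1‖ ≤ (1 - β) * Real.log q ^ 2 / 8 := by
  rcases le_or_gt (1 / 2 : ℝ) β with hβ | hβ
  · exact norm_LFunction_one_le_of_zero_of_odd_of_half_le_sharp hprim hodd hquad hβ hβ1.le hzero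
  · have hχ : χ ≠ 1 := ne_one_of_odd_sharp hodd
    have hκ : charParity χ = 1 := charParity_of_odd hodd
    have hε : rootNumber χ = 1 := PrimitiveQuadratic.rootNumber_eq_one_of_isQuadratic hprim hquad
    have hxiβ : dirichletXi χ β = 0 := by
      refine (dirichletXi_eq_zero_iff hχ fun n h ↦ ?_).mpr hzero
      rw [hκ, Nat.cast_one] at h
      have := congrArg Complex.re h
      simp at this
      have : (0 : ℝ) ≤ n := n.cast_nonneg
      linarith
    have hfe := dirichletXi_eq_rootNumber_mul_dirichletXi_inv_one_sub hprim (β : ℂ)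
    rw [hxiβ, hε, one_mul, hquad.inv] at hfe
    have hzero' : χ.LFunction ((1 - β : ℝ) : ℂ) = 0 := by
      push_cast
      refine (dirichletXi_eq_zero_iff hχ fun n h ↦ ?_).mp hfe.symm
      rw [hκ, Nat.cast_one] at h
      have := congrArg Complex.re h
      simp at this
      have : (0 : ℝ) ≤ n := n.cast_nonneg
      linarith
    have h := norm_LFunction_one_le_of_zero_of_odd_of_half_le_sharp hprim hodd hquad (β := 1 - β)
      (by linarith) (by linarith) hzero'
    have hlog : 0 ≤ Real.log (q : ℝ) ^ 2 := sq_nonneg _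
    nlinarith

end DirichletZeroSharp

end Louboutin2001

end Literature.NumberTheory.LFunctions
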